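/-
Copyright (c) 2026 the pub-hodgecm-mathlib formalisation cell (harness21).  Prover seat hodgecm-mathlib-F0P3a-p02 (g18): road «S3-ram» (LEAD F0P3a-plan (g13);
architect A-p16 (g32); junction pen F0P3a-p01 (g17), J-PACK v2 (f) isoceles wave), HYP-PLAN v1 (F0P3a-p04 (g19)) node (V5) — the (V2)→(V4) LINE-COUNT JUNCTION; 2026-09-02.
-/
import Literature.NumberTheory.Automorphic.UnitaryLatticeTreeIsocelesVertexLineCountsRamified       -- ★ (V2) p848264 (LH4-p02): κ-keyed null ∕ class counts from the SHAPE; brings ★ G3⁗ bridge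
import Literature.NumberTheory.Automorphic.UnitaryLatticeTreeIsocelesVertexShapeRamified            -- ★ (V1) p848273 (F0P3a-p04): the residual SHAPE at an adapted region vertex
import Literature.NumberTheory.Automorphic.UnitaryLatticeTreeIsocelesAdaptedFrameRamified           -- ★ (V0) p848308 (F0P3a-p04): `map_antidiagonal_three_over_apply_eq`
import Literature.NumberTheory.Automorphic.UnitaryLatticeTreeIsocelesRegionLinesRamified            -- ★ p847884∕p848140 (F0P3-p03): §7 value shape, LINE TEST κ-keyed
import Literature.NumberTheory.Automorphic.UnitaryLatticeTreeBlockGluing                           -- ★ `v_pairing_comm_of_hermitian`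
import Literature.NumberTheory.Automorphic.UnitaryLatticeTreeFixedChildCountTransportRamified       -- ★ `latticeGraphIso_one_apply`, `latticeGraphIso_mul_apply`
import Literature.NumberTheory.Automorphic.UnitaryLatticeTreeFixedGrandchildrenCountRamified        -- ★ `forall_v_conj_sub_one_le_iff_map_sub_one_le_scaleLattice` (F0P2-p06)
import Literature.NumberTheory.Rogawski1990.DepthZeroKappaTransferTypeOneRamifiedTreeInduction      -- ★ G5 (this lineage); brings ★ `exists_rooted_parent`
import HarnessLib

/-!
# The ramified type-(1) `κ`-orbital integral, HYPERBOLIC ISOCELES LITERALS: the κ-keyed LINE COUNTS of a non-root region vertex (HYP-PLAN node (V5), junction (V2)→(V4))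

Topic `NumberTheory/Rogawski1990`; namespace `Literature.NumberTheory.Rogawski1990.HyperbolicJunction`.  THEOREMS ONLY (no definition, no instance, no notation, no named
fact, no `sorry`); kernel lane `--supports stmt-HodgeConjecture-24833`.  Cell `pub/hodgecm-mathlib` (D-0151), crux H413; road «S3-ram» (count-neutral), P-1-ram organ A′ (ii)
(a2), ISO sockets S45 v4 (`F0/P3a/F0P3a-p02/g17/iso/JunctionSocketsS45.statementfirst.v4.F0P3ap02g17.lean` bc98a4a1) :46 `row_S45_hyperbolic`, HYP-PLAN v1
(`F0/P3a/F0P3a-p04/g19/hyp/HYP-PLAN.v1.F0P3ap04g19.md` 94da2402).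

THE MATHEMATICS.  At a region vertex `v = u·r₀ ≠ r₀` of a hyperbolic isoceles literal, with ADAPTED frame `u` (the inward child is `u·N₁`, ★ (V0)), the children are the
`(uκ)·N₁`, `κ ∈ K₀`; a child is a REGION DIRECTION iff its line `(uκ)e₀` is residually orthogonal to `A e_{i₀}` and `ϖ^{s'} A e_k` (★ LINE TEST), and its depth-`d₀`
VALUE `(ϖ^{d₀})⁻¹⟨κe₀, (u⁻¹γu − 1)κe₀⟩` is NULL or a unit of one of the two classes `−c₁`, `−c₁ε`.  §1: a region direction has null value (★ §7 value shape: off the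
`(s_j − 1)⟨x,x⟩` term, which vanishes on the isotropic `x = (uκ)e₀`, the value is `α·N(λ(x)) + β·N(μ(x))` with `|α| = |β| = |ϖ|^{d₀}` and `|λ(x)|, |μ(x)| < 1`); the region-
direction test depends only on the child (`A e_{i₀}, ϖ^{s'}A e_k ∈ child`).  §2: hence ★ (V4)'s three OUTWARD κ-keyed sets are: `E = NULL ∖ REGDIR` (the inward child is a
region direction), `P = CLASS(−c₁)`, `M = CLASS(−c₁ε)` (all children), and the latter are ★ (V2)'s residue-test sets.  §3: with ★ (V1)'s shape `(c, t, l)` and ★ (V2)'s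
counts: INTERIOR (`l = 0`, two region directions) `(νE, νP, νM) = (0, (q−1)[lock], (q−1)[¬lock])`; END (`l ≠ 0`, one region direction) `νE = 2[BIG]`,
`2νP = q−3 ∣ q−1 ∣ q−1 ∣ q+1`, `2νM = q−1 ∣ q+1 ∣ q−3 ∣ q−1` in the cases `(lock, BIG) = (1,1) ∣ (1,0) ∣ (0,1) ∣ (0,0)` — `lock`, `BIG` the S45 v4 texts (class of the
ROOT-LINE value `C`, resp. square class of the END constant `B`, read through ★ (V1)'s pins).  The number of region directions enters as a HYPOTHESIS `hRD` (★-pending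
(V3)(i), LH4-p02) in ★ §12's spelling.
HONEST LABEL: HC_CM is proved only modulo the 2 remaining named inputs (hLiu418 24832, h413 24833) until rung 0 closes; nothing printed is asserted here (lattice
bookkeeping over ★ results); «S3-ram» is Literature seeding, count-neutral.

## References
* [Kottwitz1986] R. E. Kottwitz, *Base change for unit elements of Hecke algebras*, Compositio Math. 60 (1986), §3 (counting fixed lattices shell by shell).
* [Rogawski1990] J. D. Rogawski, *Automorphic Representations of Unitary Groups in Three Variables*, Ann. of Math. Stud. 123 (1990), §4.9 Prop. 4.9.1 pp. 54–56.
* [BruhatTits1972] F. Bruhat, J. Tits, *Groupes réductifs sur un corps local I*, Publ. Math. IHÉS 41 (1972), §10 (lattice models of the building).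
* [Serre1980Trees] J.-P. Serre, *Trees* (1980), I.2.3, II.1.1.
-/

set_option autoImplicit false

noncomputable section

open scoped Valued WithZero Matrix MatrixGroups
open Polynomial Classical SimpleGraph
open Literature.NumberTheory.Automorphic Literature.NumberTheory.Automorphic.HermitianLattice Literature.NumberTheory.Automorphic.UnitaryLatticeTree
open Literature.Combinatorics.SimpleGraph.TreeLayers

namespace Literature.NumberTheory.Rogawski1990.HyperbolicJunction

variable {K : Type*} [Field K] [Valued K ℤᵐ⁰] {σ : K →+* K} {ϖ : K}

/-! ## §1 A region direction has null value; the region-direction test depends only on the child -/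

/-- **A REGION DIRECTION HAS NULL VALUE.**  For `γ = A·diag(s)·A⁻¹` isoceles at `i₀` with close-pair gap `d₀ + 2s'` (unit Gram `κ₀·diag d`), any `u, κ ∈ U(Φ₃)`: if the
line `x = (uκ)e₀` satisfies `|⟨x, A e_{i₀}⟩| < 1` and `|⟨x, ϖ^{s'}A e_k⟩| < 1`, then `|(ϖ^{d₀})⁻¹⟨κe₀, (u⁻¹γu − 1)κe₀⟩| < 1` (★ §7: `⟨x,(γ−1)x⟩ = α N(⟨Ae_{i₀},x⟩) +
β N(⟨ϖ^{s'}Ae_k, x⟩)` on the isotropic `x`, `|α| = |β| = |ϖ|^{d₀}`). [cite: Kottwitz1986, §3] [cite: BruhatTits1972, §10] -/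
theorem v_lineValue_lt_one_of_regDir (hσ : ∀ x, σ (σ x) = x) (hvσ : ∀ a, Valued.v (σ a) = Valued.v a) (hϖ : Valued.v ϖ = WithZero.exp (-1 : ℤ))
    {γ : unitaryGroupOfForm σ ((StdForm.antidiagonal 3).over K)} {d : Fin 3 → K} (hd : ∀ i, Valued.v (d i) = 1)
    (A : GL (Fin 3) K) (hdA : Matrix.diagonal d = (-(Matrix.diagonal d).det) • formCongr σ A ((StdForm.antidiagonal 3).over K))
    (s : Fin 3 → K) (hγA : ((γ : GL (Fin 3) K) : Matrix (Fin 3) (Fin 3) K) = (A : Matrix (Fin 3) (Fin 3) K) * Matrix.diagonal s * ((A⁻¹ : GL (Fin 3) K) : Matrix (Fin 3) (Fin 3) K))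
    (i₀ : Fin 3) {d₀ : ℕ} (hiso : ∀ m, m ≠ i₀ → Valued.v (s i₀ - s m) = Valued.v ϖ ^ d₀)
    {s' : ℕ} (hgap : ∀ j k, j ≠ i₀ → k ≠ i₀ → j ≠ k → Valued.v (s j - s k) = Valued.v ϖ ^ (d₀ + 2 * s')) {k : Fin 3} (hk : k ≠ i₀)
    (u κ : unitaryGroupOfForm σ ((StdForm.antidiagonal 3).over K)) (hRD : (Valued.v (pairing σ ((StdForm.antidiagonal 3).over K) ((((u * κ : unitaryGroupOfForm σ ((StdForm.antidiagonal 3).over K)) : GL (Fin 3) K) : Matrix (Fin 3) (Fin 3) K) *ᵥ Pi.single 0 1) ((A : Matrix (Fin 3) (Fin 3) K) *ᵥ Pi.single i₀ 1)) < 1 ∧ Valued.v (pairing σ ((StdForm.antidiagonal 3).over K) ((((u * κ : unitaryGroupOfForm σ ((StdForm.antidiagonal 3).over K)) : GL (Fin 3) K) : Matrix (Fin 3) (Fin 3) K) *ᵥ Pi.single 0 1) (ϖ ^ s' • ((A : Matrix (Fin 3) (Fin 3) K) *ᵥ Pi.single k 1))) < 1)) :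
    Valued.v ((ϖ ^ d₀)⁻¹ * pairing σ ((StdForm.antidiagonal 3).over K) (((κ : GL (Fin 3) K) : Matrix (Fin 3) (Fin 3) K) *ᵥ Pi.single 0 1) (((((u⁻¹ * γ * u : unitaryGroupOfForm σ ((StdForm.antidiagonal 3).over K)) : GL (Fin 3) K) : Matrix (Fin 3) (Fin 3) K) - 1) *ᵥ (((κ : GL (Fin 3) K) : Matrix (Fin 3) (Fin 3) K) *ᵥ Pi.single 0 1))) < 1 := by
  have hϖ0 : ϖ ≠ 0 := fun h0 => by rw [h0, map_zero] at hϖ; exact WithZero.coe_ne_zero hϖ.symm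
  have hvϖ0 : Valued.v ϖ ≠ 0 := (Valuation.ne_zero_iff _).2 hϖ0
  have hd0 : ∀ i, d i ≠ 0 := fun i h0 => by have := hd i; rw [h0, map_zero] at this; exact zero_ne_one this
  -- the third index
  obtain ⟨j, hj, hjk⟩ : ∃ j : Fin 3, j ≠ i₀ ∧ j ≠ k := by
    rcases (fin_three_eq_or i₀ k).1 with h | h | h
    · exact absurd h hk
    · exact ⟨i₀ + 2, (fin_three_eq_or i₀ k).2.2.1, by rw [h]; exact (fin_three_eq_or i₀ k).2.2.2.symm⟩
    · exact ⟨i₀ + 1, (fin_three_eq_or i₀ k).2.1, by rw [h]; exact (fin_three_eq_or i₀ k).2.2.2⟩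
  -- transport along `u`: the value is `(ϖ^d₀)⁻¹⟨x, (γ−1)x⟩`, `x = (uκ)e₀`
  have hU : (((u⁻¹ * γ * u : unitaryGroupOfForm σ ((StdForm.antidiagonal 3).over K)) : GL (Fin 3) K) : Matrix (Fin 3) (Fin 3) K) = (((u⁻¹ : unitaryGroupOfForm σ ((StdForm.antidiagonal 3).over K)) : GL (Fin 3) K) : Matrix (Fin 3) (Fin 3) K) * ((γ : GL (Fin 3) K) : Matrix (Fin 3) (Fin 3) K) * ((u : GL (Fin 3) K) : Matrix (Fin 3) (Fin 3) K) := by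
    rw [Subgroup.coe_mul, Subgroup.coe_mul, Units.val_mul, Units.val_mul]
  have hUI : (((u⁻¹ : unitaryGroupOfForm σ ((StdForm.antidiagonal 3).over K)) : GL (Fin 3) K) : Matrix (Fin 3) (Fin 3) K) = (((u : GL (Fin 3) K) : Matrix (Fin 3) (Fin 3) K))⁻¹ := by rw [Subgroup.coe_inv, Matrix.coe_units_inv]
  have hUdet : IsUnit (((u : GL (Fin 3) K) : Matrix (Fin 3) (Fin 3) K)).det := Matrix.isUnits_det_units _
  have hUIU : ∀ y : Fin 3 → K, (((u⁻¹ : unitaryGroupOfForm σ ((StdForm.antidiagonal 3).over K)) : GL (Fin 3) K) : Matrix (Fin 3) (Fin 3) K) *ᵥ (((u : GL (Fin 3) K) : Matrix (Fin 3) (Fin 3) K) *ᵥ y) = y := fun y => by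
    rw [Matrix.mulVec_mulVec, hUI, Matrix.nonsing_inv_mul _ hUdet, Matrix.one_mulVec]
  have hUUI : ∀ y : Fin 3 → K, ((u : GL (Fin 3) K) : Matrix (Fin 3) (Fin 3) K) *ᵥ ((((u⁻¹ : unitaryGroupOfForm σ ((StdForm.antidiagonal 3).over K)) : GL (Fin 3) K) : Matrix (Fin 3) (Fin 3) K) *ᵥ y) = y := fun y => by
    rw [Matrix.mulVec_mulVec, hUI, Matrix.mul_nonsing_inv _ hUdet, Matrix.one_mulVec]
  have hxu : (((u * κ : unitaryGroupOfForm σ ((StdForm.antidiagonal 3).over K)) : GL (Fin 3) K) : Matrix (Fin 3) (Fin 3) K) *ᵥ Pi.single 0 1 = ((u : GL (Fin 3) K) : Matrix (Fin 3) (Fin 3) K) *ᵥ (((κ : GL (Fin 3) K) : Matrix (Fin 3) (Fin 3) K) *ᵥ Pi.single 0 1) := by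
    rw [Subgroup.coe_mul, Units.val_mul, ← Matrix.mulVec_mulVec]
  have hMx : ((((u⁻¹ * γ * u : unitaryGroupOfForm σ ((StdForm.antidiagonal 3).over K)) : GL (Fin 3) K) : Matrix (Fin 3) (Fin 3) K) - 1) *ᵥ (((κ : GL (Fin 3) K) : Matrix (Fin 3) (Fin 3) K) *ᵥ Pi.single 0 1) = (((u⁻¹ : unitaryGroupOfForm σ ((StdForm.antidiagonal 3).over K)) : GL (Fin 3) K) : Matrix (Fin 3) (Fin 3) K) *ᵥ ((((γ : GL (Fin 3) K) : Matrix (Fin 3) (Fin 3) K) - 1) *ᵥ (((u : GL (Fin 3) K) : Matrix (Fin 3) (Fin 3) K) *ᵥ (((κ : GL (Fin 3) K) : Matrix (Fin 3) (Fin 3) K) *ᵥ Pi.single 0 1))) := by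
    rw [Matrix.sub_mulVec, Matrix.one_mulVec, hU, ← Matrix.mulVec_mulVec, ← Matrix.mulVec_mulVec, Matrix.sub_mulVec, Matrix.one_mulVec, Matrix.mulVec_sub, hUIU]
  have hval : pairing σ ((StdForm.antidiagonal 3).over K) (((κ : GL (Fin 3) K) : Matrix (Fin 3) (Fin 3) K) *ᵥ Pi.single 0 1) (((((u⁻¹ * γ * u : unitaryGroupOfForm σ ((StdForm.antidiagonal 3).over K)) : GL (Fin 3) K) : Matrix (Fin 3) (Fin 3) K) - 1) *ᵥ (((κ : GL (Fin 3) K) : Matrix (Fin 3) (Fin 3) K) *ᵥ Pi.single 0 1)) = pairing σ ((StdForm.antidiagonal 3).over K) ((((u * κ : unitaryGroupOfForm σ ((StdForm.antidiagonal 3).over K)) : GL (Fin 3) K) : Matrix (Fin 3) (Fin 3) K) *ᵥ Pi.single 0 1) ((((γ : GL (Fin 3) K) : Matrix (Fin 3) (Fin 3) K) - 1) *ᵥ ((((u * κ : unitaryGroupOfForm σ ((StdForm.antidiagonal 3).over K)) : GL (Fin 3) K) : Matrix (Fin 3) (Fin 3) K) *ᵥ Pi.single 0 1)) := by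
    rw [hMx, ← pairing_mulVec_mulVec_of_mem_unitary u.2 (((κ : GL (Fin 3) K) : Matrix (Fin 3) (Fin 3) K) *ᵥ Pi.single 0 1), hUUI, ← hxu]
  -- `x` is isotropic
  have hpair_e0 : ∀ y : Fin 3 → K, pairing σ ((StdForm.antidiagonal 3).over K) y (Pi.single 0 1) = σ (y 2) := fun y => by
    rw [pairing_antidiagonal, B₀_apply, Fin.sum_univ_three, show Fin.rev (0 : Fin 3) = 2 from rfl, show Fin.rev (1 : Fin 3) = 1 from rfl,
      show Fin.rev (2 : Fin 3) = 0 from rfl]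
    simp
  have hx0 : pairing σ ((StdForm.antidiagonal 3).over K) ((((u * κ : unitaryGroupOfForm σ ((StdForm.antidiagonal 3).over K)) : GL (Fin 3) K) : Matrix (Fin 3) (Fin 3) K) *ᵥ Pi.single 0 1) ((((u * κ : unitaryGroupOfForm σ ((StdForm.antidiagonal 3).over K)) : GL (Fin 3) K) : Matrix (Fin 3) (Fin 3) K) *ᵥ Pi.single 0 1) = 0 := by
    rw [pairing_mulVec_mulVec_of_mem_unitary (u * κ).2, hpair_e0]; simp
  -- ★ §7 at `x`
  have h7 := pairing_sub_one_mulVec_sub_eq_norm_add_norm hσ hϖ0 A hd0 hdA s hγA hj hk hjk s' ((((u * κ : unitaryGroupOfForm σ ((StdForm.antidiagonal 3).over K)) : GL (Fin 3) K) : Matrix (Fin 3) (Fin 3) K) *ᵥ Pi.single 0 1)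
  rw [hx0, mul_zero, sub_zero] at h7
  have hH : ∀ a b, σ (((StdForm.antidiagonal 3).over K) a b) = ((StdForm.antidiagonal 3).over K) b a := map_antidiagonal_three_over_apply_eq σ
  have hp : Valued.v (pairing σ ((StdForm.antidiagonal 3).over K) ((A : Matrix (Fin 3) (Fin 3) K) *ᵥ Pi.single i₀ 1) ((((u * κ : unitaryGroupOfForm σ ((StdForm.antidiagonal 3).over K)) : GL (Fin 3) K) : Matrix (Fin 3) (Fin 3) K) *ᵥ Pi.single 0 1)) < 1 := by
    rw [v_pairing_comm_of_hermitian hvσ hσ hH]; exact hRD.1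
  have hq : Valued.v (pairing σ ((StdForm.antidiagonal 3).over K) (ϖ ^ s' • ((A : Matrix (Fin 3) (Fin 3) K) *ᵥ Pi.single k 1)) ((((u * κ : unitaryGroupOfForm σ ((StdForm.antidiagonal 3).over K)) : GL (Fin 3) K) : Matrix (Fin 3) (Fin 3) K) *ᵥ Pi.single 0 1)) < 1 := by
    rw [v_pairing_comm_of_hermitian hvσ hσ hH]; exact hRD.2
  have hα := v_shapeCoeff_i₀_eq hvσ hd s hj hiso
  have hβ := v_shapeCoeff_k_eq hvσ hϖ hd s hj hk hjk hgap
  have hpos : (0 : ℤᵐ⁰) < Valued.v ϖ ^ d₀ := pow_pos (zero_lt_iff.2 hvϖ0) _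
  have hlt : Valued.v (pairing σ ((StdForm.antidiagonal 3).over K) ((((u * κ : unitaryGroupOfForm σ ((StdForm.antidiagonal 3).over K)) : GL (Fin 3) K) : Matrix (Fin 3) (Fin 3) K) *ᵥ Pi.single 0 1) ((((γ : GL (Fin 3) K) : Matrix (Fin 3) (Fin 3) K) - 1) *ᵥ ((((u * κ : unitaryGroupOfForm σ ((StdForm.antidiagonal 3).over K)) : GL (Fin 3) K) : Matrix (Fin 3) (Fin 3) K) *ᵥ Pi.single 0 1))) < Valued.v ϖ ^ d₀ := by
    rw [h7]
    refine lt_of_le_of_lt (Valuation.map_add _ _ _) (max_lt ?_ ?_)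
    · rw [map_mul, map_mul, hα, hvσ]
      refine mul_lt_of_lt_one_right hpos ?_
      calc Valued.v _ * Valued.v _ < 1 * 1 := mul_lt_mul'' hp hp zero_le zero_le
        _ = 1 := one_mul 1
    · rw [map_mul, map_mul, hβ, hvσ]
      refine mul_lt_of_lt_one_right hpos ?_
      calc Valued.v _ * Valued.v _ < 1 * 1 := mul_lt_mul'' hq hq zero_le zero_le
        _ = 1 := one_mul 1
  rw [map_mul, map_inv₀, map_pow, hval, inv_mul_lt_iff₀ hpos, mul_one]
  exact hlt

/-- **THE REGION-DIRECTION TEST DEPENDS ONLY ON THE CHILD**: for `κ ∈ K₀` and `y ∈ v = u·r₀`, `|⟨(uκ)e₀, y⟩| < 1 ↔ y ∈ (uκ)·N₁` (★ `mem_mapGL_N₁_iff` transported by `u`).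
[cite: BruhatTits1972, §10] [cite: Serre1980Trees, II.1.1] -/
theorem v_pairing_lt_one_iff_mem_child (hσϖ : σ ϖ = -ϖ) (hϖ : Valued.v ϖ = WithZero.exp (-1 : ℤ))
    (u : unitaryGroupOfForm σ ((StdForm.antidiagonal 3).over K)) {κ : unitaryGroupOfForm σ ((StdForm.antidiagonal 3).over K)} (hκ : κ ∈ unitaryInt σ ((StdForm.antidiagonal 3).over K)) {y : Fin 3 → K} (hy : y ∈ (latticeGraphIso σ ϖ ((StdForm.antidiagonal 3).over K) u ⟨stdLattice K 3, 0, isSelfDualLattice_stdLattice_three_of_v hϖ⟩ : {M : Submodule 𝒪[K] (Fin 3 → K) // IsVertex σ ϖ ((StdForm.antidiagonal 3).over K) M}).1) :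
    Valued.v (pairing σ ((StdForm.antidiagonal 3).over K) ((((u * κ : unitaryGroupOfForm σ ((StdForm.antidiagonal 3).over K)) : GL (Fin 3) K) : Matrix (Fin 3) (Fin 3) K) *ᵥ Pi.single 0 1) y) < 1 ↔ y ∈ (latticeGraphIso σ ϖ ((StdForm.antidiagonal 3).over K) (u * κ) ⟨latt (Matrix.diagonal ![(1 : K), 1, ϖ]), 2, isVertexLattice_two_N₁_of_neg hσϖ hϖ⟩ : {M : Submodule 𝒪[K] (Fin 3 → K) // IsVertex σ ϖ ((StdForm.antidiagonal 3).over K) M}).1 := by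
  have hϖ0 : ϖ ≠ 0 := fun h0 => by rw [h0, map_zero] at hϖ; exact WithZero.coe_ne_zero hϖ.symm
  have hy0 : (((u : GL (Fin 3) K)⁻¹ : GL (Fin 3) K) : Matrix (Fin 3) (Fin 3) K) *ᵥ y ∈ stdLattice K 3 := by
    rw [latticeGraphIso_apply_val, mem_mapGL_iff] at hy; exact hy
  have hxu : (((u * κ : unitaryGroupOfForm σ ((StdForm.antidiagonal 3).over K)) : GL (Fin 3) K) : Matrix (Fin 3) (Fin 3) K) *ᵥ Pi.single 0 1 = ((u : GL (Fin 3) K) : Matrix (Fin 3) (Fin 3) K) *ᵥ (((κ : GL (Fin 3) K) : Matrix (Fin 3) (Fin 3) K) *ᵥ Pi.single 0 1) := by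
    rw [Subgroup.coe_mul, Units.val_mul, ← Matrix.mulVec_mulVec]
  rw [latticeGraphIso_apply_val, Subgroup.coe_mul, mapGL_mul, mem_mapGL_iff]
  change _ ↔ (((u : GL (Fin 3) K)⁻¹ : GL (Fin 3) K) : Matrix (Fin 3) (Fin 3) K) *ᵥ y ∈ mapGL (κ : GL (Fin 3) K) (latt (Matrix.diagonal ![(1 : K), 1, ϖ]))
  rw [mem_mapGL_N₁_iff hκ hϖ0 hy0, ← pairing_antidiagonal, ← v_lt_one_iff_v_le_v hϖ]
  have hback : pairing σ ((StdForm.antidiagonal 3).over K) (((κ : GL (Fin 3) K) : Matrix (Fin 3) (Fin 3) K) *ᵥ Pi.single 0 1) ((((u : GL (Fin 3) K)⁻¹ : GL (Fin 3) K) : Matrix (Fin 3) (Fin 3) K) *ᵥ y) = pairing σ ((StdForm.antidiagonal 3).over K) ((((u * κ : unitaryGroupOfForm σ ((StdForm.antidiagonal 3).over K)) : GL (Fin 3) K) : Matrix (Fin 3) (Fin 3) K) *ᵥ Pi.single 0 1) y := by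
    rw [← pairing_mulVec_mulVec_of_mem_unitary u.2, ← hxu, Matrix.mulVec_mulVec, ← Units.val_mul, mul_inv_cancel, Units.val_one, Matrix.one_mulVec]
  rw [hback, Subgroup.coe_mul]

/-! ## §2 The three OUTWARD κ-keyed sets of ★ (V4) at a non-root region vertex with adapted frame -/

/-- **SET IDENTITIES AT AN ADAPTED NON-ROOT REGION VERTEX.**  `v = u·r₀ ≠ r₀` self-dual with `LEV[v](ϖ^{d₀})`, inward child `u·N₁` (a region direction: `hlam`, `hmu`):
★ (V4)'s outward `E`-set is `NULL ∖ REGDIR` and `REGDIR ⊆ NULL`; its outward `P`- and `M`-sets are the class sets over ALL children (a unit value is not null, so not a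
region direction, so not the inward child — the region-direction test depends only on the child). [cite: Kottwitz1986, §3] [cite: BruhatTits1972, §10] [cite: Serre1980Trees, I.2.3] -/
theorem outwardSets_eq_of_adapted (hσ : ∀ x, σ (σ x) = x) (hvσ : ∀ a, Valued.v (σ a) = Valued.v a) (hσϖ : σ ϖ = -ϖ)
    (hϖ : Valued.v ϖ = WithZero.exp (-1 : ℤ)) (hT : (latticeGraph σ ϖ ((StdForm.antidiagonal 3).over K)).IsTree)
    {γ : unitaryGroupOfForm σ ((StdForm.antidiagonal 3).over K)} {d : Fin 3 → K} (hd : ∀ i, Valued.v (d i) = 1)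
    (A : GL (Fin 3) K) (hdA : Matrix.diagonal d = (-(Matrix.diagonal d).det) • formCongr σ A ((StdForm.antidiagonal 3).over K))
    (s : Fin 3 → K) (hγA : ((γ : GL (Fin 3) K) : Matrix (Fin 3) (Fin 3) K) = (A : Matrix (Fin 3) (Fin 3) K) * Matrix.diagonal s * ((A⁻¹ : GL (Fin 3) K) : Matrix (Fin 3) (Fin 3) K))
    (i₀ : Fin 3) {d₀ : ℕ} (he : ∀ i, Valued.v (s i - 1) ≤ Valued.v ϖ ^ d₀) (hiso : ∀ m, m ≠ i₀ → Valued.v (s i₀ - s m) = Valued.v ϖ ^ d₀)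
    {s' : ℕ} (hgap : ∀ j k, j ≠ i₀ → k ≠ i₀ → j ≠ k → Valued.v (s j - s k) = Valued.v ϖ ^ (d₀ + 2 * s')) {k : Fin 3} (hk : k ≠ i₀)
    (c₁ ε : K) (hc₁ : Valued.v c₁ = 1) (hεv : Valued.v ε = 1)
    (u : unitaryGroupOfForm σ ((StdForm.antidiagonal 3).over K)) {v : {M : Submodule 𝒪[K] (Fin 3 → K) // IsVertex σ ϖ ((StdForm.antidiagonal 3).over K) M}} (hvu : v = latticeGraphIso σ ϖ ((StdForm.antidiagonal 3).over K) u ⟨stdLattice K 3, 0, isSelfDualLattice_stdLattice_three_of_v hϖ⟩)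
    (hv : IsSelfDualLattice σ ϖ ((StdForm.antidiagonal 3).over K) v.1) (hvr : v ≠ ⟨stdLattice K 3, 0, isSelfDualLattice_stdLattice_three_of_v hϖ⟩) (hvR : v.1.map ((Matrix.toLin' (((γ : GL (Fin 3) K) : Matrix (Fin 3) (Fin 3) K) - 1)).restrictScalars 𝒪[K]) ≤ scaleLattice (ϖ ^ d₀) v.1)
    (hin : (latticeGraph σ ϖ ((StdForm.antidiagonal 3).over K)).Adj v (latticeGraphIso σ ϖ ((StdForm.antidiagonal 3).over K) u ⟨latt (Matrix.diagonal ![(1 : K), 1, ϖ]), 2, isVertexLattice_two_N₁_of_neg hσϖ hϖ⟩)) (hdin : (latticeGraph σ ϖ ((StdForm.antidiagonal 3).over K)).dist ⟨stdLattice K 3, 0, isSelfDualLattice_stdLattice_three_of_v hϖ⟩ (latticeGraphIso σ ϖ ((StdForm.antidiagonal 3).over K) u ⟨latt (Matrix.diagonal ![(1 : K), 1, ϖ]), 2, isVertexLattice_two_N₁_of_neg hσϖ hϖ⟩) + 1 = (latticeGraph σ ϖ ((StdForm.antidiagonal 3).over K)).dist ⟨stdLattice K 3, 0, isSelfDualLattice_stdLattice_three_of_v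 hϖ⟩ v)
    (hlam : Valued.v (pairing σ ((StdForm.antidiagonal 3).over K) ((A : Matrix (Fin 3) (Fin 3) K) *ᵥ Pi.single i₀ 1) (((u : GL (Fin 3) K) : Matrix (Fin 3) (Fin 3) K) *ᵥ Pi.single 0 1)) < 1) (hmu : Valued.v (pairing σ ((StdForm.antidiagonal 3).over K) (ϖ ^ s' • ((A : Matrix (Fin 3) (Fin 3) K) *ᵥ Pi.single k 1)) (((u : GL (Fin 3) K) : Matrix (Fin 3) (Fin 3) K) *ᵥ Pi.single 0 1)) < 1) :
    {c : {M : Submodule 𝒪[K] (Fin 3 → K) // IsVertex σ ϖ ((StdForm.antidiagonal 3).over K) M} | (latticeGraph σ ϖ ((StdForm.antidiagonal 3).over K)).Adj v c ∧ (latticeGraph σ ϖ ((StdForm.antidiagonal 3).over K)).dist ⟨stdLattice K 3, 0, isSelfDualLattice_stdLattice_three_of_v hϖ⟩ c = (latticeGraph σ ϖ ((StdForm.antidiagonal 3).over K)).dist ⟨stdLattice K 3, 0, isSelfDualLattice_stdLattice_three_of_v hϖ⟩ v + 1 ∧ ∃ κ : unitaryGroupOfForm σ ((StdForm.antidiagonal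 3).over K), κ ∈ unitaryInt σ ((StdForm.antidiagonal 3).over K) ∧ c = latticeGraphIso σ ϖ ((StdForm.antidiagonal 3).over K) (u * κ) ⟨latt (Matrix.diagonal ![(1 : K), 1, ϖ]), 2, isVertexLattice_two_N₁_of_neg hσϖ hϖ⟩ ∧ (¬ (Valued.v (pairing σ ((StdForm.antidiagonal 3).over K) ((((u * κ : unitaryGroupOfForm σ ((StdForm.antidiagonal 3).over K)) : GL (Fin 3) K) : Matrix (Fin 3) (Fin 3) K) *ᵥ Pi.single 0 1) ((A : Matrix (Fin 3) (Fin 3) K) *ᵥ Pi.single i₀ 1)) < 1 ∧ Valued.v (pairing σ ((StdForm.antidiagonal 3).over K) ((((u * κ : unitaryGroupOfForm σ ((StdForm.antidiagonal 3).over K)) : GL (Fin 3) K) : Matrix (Fin 3) (Fin 3) K) *ᵥ Pi.single 0 1) (ϖ ^ s' • ((A : Matrix (Fin 3) (Fin 3) K) *ᵥ Pi.single k 1))) < 1) ∧ Valued.v ((ϖ ^ d₀)⁻¹ * pairing σ ((StdForm.antidiagonal 3).over K) (((κ : GL (Fin 3) K) : Matrix (Fin 3) (Fin 3) K) *ᵥ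 Pi.single 0 1) (((((u⁻¹ * γ * u : unitaryGroupOfForm σ ((StdForm.antidiagonal 3).over K)) : GL (Fin 3) K) : Matrix (Fin 3) (Fin 3) K) - 1) *ᵥ (((κ : GL (Fin 3) K) : Matrix (Fin 3) (Fin 3) K) *ᵥ Pi.single 0 1))) < 1)} = {c : {M : Submodule 𝒪[K] (Fin 3 → K) // IsVertex σ ϖ ((StdForm.antidiagonal 3).over K) M} | (latticeGraph σ ϖ ((StdForm.antidiagonal 3).over K)).Adj v c ∧ ∃ κ : unitaryGroupOfForm σ ((StdForm.antidiagonal 3).over K), κ ∈ unitaryInt σ ((StdForm.antidiagonal 3).over K) ∧ c = latticeGraphIso σ ϖ ((StdForm.antidiagonal 3).over K) (u * κ) ⟨latt (Matrix.diagonal ![(1 : K), 1, ϖ]), 2, isVertexLattice_two_N₁_of_neg hσϖ hϖ⟩ ∧ Valued.v ((ϖ ^ d₀)⁻¹ * pairing σ ((StdForm.antidiagonal 3).over K) (((κ : GL (Fin 3) K) : Matrix (Fin 3) (Fin 3) K) *ᵥ Pi.single 0 1) (((((u⁻¹ * γ * u : unitaryGroupOfForm σ ((StdForm.antidiagonal 3).over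 K)) : GL (Fin 3) K) : Matrix (Fin 3) (Fin 3) K) - 1) *ᵥ (((κ : GL (Fin 3) K) : Matrix (Fin 3) (Fin 3) K) *ᵥ Pi.single 0 1))) < 1} \ {c : {M : Submodule 𝒪[K] (Fin 3 → K) // IsVertex σ ϖ ((StdForm.antidiagonal 3).over K) M} | (latticeGraph σ ϖ ((StdForm.antidiagonal 3).over K)).Adj v c ∧ ∃ κ : unitaryGroupOfForm σ ((StdForm.antidiagonal 3).over K), κ ∈ unitaryInt σ ((StdForm.antidiagonal 3).over K) ∧ c = latticeGraphIso σ ϖ ((StdForm.antidiagonal 3).over K) (u * κ) ⟨latt (Matrix.diagonal ![(1 : K), 1, ϖ]), 2, isVertexLattice_two_N₁_of_neg hσϖ hϖ⟩ ∧ (Valued.v (pairing σ ((StdForm.antidiagonal 3).over K) ((((u * κ : unitaryGroupOfForm σ ((StdForm.antidiagonal 3).over K)) : GL (Fin 3) K) : Matrix (Fin 3) (Fin 3) K) *ᵥ Pi.single 0 1) ((A : Matrix (Fin 3) (Fin 3) K) *ᵥ Pi.single i₀ 1)) < 1 ∧ Valued.v (pairing σ ((StdForm.antidiagonal 3).over K)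 ((((u * κ : unitaryGroupOfForm σ ((StdForm.antidiagonal 3).over K)) : GL (Fin 3) K) : Matrix (Fin 3) (Fin 3) K) *ᵥ Pi.single 0 1) (ϖ ^ s' • ((A : Matrix (Fin 3) (Fin 3) K) *ᵥ Pi.single k 1))) < 1)} ∧
    {c : {M : Submodule 𝒪[K] (Fin 3 → K) // IsVertex σ ϖ ((StdForm.antidiagonal 3).over K) M} | (latticeGraph σ ϖ ((StdForm.antidiagonal 3).over K)).Adj v c ∧ ∃ κ : unitaryGroupOfForm σ ((StdForm.antidiagonal 3).over K), κ ∈ unitaryInt σ ((StdForm.antidiagonal 3).over K) ∧ c = latticeGraphIso σ ϖ ((StdForm.antidiagonal 3).over K) (u * κ) ⟨latt (Matrix.diagonal ![(1 : K), 1, ϖ]), 2, isVertexLattice_two_N₁_of_neg hσϖ hϖ⟩ ∧ (Valued.v (pairing σ ((StdForm.antidiagonal 3).over K) ((((u * κ : unitaryGroupOfForm σ ((StdForm.antidiagonal 3).over K)) : GL (Fin 3) K) : Matrix (Fin 3) (Fin 3) K) *ᵥ Pi.single 0 1) ((A : Matrix (Fin 3) (Fin 3) K) *ᵥ Pi.single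 i₀ 1)) < 1 ∧ Valued.v (pairing σ ((StdForm.antidiagonal 3).over K) ((((u * κ : unitaryGroupOfForm σ ((StdForm.antidiagonal 3).over K)) : GL (Fin 3) K) : Matrix (Fin 3) (Fin 3) K) *ᵥ Pi.single 0 1) (ϖ ^ s' • ((A : Matrix (Fin 3) (Fin 3) K) *ᵥ Pi.single k 1))) < 1)} ⊆ {c : {M : Submodule 𝒪[K] (Fin 3 → K) // IsVertex σ ϖ ((StdForm.antidiagonal 3).over K) M} | (latticeGraph σ ϖ ((StdForm.antidiagonal 3).over K)).Adj v c ∧ ∃ κ : unitaryGroupOfForm σ ((StdForm.antidiagonal 3).over K), κ ∈ unitaryInt σ ((StdForm.antidiagonal 3).over K) ∧ c = latticeGraphIso σ ϖ ((StdForm.antidiagonal 3).over K) (u * κ) ⟨latt (Matrix.diagonal ![(1 : K), 1, ϖ]), 2, isVertexLattice_two_N₁_of_neg hσϖ hϖ⟩ ∧ Valued.v ((ϖ ^ d₀)⁻¹ * pairing σ ((StdForm.antidiagonal 3).over K) (((κ : GL (Fin 3) K) : Matrix (Fin 3) (Fin 3) K) *ᵥ Pi.single 0 1) (((((u⁻¹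 * γ * u : unitaryGroupOfForm σ ((StdForm.antidiagonal 3).over K)) : GL (Fin 3) K) : Matrix (Fin 3) (Fin 3) K) - 1) *ᵥ (((κ : GL (Fin 3) K) : Matrix (Fin 3) (Fin 3) K) *ᵥ Pi.single 0 1))) < 1} ∧
    {c : {M : Submodule 𝒪[K] (Fin 3 → K) // IsVertex σ ϖ ((StdForm.antidiagonal 3).over K) M} | (latticeGraph σ ϖ ((StdForm.antidiagonal 3).over K)).Adj v c ∧ (latticeGraph σ ϖ ((StdForm.antidiagonal 3).over K)).dist ⟨stdLattice K 3, 0, isSelfDualLattice_stdLattice_three_of_v hϖ⟩ c = (latticeGraph σ ϖ ((StdForm.antidiagonal 3).over K)).dist ⟨stdLattice K 3, 0, isSelfDualLattice_stdLattice_three_of_v hϖ⟩ v + 1 ∧ ∃ κ : unitaryGroupOfForm σ ((StdForm.antidiagonal 3).over K), κ ∈ unitaryInt σ ((StdForm.antidiagonal 3).over K) ∧ c = latticeGraphIso σ ϖ ((StdForm.antidiagonal 3).over K) (u * κ) ⟨latt (Matrix.diagonal ![(1 : K), 1, ϖ]), 2, isVertexLattice_two_N₁_of_neg hσϖ hϖ⟩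 ∧ (¬ (Valued.v (pairing σ ((StdForm.antidiagonal 3).over K) ((((u * κ : unitaryGroupOfForm σ ((StdForm.antidiagonal 3).over K)) : GL (Fin 3) K) : Matrix (Fin 3) (Fin 3) K) *ᵥ Pi.single 0 1) ((A : Matrix (Fin 3) (Fin 3) K) *ᵥ Pi.single i₀ 1)) < 1 ∧ Valued.v (pairing σ ((StdForm.antidiagonal 3).over K) ((((u * κ : unitaryGroupOfForm σ ((StdForm.antidiagonal 3).over K)) : GL (Fin 3) K) : Matrix (Fin 3) (Fin 3) K) *ᵥ Pi.single 0 1) (ϖ ^ s' • ((A : Matrix (Fin 3) (Fin 3) K) *ᵥ Pi.single k 1))) < 1) ∧ ∃ a : K, Valued.v a = 1 ∧ Valued.v (((ϖ ^ d₀)⁻¹ * pairing σ ((StdForm.antidiagonal 3).over K) (((κ : GL (Fin 3) K) : Matrix (Fin 3) (Fin 3) K) *ᵥ Pi.single 0 1) (((((u⁻¹ * γ * u : unitaryGroupOfForm σ ((StdForm.antidiagonal 3).over K)) : GL (Fin 3) K) : Matrix (Fin 3) (Fin 3) K) - 1) *ᵥ (((κ : GL (Fin 3) K) : Matrix (Fin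 3) (Fin 3) K) *ᵥ Pi.single 0 1))) - (-c₁) * a ^ 2) < 1)} = {c : {M : Submodule 𝒪[K] (Fin 3 → K) // IsVertex σ ϖ ((StdForm.antidiagonal 3).over K) M} | (latticeGraph σ ϖ ((StdForm.antidiagonal 3).over K)).Adj v c ∧ ∃ κ : unitaryGroupOfForm σ ((StdForm.antidiagonal 3).over K), κ ∈ unitaryInt σ ((StdForm.antidiagonal 3).over K) ∧ c = latticeGraphIso σ ϖ ((StdForm.antidiagonal 3).over K) (u * κ) ⟨latt (Matrix.diagonal ![(1 : K), 1, ϖ]), 2, isVertexLattice_two_N₁_of_neg hσϖ hϖ⟩ ∧ (∃ a : K, Valued.v a = 1 ∧ Valued.v (((ϖ ^ d₀)⁻¹ * pairing σ ((StdForm.antidiagonal 3).over K) (((κ : GL (Fin 3) K) : Matrix (Fin 3) (Fin 3) K) *ᵥ Pi.single 0 1) (((((u⁻¹ * γ * u : unitaryGroupOfForm σ ((StdForm.antidiagonal 3).over K)) : GL (Fin 3) K) : Matrix (Fin 3) (Fin 3) K) - 1) *ᵥ (((κ : GL (Fin 3) K) : Matrix (Fin 3) (Fin 3) K) *ᵥ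 Pi.single 0 1))) - (-c₁) * a ^ 2) < 1)} ∧
    {c : {M : Submodule 𝒪[K] (Fin 3 → K) // IsVertex σ ϖ ((StdForm.antidiagonal 3).over K) M} | (latticeGraph σ ϖ ((StdForm.antidiagonal 3).over K)).Adj v c ∧ (latticeGraph σ ϖ ((StdForm.antidiagonal 3).over K)).dist ⟨stdLattice K 3, 0, isSelfDualLattice_stdLattice_three_of_v hϖ⟩ c = (latticeGraph σ ϖ ((StdForm.antidiagonal 3).over K)).dist ⟨stdLattice K 3, 0, isSelfDualLattice_stdLattice_three_of_v hϖ⟩ v + 1 ∧ ∃ κ : unitaryGroupOfForm σ ((StdForm.antidiagonal 3).over K), κ ∈ unitaryInt σ ((StdForm.antidiagonal 3).over K) ∧ c = latticeGraphIso σ ϖ ((StdForm.antidiagonal 3).over K) (u * κ) ⟨latt (Matrix.diagonal ![(1 : K), 1, ϖ]), 2, isVertexLattice_two_N₁_of_neg hσϖ hϖ⟩ ∧ (¬ (Valued.v (pairing σ ((StdForm.antidiagonal 3).over K) ((((u * κ : unitaryGroupOfForm σ ((StdForm.antidiagonal 3).over K)) : GL (Fin 3) K) : Matrix (Fin 3)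 (Fin 3) K) *ᵥ Pi.single 0 1) ((A : Matrix (Fin 3) (Fin 3) K) *ᵥ Pi.single i₀ 1)) < 1 ∧ Valued.v (pairing σ ((StdForm.antidiagonal 3).over K) ((((u * κ : unitaryGroupOfForm σ ((StdForm.antidiagonal 3).over K)) : GL (Fin 3) K) : Matrix (Fin 3) (Fin 3) K) *ᵥ Pi.single 0 1) (ϖ ^ s' • ((A : Matrix (Fin 3) (Fin 3) K) *ᵥ Pi.single k 1))) < 1) ∧ ∃ a : K, Valued.v a = 1 ∧ Valued.v (((ϖ ^ d₀)⁻¹ * pairing σ ((StdForm.antidiagonal 3).over K) (((κ : GL (Fin 3) K) : Matrix (Fin 3) (Fin 3) K) *ᵥ Pi.single 0 1) (((((u⁻¹ * γ * u : unitaryGroupOfForm σ ((StdForm.antidiagonal 3).over K)) : GL (Fin 3) K) : Matrix (Fin 3) (Fin 3) K) - 1) *ᵥ (((κ : GL (Fin 3) K) : Matrix (Fin 3) (Fin 3) K) *ᵥ Pi.single 0 1))) - (-(c₁ * ε)) * a ^ 2) < 1)} = {c : {M : Submodule 𝒪[K] (Fin 3 → K) // IsVertex σ ϖ ((StdForm.antidiagonal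 3).over K) M} | (latticeGraph σ ϖ ((StdForm.antidiagonal 3).over K)).Adj v c ∧ ∃ κ : unitaryGroupOfForm σ ((StdForm.antidiagonal 3).over K), κ ∈ unitaryInt σ ((StdForm.antidiagonal 3).over K) ∧ c = latticeGraphIso σ ϖ ((StdForm.antidiagonal 3).over K) (u * κ) ⟨latt (Matrix.diagonal ![(1 : K), 1, ϖ]), 2, isVertexLattice_two_N₁_of_neg hσϖ hϖ⟩ ∧ (∃ a : K, Valued.v a = 1 ∧ Valued.v (((ϖ ^ d₀)⁻¹ * pairing σ ((StdForm.antidiagonal 3).over K) (((κ : GL (Fin 3) K) : Matrix (Fin 3) (Fin 3) K) *ᵥ Pi.single 0 1) (((((u⁻¹ * γ * u : unitaryGroupOfForm σ ((StdForm.antidiagonal 3).over K)) : GL (Fin 3) K) : Matrix (Fin 3) (Fin 3) K) - 1) *ᵥ (((κ : GL (Fin 3) K) : Matrix (Fin 3) (Fin 3) K) *ᵥ Pi.single 0 1))) - (-(c₁ * ε)) * a ^ 2) < 1)} := by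
  have hH : ∀ a b, σ (((StdForm.antidiagonal 3).over K) a b) = ((StdForm.antidiagonal 3).over K) b a := map_antidiagonal_three_over_apply_eq σ
  -- the two test vectors lie in `v` (★ REGION CRITERION)
  obtain ⟨hyI, hyK⟩ := (map_sub_one_le_scaleLattice_iff_mem_and_mem_of_isSelfDualLattice hσ hvσ hϖ A hd hdA s hγA i₀ he hiso hgap hv hk).1 hvR
  rw [hvu] at hyI hyK
  -- region direction ⟺ both test vectors in the child (representation-free); region direction ⟹ null value
  have hRDiff : ∀ κ : unitaryGroupOfForm σ ((StdForm.antidiagonal 3).over K), κ ∈ unitaryInt σ ((StdForm.antidiagonal 3).over K) → ((Valued.v (pairing σ ((StdForm.antidiagonal 3).over K) ((((u * κ : unitaryGroupOfForm σ ((StdForm.antidiagonal 3).over K)) : GL (Fin 3) K) : Matrix (Fin 3) (Fin 3) K) *ᵥ Pi.single 0 1) ((A : Matrix (Fin 3) (Fin 3) K) *ᵥ Pi.single i₀ 1)) < 1 ∧ Valued.v (pairing σ ((StdForm.antidiagonal 3).over K) ((((u * κ : unitaryGroupOfForm σ ((StdForm.antidiagonal 3).over K)) : GL (Fin 3) K)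 : Matrix (Fin 3) (Fin 3) K) *ᵥ Pi.single 0 1) (ϖ ^ s' • ((A : Matrix (Fin 3) (Fin 3) K) *ᵥ Pi.single k 1))) < 1) ↔
      (((A : Matrix (Fin 3) (Fin 3) K) *ᵥ Pi.single i₀ 1) ∈ (latticeGraphIso σ ϖ ((StdForm.antidiagonal 3).over K) (u * κ) ⟨latt (Matrix.diagonal ![(1 : K), 1, ϖ]), 2, isVertexLattice_two_N₁_of_neg hσϖ hϖ⟩ : {M : Submodule 𝒪[K] (Fin 3 → K) // IsVertex σ ϖ ((StdForm.antidiagonal 3).over K) M}).1 ∧ (ϖ ^ s' • ((A : Matrix (Fin 3) (Fin 3) K) *ᵥ Pi.single k 1)) ∈ (latticeGraphIso σ ϖ ((StdForm.antidiagonal 3).over K) (u * κ) ⟨latt (Matrix.diagonal ![(1 : K), 1, ϖ]), 2, isVertexLattice_two_N₁_of_neg hσϖ hϖ⟩ : {M : Submodule 𝒪[K] (Fin 3 → K) // IsVertex σ ϖ ((StdForm.antidiagonal 3).over K) M}).1)) := fun κ hκ =>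
    and_congr (v_pairing_lt_one_iff_mem_child hσϖ hϖ u hκ hyI) (v_pairing_lt_one_iff_mem_child hσϖ hϖ u hκ hyK)
  have hRDnull : ∀ κ : unitaryGroupOfForm σ ((StdForm.antidiagonal 3).over K), (Valued.v (pairing σ ((StdForm.antidiagonal 3).over K) ((((u * κ : unitaryGroupOfForm σ ((StdForm.antidiagonal 3).over K)) : GL (Fin 3) K) : Matrix (Fin 3) (Fin 3) K) *ᵥ Pi.single 0 1) ((A : Matrix (Fin 3) (Fin 3) K) *ᵥ Pi.single i₀ 1)) < 1 ∧ Valued.v (pairing σ ((StdForm.antidiagonal 3).over K) ((((u * κ : unitaryGroupOfForm σ ((StdForm.antidiagonal 3).over K)) : GL (Fin 3) K) : Matrix (Fin 3) (Fin 3) K) *ᵥ Pi.single 0 1) (ϖ ^ s' • ((A : Matrix (Fin 3) (Fin 3) K) *ᵥ Pi.single k 1))) < 1) → Valued.v ((ϖ ^ d₀)⁻¹ * pairing σ ((StdForm.antidiagonal 3).over K) (((κ : GL (Fin 3) K) : Matrix (Fin 3) (Fin 3) K) *ᵥ Pi.single 0 1) (((((u⁻¹ * γ * u : unitaryGroupOfForm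 σ ((StdForm.antidiagonal 3).over K)) : GL (Fin 3) K) : Matrix (Fin 3) (Fin 3) K) - 1) *ᵥ (((κ : GL (Fin 3) K) : Matrix (Fin 3) (Fin 3) K) *ᵥ Pi.single 0 1))) < 1 := fun κ hR =>
    v_lineValue_lt_one_of_regDir hσ hvσ hϖ hd A hdA s hγA i₀ hiso hgap hk u κ hR
  -- the inward child `u·N₁ = (u·1)·N₁` is a region direction
  have hcin1 : (latticeGraphIso σ ϖ ((StdForm.antidiagonal 3).over K) u ⟨latt (Matrix.diagonal ![(1 : K), 1, ϖ]), 2, isVertexLattice_two_N₁_of_neg hσϖ hϖ⟩ : {M : Submodule 𝒪[K] (Fin 3 → K) // IsVertex σ ϖ ((StdForm.antidiagonal 3).over K) M}) = latticeGraphIso σ ϖ ((StdForm.antidiagonal 3).over K) (u * 1) ⟨latt (Matrix.diagonal ![(1 : K), 1, ϖ]), 2, isVertexLattice_two_N₁_of_neg hσϖ hϖ⟩ := by rw [mul_one]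
  have hRD1 : (Valued.v (pairing σ ((StdForm.antidiagonal 3).over K) ((((u * 1 : unitaryGroupOfForm σ ((StdForm.antidiagonal 3).over K)) : GL (Fin 3) K) : Matrix (Fin 3) (Fin 3) K) *ᵥ Pi.single 0 1) ((A : Matrix (Fin 3) (Fin 3) K) *ᵥ Pi.single i₀ 1)) < 1 ∧ Valued.v (pairing σ ((StdForm.antidiagonal 3).over K) ((((u * 1 : unitaryGroupOfForm σ ((StdForm.antidiagonal 3).over K)) : GL (Fin 3) K) : Matrix (Fin 3) (Fin 3) K) *ᵥ Pi.single 0 1) (ϖ ^ s' • ((A : Matrix (Fin 3) (Fin 3) K) *ᵥ Pi.single k 1))) < 1) := by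
    refine ⟨?_, ?_⟩
    · rw [mul_one, v_pairing_comm_of_hermitian hvσ hσ hH]; exact hlam
    · rw [mul_one, v_pairing_comm_of_hermitian hvσ hσ hH]; exact hmu
  have hcinRD : (latticeGraphIso σ ϖ ((StdForm.antidiagonal 3).over K) u ⟨latt (Matrix.diagonal ![(1 : K), 1, ϖ]), 2, isVertexLattice_two_N₁_of_neg hσϖ hϖ⟩ : {M : Submodule 𝒪[K] (Fin 3 → K) // IsVertex σ ϖ ((StdForm.antidiagonal 3).over K) M}) ∈ {c : {M : Submodule 𝒪[K] (Fin 3 → K) // IsVertex σ ϖ ((StdForm.antidiagonal 3).over K) M} | (latticeGraph σ ϖ ((StdForm.antidiagonal 3).over K)).Adj v c ∧ ∃ κ : unitaryGroupOfForm σ ((StdForm.antidiagonal 3).over K), κ ∈ unitaryInt σ ((StdForm.antidiagonal 3).over K) ∧ c = latticeGraphIso σ ϖ ((StdForm.antidiagonal 3).over K) (u * κ) ⟨latt (Matrix.diagonal ![(1 : K), 1, ϖ]), 2, isVertexLattice_two_N₁_of_neg hσϖ hϖ⟩ ∧ (Valued.v (pairing σ ((StdForm.antidiagonal 3).over K) ((((u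 * κ : unitaryGroupOfForm σ ((StdForm.antidiagonal 3).over K)) : GL (Fin 3) K) : Matrix (Fin 3) (Fin 3) K) *ᵥ Pi.single 0 1) ((A : Matrix (Fin 3) (Fin 3) K) *ᵥ Pi.single i₀ 1)) < 1 ∧ Valued.v (pairing σ ((StdForm.antidiagonal 3).over K) ((((u * κ : unitaryGroupOfForm σ ((StdForm.antidiagonal 3).over K)) : GL (Fin 3) K) : Matrix (Fin 3) (Fin 3) K) *ᵥ Pi.single 0 1) (ϖ ^ s' • ((A : Matrix (Fin 3) (Fin 3) K) *ᵥ Pi.single k 1))) < 1)} := by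
    refine ⟨hin, 1, one_mem _, hcin1, hRD1⟩
  have hRD_of_eq : ∀ κ : unitaryGroupOfForm σ ((StdForm.antidiagonal 3).over K), κ ∈ unitaryInt σ ((StdForm.antidiagonal 3).over K) → (latticeGraphIso σ ϖ ((StdForm.antidiagonal 3).over K) (u * κ) ⟨latt (Matrix.diagonal ![(1 : K), 1, ϖ]), 2, isVertexLattice_two_N₁_of_neg hσϖ hϖ⟩ : {M : Submodule 𝒪[K] (Fin 3 → K) // IsVertex σ ϖ ((StdForm.antidiagonal 3).over K) M}) = latticeGraphIso σ ϖ ((StdForm.antidiagonal 3).over K) u ⟨latt (Matrix.diagonal ![(1 : K), 1, ϖ]), 2, isVertexLattice_two_N₁_of_neg hσϖ hϖ⟩ → (Valued.v (pairing σ ((StdForm.antidiagonal 3).over K) ((((u * κ : unitaryGroupOfForm σ ((StdForm.antidiagonal 3).over K)) : GL (Fin 3) K) : Matrix (Fin 3) (Fin 3) K) *ᵥ Pi.single 0 1) ((A : Matrix (Fin 3) (Fin 3) K) *ᵥ Pi.single i₀ 1)) < 1 ∧ Valued.v (pairing σ ((StdForm.antidiagonal 3).over K) ((((u * κ : unitaryGroupOfForm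 σ ((StdForm.antidiagonal 3).over K)) : GL (Fin 3) K) : Matrix (Fin 3) (Fin 3) K) *ᵥ Pi.single 0 1) (ϖ ^ s' • ((A : Matrix (Fin 3) (Fin 3) K) *ᵥ Pi.single k 1))) < 1) := fun κ hκ hce =>
    (hRDiff κ hκ).2 (by rw [hce, hcin1]; exact (hRDiff 1 (one_mem _)).1 hRD1)
  -- the rooted parent: the inward child is THE parent, every other child is outward
  obtain ⟨p, -, hp5, -, -⟩ := exists_rooted_parent hT (⟨stdLattice K 3, 0, isSelfDualLattice_stdLattice_three_of_v hϖ⟩ : {M : Submodule 𝒪[K] (Fin 3 → K) // IsVertex σ ϖ ((StdForm.antidiagonal 3).over K) M})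
  have hpar : p v = latticeGraphIso σ ϖ ((StdForm.antidiagonal 3).over K) u ⟨latt (Matrix.diagonal ![(1 : K), 1, ϖ]), 2, isVertexLattice_two_N₁_of_neg hσϖ hϖ⟩ := by
    by_contra hne
    have h := (hp5 v _ hvr hin (Ne.symm hne)).1
    omega
  have hout : ∀ c : {M : Submodule 𝒪[K] (Fin 3 → K) // IsVertex σ ϖ ((StdForm.antidiagonal 3).over K) M}, (latticeGraph σ ϖ ((StdForm.antidiagonal 3).over K)).Adj v c → c ≠ latticeGraphIso σ ϖ ((StdForm.antidiagonal 3).over K) u ⟨latt (Matrix.diagonal ![(1 : K), 1, ϖ]), 2, isVertexLattice_two_N₁_of_neg hσϖ hϖ⟩ → (latticeGraph σ ϖ ((StdForm.antidiagonal 3).over K)).dist ⟨stdLattice K 3, 0, isSelfDualLattice_stdLattice_three_of_v hϖ⟩ c = (latticeGraph σ ϖ ((StdForm.antidiagonal 3).over K)).dist ⟨stdLattice K 3, 0, isSelfDualLattice_stdLattice_three_of_v hϖ⟩ v + 1 :=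
    fun c hc hne => (hp5 v c hvr hc (by rw [hpar]; exact hne)).1
  -- a value in a unit class is not null
  have hnn : ∀ (X tt : K), Valued.v tt = 1 → (∃ a : K, Valued.v a = 1 ∧ Valued.v (X - tt * a ^ 2) < 1) → ¬ Valued.v X < 1 := by
    rintro X tt htt ⟨a, ha, hlt⟩ hX
    have h1 : Valued.v (tt * a ^ 2) = 1 := by rw [map_mul, map_pow, htt, ha, one_pow, mul_one]
    have h2 : Valued.v (tt * a ^ 2) < 1 := by
      have e : tt * a ^ 2 = X - (X - tt * a ^ 2) := by ring
      rw [e]; exact lt_of_le_of_lt (Valuation.map_sub _ _ _) (max_lt hX hlt)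
    exact absurd h1 (ne_of_lt h2)
  have hnc₁ : Valued.v (-c₁) = 1 := by rw [Valuation.map_neg, hc₁]
  have hnc₁ε : Valued.v (-(c₁ * ε)) = 1 := by rw [Valuation.map_neg, map_mul, hc₁, hεv, mul_one]
  refine ⟨?_, ?_, ?_, ?_⟩
  · -- E = NULL ∖ REGDIR
    ext c
    simp only [Set.mem_sdiff, Set.mem_setOf_eq]
    constructor
    · rintro ⟨hadj, -, κ, hκ, hc, hnR, hnull⟩
      refine ⟨⟨hadj, κ, hκ, hc, hnull⟩, ?_⟩
      rintro ⟨-, κ', hκ', hc', hR'⟩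
      exact hnR ((hRDiff κ hκ).2 (by rw [← hc, hc']; exact (hRDiff κ' hκ').1 hR'))
    · rintro ⟨⟨hadj, κ, hκ, hc, hnull⟩, hnB⟩
      refine ⟨hadj, hout c hadj (fun hce => hnB (by rw [hce]; exact hcinRD)), κ, hκ, hc, fun hR => hnB ⟨hadj, κ, hκ, hc, hR⟩, hnull⟩
  · -- REGDIR ⊆ NULL
    rintro c ⟨hadj, κ, hκ, hc, hR⟩
    exact ⟨hadj, κ, hκ, hc, hRDnull κ hR⟩
  · -- P
    ext c
    simp only [Set.mem_setOf_eq]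
    constructor
    · rintro ⟨hadj, -, κ, hκ, hc, -, hcls⟩
      exact ⟨hadj, κ, hκ, hc, hcls⟩
    · rintro ⟨hadj, κ, hκ, hc, hcls⟩
      have hnR : ¬ (Valued.v (pairing σ ((StdForm.antidiagonal 3).over K) ((((u * κ : unitaryGroupOfForm σ ((StdForm.antidiagonal 3).over K)) : GL (Fin 3) K) : Matrix (Fin 3) (Fin 3) K) *ᵥ Pi.single 0 1) ((A : Matrix (Fin 3) (Fin 3) K) *ᵥ Pi.single i₀ 1)) < 1 ∧ Valued.v (pairing σ ((StdForm.antidiagonal 3).over K) ((((u * κ : unitaryGroupOfForm σ ((StdForm.antidiagonal 3).over K)) : GL (Fin 3) K) : Matrix (Fin 3) (Fin 3) K) *ᵥ Pi.single 0 1) (ϖ ^ s' • ((A : Matrix (Fin 3) (Fin 3) K) *ᵥ Pi.single k 1))) < 1) := fun hR => hnn _ _ hnc₁ hcls (hRDnull κ hR)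
      exact ⟨hadj, hout c hadj (fun hce => hnR (hRD_of_eq κ hκ (by rw [← hc]; exact hce))), κ, hκ, hc, hnR, hcls⟩
  · -- M
    ext c
    simp only [Set.mem_setOf_eq]
    constructor
    · rintro ⟨hadj, -, κ, hκ, hc, -, hcls⟩
      exact ⟨hadj, κ, hκ, hc, hcls⟩
    · rintro ⟨hadj, κ, hκ, hc, hcls⟩
      have hnR : ¬ (Valued.v (pairing σ ((StdForm.antidiagonal 3).over K) ((((u * κ : unitaryGroupOfForm σ ((StdForm.antidiagonal 3).over K)) : GL (Fin 3) K) : Matrix (Fin 3) (Fin 3) K) *ᵥ Pi.single 0 1) ((A : Matrix (Fin 3) (Fin 3) K) *ᵥ Pi.single i₀ 1)) < 1 ∧ Valued.v (pairing σ ((StdForm.antidiagonal 3).over K) ((((u * κ : unitaryGroupOfForm σ ((StdForm.antidiagonal 3).over K)) : GL (Fin 3) K) : Matrix (Fin 3) (Fin 3) K) *ᵥ Pi.single 0 1) (ϖ ^ s' • ((A : Matrix (Fin 3) (Fin 3) K) *ᵥ Pi.single k 1))) < 1) := fun hR => hnn _ _ hnc₁ε hcls (hRDnull κ hR)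
      exact ⟨hadj, hout c hadj (fun hce => hnR (hRD_of_eq κ hκ (by rw [← hc]; exact hce))), κ, hκ, hc, hnR, hcls⟩

/-! ## §3 The class sets in ★ (V2)'s residue-test spelling -/

/-- Square classes in a finite field: `x ∈ n·(𝔽ˣ)²` iff `χ(n⁻¹x) = 1` (`n ≠ 0`). [cite: Kottwitz1986, §3] -/
theorem exists_eq_mul_sq_iff_quadraticChar_eq_one {F : Type*} [Field F] [Fintype F] [DecidableEq F] {n : F} (hn : n ≠ 0) (x : F) :
    (∃ a : F, a ≠ 0 ∧ x = n * a ^ 2) ↔ quadraticChar F (n⁻¹ * x) = 1 := by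
  constructor
  · rintro ⟨a, ha, rfl⟩
    rw [← mul_assoc, inv_mul_cancel₀ hn, one_mul]
    exact quadraticChar_sq_one' ha
  · intro h
    have hx0 : n⁻¹ * x ≠ 0 := fun h0 => by rw [h0, quadraticChar_zero] at h; exact zero_ne_one h
    obtain ⟨r, hr⟩ := (quadraticChar_one_iff_isSquare hx0).1 h
    have hr0 : r ≠ 0 := fun h0 => hx0 (by rw [hr, h0, mul_zero])
    refine ⟨r, hr0, ?_⟩
    calc x = n * (n⁻¹ * x) := by rw [← mul_assoc, mul_inv_cancel₀ hn, one_mul]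
      _ = n * r ^ 2 := by rw [hr, pow_two]

/-- Square classes in a finite field: `x ∈ n·e·(𝔽ˣ)²` iff `χ(n⁻¹x) = −1`, for a non-square `e` (`χ(e) = −1`, `n ≠ 0`). [cite: Kottwitz1986, §3] -/
theorem exists_eq_mul_mul_sq_iff_quadraticChar_eq_neg_one {F : Type*} [Field F] [Fintype F] [DecidableEq F] {n : F} (hn : n ≠ 0) {e : F}
    (he : quadraticChar F e = -1) (x : F) :
    (∃ a : F, a ≠ 0 ∧ x = n * e * a ^ 2) ↔ quadraticChar F (n⁻¹ * x) = -1 := by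
  have he0 : e ≠ 0 := fun h0 => by rw [h0, quadraticChar_zero] at he; exact absurd he (by norm_num)
  constructor
  · rintro ⟨a, ha, rfl⟩
    rw [show n⁻¹ * (n * e * a ^ 2) = e * a ^ 2 by rw [mul_assoc, ← mul_assoc, ← mul_assoc, inv_mul_cancel₀ hn, one_mul], map_mul,
      quadraticChar_sq_one' ha, he, mul_one]
  · intro h
    have hx0 : n⁻¹ * x ≠ 0 := fun h0 => by rw [h0, quadraticChar_zero] at h; exact absurd h (by norm_num)
    have h1 : quadraticChar F (n⁻¹ * x * e) = 1 := by rw [map_mul, h, he]; norm_num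
    obtain ⟨r, hr⟩ := (quadraticChar_one_iff_isSquare (mul_ne_zero hx0 he0)).1 h1
    have hr0 : r ≠ 0 := fun h0 => mul_ne_zero hx0 he0 (by rw [hr, h0, mul_zero])
    refine ⟨r * e⁻¹, mul_ne_zero hr0 (inv_ne_zero he0), ?_⟩
    have hx : x = n * (n⁻¹ * x * e) * e⁻¹ := by field_simp
    rw [hx, hr]; field_simp

/-- **THE THREE CLASS SETS ARE ★ (V2)'s RESIDUE-TEST SETS** (NULL: residue `0`; class `−c₁`: `χ(c₀·residue) = 1`; class `−c₁ε`: `χ(c₀·residue) = −1`, `c₀ = (−c̄₁)⁻¹`, `ε̄`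
a non-square), in the frame `κ` on `M = u⁻¹γu − 1` with integral `Y₀ = (ϖ^{d₀})⁻¹M` (★ G3⁗ token dictionary). [cite: Kottwitz1986, §3] [cite: BruhatTits1972, §10] -/
theorem childSets_eq_residueTestSets (hvσ : ∀ a, Valued.v (σ a) = Valued.v a) (hσϖ : σ ϖ = -ϖ) (hϖ : Valued.v ϖ = WithZero.exp (-1 : ℤ))
    (hres : ∀ x : K, Valued.v x ≤ 1 → Valued.v (σ x - x) < 1) [Fintype 𝓀[K]] [DecidableEq 𝓀[K]]
    {γ : unitaryGroupOfForm σ ((StdForm.antidiagonal 3).over K)} (c₁ ε : K) (hε : ∀ z : K, Valued.v z ≤ 1 → Valued.v (z ^ 2 - ε) = 1)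
    (u : unitaryGroupOfForm σ ((StdForm.antidiagonal 3).over K)) {v : {M : Submodule 𝒪[K] (Fin 3 → K) // IsVertex σ ϖ ((StdForm.antidiagonal 3).over K) M}} (hvu : v = latticeGraphIso σ ϖ ((StdForm.antidiagonal 3).over K) u ⟨stdLattice K 3, 0, isSelfDualLattice_stdLattice_three_of_v hϖ⟩) {d₀ : ℕ}
    (Y₀ : Matrix (Fin 3) (Fin 3) 𝒪[K]) (hY₀ : ∀ a b, ((Y₀ a b : 𝒪[K]) : K) = (ϖ ^ d₀)⁻¹ * (((((u⁻¹ * γ * u : unitaryGroupOfForm σ ((StdForm.antidiagonal 3).over K)) : GL (Fin 3) K) : Matrix (Fin 3) (Fin 3) K) - 1) a b))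
    (nc₁ : 𝒪[K]) (hnc₁ : (nc₁ : K) = -c₁) (hnc₁v : Valued.v (nc₁ : K) = 1) (εO : 𝒪[K]) (hεO : (εO : K) = ε) :
    {c : {M : Submodule 𝒪[K] (Fin 3 → K) // IsVertex σ ϖ ((StdForm.antidiagonal 3).over K) M} | (latticeGraph σ ϖ ((StdForm.antidiagonal 3).over K)).Adj v c ∧ ∃ κ : unitaryGroupOfForm σ ((StdForm.antidiagonal 3).over K), κ ∈ unitaryInt σ ((StdForm.antidiagonal 3).over K) ∧ c = latticeGraphIso σ ϖ ((StdForm.antidiagonal 3).over K) (u * κ) ⟨latt (Matrix.diagonal ![(1 : K), 1, ϖ]), 2, isVertexLattice_two_N₁_of_neg hσϖ hϖ⟩ ∧ Valued.v ((ϖ ^ d₀)⁻¹ * pairing σ ((StdForm.antidiagonal 3).over K) (((κ : GL (Fin 3) K) : Matrix (Fin 3) (Fin 3) K) *ᵥ Pi.single 0 1) (((((u⁻¹ * γ * u : unitaryGroupOfForm σ ((StdForm.antidiagonal 3).over K)) : GL (Fin 3) K) : Matrix (Fin 3) (Fin 3) K) - 1) *ᵥ (((κ : GL (Fin 3) K)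 : Matrix (Fin 3) (Fin 3) K) *ᵥ Pi.single 0 1))) < 1} =
      {w | w ∈ (latticeGraph σ ϖ ((StdForm.antidiagonal 3).over K)).neighborSet
          (latticeGraphIso σ ϖ ((StdForm.antidiagonal 3).over K) u ⟨stdLattice K 3, 0, isSelfDualLattice_stdLattice_three_of_v hϖ⟩) ∧
        ∃ κ : unitaryGroupOfForm σ ((StdForm.antidiagonal 3).over K), κ ∈ unitaryInt σ ((StdForm.antidiagonal 3).over K) ∧
          w.1 = mapGL (((u * κ : unitaryGroupOfForm σ ((StdForm.antidiagonal 3).over K)) : GL (Fin 3) K)) (latt (Matrix.diagonal ![(1 : K), 1, ϖ])) ∧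
          ∃ t₀ : 𝒪[K], (t₀ : K) = (ϖ ^ d₀)⁻¹ * B₀ σ 3 (((κ : GL (Fin 3) K) : Matrix (Fin 3) (Fin 3) K) *ᵥ (Pi.single 0 1))
              (((((u⁻¹ * γ * u : unitaryGroupOfForm σ ((StdForm.antidiagonal 3).over K)) : GL (Fin 3) K) : Matrix (Fin 3) (Fin 3) K) - 1) *ᵥ (((κ : GL (Fin 3) K) : Matrix (Fin 3) (Fin 3) K) *ᵥ (Pi.single 0 1))) ∧ IsLocalRing.residue 𝒪[K] t₀ = 0} ∧
    {c : {M : Submodule 𝒪[K] (Fin 3 → K) // IsVertex σ ϖ ((StdForm.antidiagonal 3).over K) M} | (latticeGraph σ ϖ ((StdForm.antidiagonal 3).over K)).Adj v c ∧ ∃ κ : unitaryGroupOfForm σ ((StdForm.antidiagonal 3).over K), κ ∈ unitaryInt σ ((StdForm.antidiagonal 3).over K) ∧ c = latticeGraphIso σ ϖ ((StdForm.antidiagonal 3).over K) (u * κ) ⟨latt (Matrix.diagonal ![(1 : K), 1, ϖ]), 2, isVertexLattice_two_N₁_of_neg hσϖ hϖ⟩ ∧ (∃ a : K, Valued.v a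 = 1 ∧ Valued.v (((ϖ ^ d₀)⁻¹ * pairing σ ((StdForm.antidiagonal 3).over K) (((κ : GL (Fin 3) K) : Matrix (Fin 3) (Fin 3) K) *ᵥ Pi.single 0 1) (((((u⁻¹ * γ * u : unitaryGroupOfForm σ ((StdForm.antidiagonal 3).over K)) : GL (Fin 3) K) : Matrix (Fin 3) (Fin 3) K) - 1) *ᵥ (((κ : GL (Fin 3) K) : Matrix (Fin 3) (Fin 3) K) *ᵥ Pi.single 0 1))) - (-c₁) * a ^ 2) < 1)} =
      {w | w ∈ (latticeGraph σ ϖ ((StdForm.antidiagonal 3).over K)).neighborSet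
          (latticeGraphIso σ ϖ ((StdForm.antidiagonal 3).over K) u ⟨stdLattice K 3, 0, isSelfDualLattice_stdLattice_three_of_v hϖ⟩) ∧
        ∃ κ : unitaryGroupOfForm σ ((StdForm.antidiagonal 3).over K), κ ∈ unitaryInt σ ((StdForm.antidiagonal 3).over K) ∧
          w.1 = mapGL (((u * κ : unitaryGroupOfForm σ ((StdForm.antidiagonal 3).over K)) : GL (Fin 3) K)) (latt (Matrix.diagonal ![(1 : K), 1, ϖ])) ∧
          ∃ t₀ : 𝒪[K], (t₀ : K) = (ϖ ^ d₀)⁻¹ * B₀ σ 3 (((κ : GL (Fin 3) K) : Matrix (Fin 3) (Fin 3) K) *ᵥ (Pi.single 0 1))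
              (((((u⁻¹ * γ * u : unitaryGroupOfForm σ ((StdForm.antidiagonal 3).over K)) : GL (Fin 3) K) : Matrix (Fin 3) (Fin 3) K) - 1) *ᵥ (((κ : GL (Fin 3) K) : Matrix (Fin 3) (Fin 3) K) *ᵥ (Pi.single 0 1))) ∧ quadraticChar 𝓀[K] ((IsLocalRing.residue 𝒪[K] nc₁)⁻¹ * IsLocalRing.residue 𝒪[K] t₀) = 1} ∧
    {c : {M : Submodule 𝒪[K] (Fin 3 → K) // IsVertex σ ϖ ((StdForm.antidiagonal 3).over K) M} | (latticeGraph σ ϖ ((StdForm.antidiagonal 3).over K)).Adj v c ∧ ∃ κ : unitaryGroupOfForm σ ((StdForm.antidiagonal 3).over K), κ ∈ unitaryInt σ ((StdForm.antidiagonal 3).over K) ∧ c = latticeGraphIso σ ϖ ((StdForm.antidiagonal 3).over K) (u * κ) ⟨latt (Matrix.diagonal ![(1 : K), 1, ϖ]), 2, isVertexLattice_two_N₁_of_neg hσϖ hϖ⟩ ∧ (∃ a : K, Valued.v a = 1 ∧ Valued.v (((ϖ ^ d₀)⁻¹ * pairing σ ((StdForm.antidiagonal 3).over K) (((κ : GL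 (Fin 3) K) : Matrix (Fin 3) (Fin 3) K) *ᵥ Pi.single 0 1) (((((u⁻¹ * γ * u : unitaryGroupOfForm σ ((StdForm.antidiagonal 3).over K)) : GL (Fin 3) K) : Matrix (Fin 3) (Fin 3) K) - 1) *ᵥ (((κ : GL (Fin 3) K) : Matrix (Fin 3) (Fin 3) K) *ᵥ Pi.single 0 1))) - (-(c₁ * ε)) * a ^ 2) < 1)} =
      {w | w ∈ (latticeGraph σ ϖ ((StdForm.antidiagonal 3).over K)).neighborSet
          (latticeGraphIso σ ϖ ((StdForm.antidiagonal 3).over K) u ⟨stdLattice K 3, 0, isSelfDualLattice_stdLattice_three_of_v hϖ⟩) ∧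
        ∃ κ : unitaryGroupOfForm σ ((StdForm.antidiagonal 3).over K), κ ∈ unitaryInt σ ((StdForm.antidiagonal 3).over K) ∧
          w.1 = mapGL (((u * κ : unitaryGroupOfForm σ ((StdForm.antidiagonal 3).over K)) : GL (Fin 3) K)) (latt (Matrix.diagonal ![(1 : K), 1, ϖ])) ∧
          ∃ t₀ : 𝒪[K], (t₀ : K) = (ϖ ^ d₀)⁻¹ * B₀ σ 3 (((κ : GL (Fin 3) K) : Matrix (Fin 3) (Fin 3) K) *ᵥ (Pi.single 0 1))
              (((((u⁻¹ * γ * u : unitaryGroupOfForm σ ((StdForm.antidiagonal 3).over K)) : GL (Fin 3) K) : Matrix (Fin 3) (Fin 3) K) - 1) *ᵥ (((κ : GL (Fin 3) K) : Matrix (Fin 3) (Fin 3) K) *ᵥ (Pi.single 0 1))) ∧ quadraticChar 𝓀[K] ((IsLocalRing.residue 𝒪[K] nc₁)⁻¹ * IsLocalRing.residue 𝒪[K] t₀) = -1} := by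
  have hϖ0 : ϖ ≠ 0 := fun h0 => by rw [h0, map_zero] at hϖ; exact WithZero.coe_ne_zero hϖ.symm
  have hres0 : ∀ x : 𝒪[K], IsLocalRing.residue 𝒪[K] x = 0 ↔ Valued.v (x : K) < 1 := residue_eq_zero_iff_v_lt_one
  -- integrality of the line value
  have hκcol : ∀ κ : unitaryGroupOfForm σ ((StdForm.antidiagonal 3).over K), κ ∈ unitaryInt σ ((StdForm.antidiagonal 3).over K) → ∀ i, Valued.v ((((κ : GL (Fin 3) K) : Matrix (Fin 3) (Fin 3) K) *ᵥ Pi.single 0 1) i) ≤ 1 := fun κ hκ i => by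
    rw [Matrix.mulVec_single_one]; exact (mem_unitaryInt_iff.1 hκ).1 i 0
  have hvalint : ∀ κ : unitaryGroupOfForm σ ((StdForm.antidiagonal 3).over K), κ ∈ unitaryInt σ ((StdForm.antidiagonal 3).over K) → ∃ t : 𝒪[K], (t : K) = ((ϖ ^ d₀)⁻¹ * pairing σ ((StdForm.antidiagonal 3).over K) (((κ : GL (Fin 3) K) : Matrix (Fin 3) (Fin 3) K) *ᵥ Pi.single 0 1) (((((u⁻¹ * γ * u : unitaryGroupOfForm σ ((StdForm.antidiagonal 3).over K)) : GL (Fin 3) K) : Matrix (Fin 3) (Fin 3) K) - 1) *ᵥ (((κ : GL (Fin 3) K) : Matrix (Fin 3) (Fin 3) K) *ᵥ Pi.single 0 1))) := fun κ hκ => by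
    obtain ⟨t, ht, -⟩ := exists_integer_eq_test_and_residue_eq hvσ hres hϖ0 ((((u⁻¹ * γ * u : unitaryGroupOfForm σ ((StdForm.antidiagonal 3).over K)) : GL (Fin 3) K) : Matrix (Fin 3) (Fin 3) K) - 1) Y₀ hY₀ (fun i => ⟨(((κ : GL (Fin 3) K) : Matrix (Fin 3) (Fin 3) K) *ᵥ Pi.single 0 1) i, hκcol κ hκ i⟩)
    exact ⟨t, by rw [ht, pairing_antidiagonal]⟩
  -- the generic dictionary between the two spellings
  have hkey : ∀ (Pκ : unitaryGroupOfForm σ ((StdForm.antidiagonal 3).over K) → Prop) (P' : 𝓀[K] → Prop), (∀ κ : unitaryGroupOfForm σ ((StdForm.antidiagonal 3).over K), κ ∈ unitaryInt σ ((StdForm.antidiagonal 3).over K) → ∀ t : 𝒪[K], (t : K) = ((ϖ ^ d₀)⁻¹ * pairing σ ((StdForm.antidiagonal 3).over K) (((κ : GL (Fin 3) K) : Matrix (Fin 3) (Fin 3) K) *ᵥ Pi.single 0 1) (((((u⁻¹ * γ * u : unitaryGroupOfForm σ ((StdForm.antidiagonal 3).over K)) : GL (Fin 3) K) : Matrix (Fin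 3) (Fin 3) K) - 1) *ᵥ (((κ : GL (Fin 3) K) : Matrix (Fin 3) (Fin 3) K) *ᵥ Pi.single 0 1))) → (Pκ κ ↔ P' (IsLocalRing.residue 𝒪[K] t))) →
      {c : {M : Submodule 𝒪[K] (Fin 3 → K) // IsVertex σ ϖ ((StdForm.antidiagonal 3).over K) M} | (latticeGraph σ ϖ ((StdForm.antidiagonal 3).over K)).Adj v c ∧ ∃ κ : unitaryGroupOfForm σ ((StdForm.antidiagonal 3).over K), κ ∈ unitaryInt σ ((StdForm.antidiagonal 3).over K) ∧ c = latticeGraphIso σ ϖ ((StdForm.antidiagonal 3).over K) (u * κ) ⟨latt (Matrix.diagonal ![(1 : K), 1, ϖ]), 2, isVertexLattice_two_N₁_of_neg hσϖ hϖ⟩ ∧ Pκ κ} = {w | w ∈ (latticeGraph σ ϖ ((StdForm.antidiagonal 3).over K)).neighborSet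
          (latticeGraphIso σ ϖ ((StdForm.antidiagonal 3).over K) u ⟨stdLattice K 3, 0, isSelfDualLattice_stdLattice_three_of_v hϖ⟩) ∧
        ∃ κ : unitaryGroupOfForm σ ((StdForm.antidiagonal 3).over K), κ ∈ unitaryInt σ ((StdForm.antidiagonal 3).over K) ∧
          w.1 = mapGL (((u * κ : unitaryGroupOfForm σ ((StdForm.antidiagonal 3).over K)) : GL (Fin 3) K)) (latt (Matrix.diagonal ![(1 : K), 1, ϖ])) ∧
          ∃ t₀ : 𝒪[K], (t₀ : K) = (ϖ ^ d₀)⁻¹ * B₀ σ 3 (((κ : GL (Fin 3) K) : Matrix (Fin 3) (Fin 3) K) *ᵥ (Pi.single 0 1))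
              (((((u⁻¹ * γ * u : unitaryGroupOfForm σ ((StdForm.antidiagonal 3).over K)) : GL (Fin 3) K) : Matrix (Fin 3) (Fin 3) K) - 1) *ᵥ (((κ : GL (Fin 3) K) : Matrix (Fin 3) (Fin 3) K) *ᵥ (Pi.single 0 1))) ∧ P' (IsLocalRing.residue 𝒪[K] t₀)} := by
    intro Pκ P' hiff
    have hB₀ : ∀ κ : unitaryGroupOfForm σ ((StdForm.antidiagonal 3).over K), (ϖ ^ d₀)⁻¹ * B₀ σ 3 (((κ : GL (Fin 3) K) : Matrix (Fin 3) (Fin 3) K) *ᵥ Pi.single 0 1) (((((u⁻¹ * γ * u : unitaryGroupOfForm σ ((StdForm.antidiagonal 3).over K)) : GL (Fin 3) K) : Matrix (Fin 3) (Fin 3) K) - 1) *ᵥ (((κ : GL (Fin 3) K) : Matrix (Fin 3) (Fin 3) K) *ᵥ Pi.single 0 1)) = ((ϖ ^ d₀)⁻¹ * pairing σ ((StdForm.antidiagonal 3).over K) (((κ : GL (Fin 3) K) : Matrix (Fin 3) (Fin 3) K) *ᵥ Pi.single 0 1) (((((u⁻¹ * γ * u : unitaryGroupOfForm σ ((StdForm.antidiagonal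 3).over K)) : GL (Fin 3) K) : Matrix (Fin 3) (Fin 3) K) - 1) *ᵥ (((κ : GL (Fin 3) K) : Matrix (Fin 3) (Fin 3) K) *ᵥ Pi.single 0 1))) := fun κ => by
      rw [pairing_antidiagonal]
    have hN₁ : ∀ κ : unitaryGroupOfForm σ ((StdForm.antidiagonal 3).over K), (latticeGraphIso σ ϖ ((StdForm.antidiagonal 3).over K) (u * κ) ⟨latt (Matrix.diagonal ![(1 : K), 1, ϖ]), 2, isVertexLattice_two_N₁_of_neg hσϖ hϖ⟩ : {M : Submodule 𝒪[K] (Fin 3 → K) // IsVertex σ ϖ ((StdForm.antidiagonal 3).over K) M}).1 = mapGL (((u * κ : unitaryGroupOfForm σ ((StdForm.antidiagonal 3).over K)) : GL (Fin 3) K)) (latt (Matrix.diagonal ![(1 : K), 1, ϖ])) := fun κ => rfl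
    apply Set.Subset.antisymm
    · rintro c ⟨hadj, κ, hκ, hc, hP⟩
      obtain ⟨t, ht⟩ := hvalint κ hκ
      refine ⟨?_, κ, hκ, ?_, t, ?_, (hiff κ hκ t ht).1 hP⟩
      · rw [SimpleGraph.mem_neighborSet, ← hvu]; exact hadj
      · rw [hc]; exact hN₁ κ
      · rw [hB₀ κ]; exact ht
    · rintro c ⟨hadj, κ, hκ, hc, t, ht, hP⟩
      rw [hB₀ κ] at ht
      rw [SimpleGraph.mem_neighborSet, ← hvu] at hadj
      exact ⟨hadj, κ, hκ, Subtype.ext (by rw [hN₁ κ]; exact hc), (hiff κ hκ t ht).2 hP⟩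
  -- residual constants
  have hnc0 : IsLocalRing.residue 𝒪[K] nc₁ ≠ 0 := residue_ne_zero_of_v_eq_one _ hnc₁v
  have hεns : ¬ IsSquare (IsLocalRing.residue 𝒪[K] εO) := by
    rintro ⟨r, hr⟩
    obtain ⟨z, hz⟩ := IsLocalRing.residue_surjective r
    have h1 := hε (z : K) z.2
    have h0 : IsLocalRing.residue 𝒪[K] (z ^ 2 - εO) = 0 := by rw [map_sub, map_pow, hz, hr]; ring
    rw [hres0] at h0
    push_cast at h0
    rw [hεO] at h0
    exact absurd h1 (ne_of_lt h0)
  have hεχ : quadraticChar 𝓀[K] (IsLocalRing.residue 𝒪[K] εO) = -1 := quadraticChar_neg_one_iff_not_isSquare.2 hεns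
  refine ⟨?_, ?_, ?_⟩
  · have hk' := hkey (fun κ => Valued.v ((ϖ ^ d₀)⁻¹ * pairing σ ((StdForm.antidiagonal 3).over K) (((κ : GL (Fin 3) K) : Matrix (Fin 3) (Fin 3) K) *ᵥ Pi.single 0 1) (((((u⁻¹ * γ * u : unitaryGroupOfForm σ ((StdForm.antidiagonal 3).over K)) : GL (Fin 3) K) : Matrix (Fin 3) (Fin 3) K) - 1) *ᵥ (((κ : GL (Fin 3) K) : Matrix (Fin 3) (Fin 3) K) *ᵥ Pi.single 0 1))) < 1) (fun r => r = 0) (fun κ _ t ht => by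
      show Valued.v ((ϖ ^ d₀)⁻¹ * pairing σ ((StdForm.antidiagonal 3).over K) (((κ : GL (Fin 3) K) : Matrix (Fin 3) (Fin 3) K) *ᵥ Pi.single 0 1) (((((u⁻¹ * γ * u : unitaryGroupOfForm σ ((StdForm.antidiagonal 3).over K)) : GL (Fin 3) K) : Matrix (Fin 3) (Fin 3) K) - 1) *ᵥ (((κ : GL (Fin 3) K) : Matrix (Fin 3) (Fin 3) K) *ᵥ Pi.single 0 1))) < 1 ↔ IsLocalRing.residue 𝒪[K] t = 0
      rw [hres0, ht])
    beta_reduce at hk'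
    exact hk'
  · have hk' := hkey (fun κ => ∃ a : K, Valued.v a = 1 ∧ Valued.v (((ϖ ^ d₀)⁻¹ * pairing σ ((StdForm.antidiagonal 3).over K) (((κ : GL (Fin 3) K) : Matrix (Fin 3) (Fin 3) K) *ᵥ Pi.single 0 1) (((((u⁻¹ * γ * u : unitaryGroupOfForm σ ((StdForm.antidiagonal 3).over K)) : GL (Fin 3) K) : Matrix (Fin 3) (Fin 3) K) - 1) *ᵥ (((κ : GL (Fin 3) K) : Matrix (Fin 3) (Fin 3) K) *ᵥ Pi.single 0 1))) - (-c₁) * a ^ 2) < 1) (fun r => quadraticChar 𝓀[K] ((IsLocalRing.residue 𝒪[K] nc₁)⁻¹ * r) = 1) (fun κ _ t ht => by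
      show (∃ a : K, Valued.v a = 1 ∧ Valued.v (((ϖ ^ d₀)⁻¹ * pairing σ ((StdForm.antidiagonal 3).over K) (((κ : GL (Fin 3) K) : Matrix (Fin 3) (Fin 3) K) *ᵥ Pi.single 0 1) (((((u⁻¹ * γ * u : unitaryGroupOfForm σ ((StdForm.antidiagonal 3).over K)) : GL (Fin 3) K) : Matrix (Fin 3) (Fin 3) K) - 1) *ᵥ (((κ : GL (Fin 3) K) : Matrix (Fin 3) (Fin 3) K) *ᵥ Pi.single 0 1))) - (-c₁) * a ^ 2) < 1) ↔ quadraticChar 𝓀[K] ((IsLocalRing.residue 𝒪[K] nc₁)⁻¹ * IsLocalRing.residue 𝒪[K] t) = 1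
      have h := exists_unit_v_sub_mul_sq_lt_one_iff_residue t nc₁
      rw [hnc₁, ht] at h
      exact h.trans (exists_eq_mul_sq_iff_quadraticChar_eq_one hnc0 _))
    beta_reduce at hk'
    exact hk'
  · have hk' := hkey (fun κ => ∃ a : K, Valued.v a = 1 ∧ Valued.v (((ϖ ^ d₀)⁻¹ * pairing σ ((StdForm.antidiagonal 3).over K) (((κ : GL (Fin 3) K) : Matrix (Fin 3) (Fin 3) K) *ᵥ Pi.single 0 1) (((((u⁻¹ * γ * u : unitaryGroupOfForm σ ((StdForm.antidiagonal 3).over K)) : GL (Fin 3) K) : Matrix (Fin 3) (Fin 3) K) - 1) *ᵥ (((κ : GL (Fin 3) K) : Matrix (Fin 3) (Fin 3) K) *ᵥ Pi.single 0 1))) - (-(c₁ * ε)) * a ^ 2) < 1) (fun r => quadraticChar 𝓀[K] ((IsLocalRing.residue 𝒪[K] nc₁)⁻¹ * r) = -1) (fun κ _ t ht => by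
      show (∃ a : K, Valued.v a = 1 ∧ Valued.v (((ϖ ^ d₀)⁻¹ * pairing σ ((StdForm.antidiagonal 3).over K) (((κ : GL (Fin 3) K) : Matrix (Fin 3) (Fin 3) K) *ᵥ Pi.single 0 1) (((((u⁻¹ * γ * u : unitaryGroupOfForm σ ((StdForm.antidiagonal 3).over K)) : GL (Fin 3) K) : Matrix (Fin 3) (Fin 3) K) - 1) *ᵥ (((κ : GL (Fin 3) K) : Matrix (Fin 3) (Fin 3) K) *ᵥ Pi.single 0 1))) - (-(c₁ * ε)) * a ^ 2) < 1) ↔ quadraticChar 𝓀[K] ((IsLocalRing.residue 𝒪[K] nc₁)⁻¹ * IsLocalRing.residue 𝒪[K] t) = -1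
      have h := exists_unit_v_sub_mul_sq_lt_one_iff_residue t (nc₁ * εO)
      push_cast at h
      rw [hnc₁, hεO, ht, neg_mul, map_mul] at h
      exact h.trans ((exists_congr fun a => by rw [mul_assoc]).trans (exists_eq_mul_mul_sq_iff_quadraticChar_eq_neg_one hnc0 hεχ _)))
    beta_reduce at hk'
    exact hk'

/-- **SET IDENTITIES AT THE ROOT with an adapted frame `u ∈ K₀`** (`r₀ = u·r₀`, a region-direction root child `u·N₁`): every child of the root is outward, so ★ (V4)'s
outward `E`-set is `NULL ∖ REGDIR`, `REGDIR ⊆ NULL`, and the `P`-∕`M`-sets are the class sets over all children. [cite: Kottwitz1986, §3] [cite: BruhatTits1972, §10] [cite: Serre1980Trees, I.2.3] -/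
theorem outwardSets_eq_of_adapted_root (hσ : ∀ x, σ (σ x) = x) (hvσ : ∀ a, Valued.v (σ a) = Valued.v a) (hσϖ : σ ϖ = -ϖ)
    (hϖ : Valued.v ϖ = WithZero.exp (-1 : ℤ))
    {γ : unitaryGroupOfForm σ ((StdForm.antidiagonal 3).over K)} {d : Fin 3 → K} (hd : ∀ i, Valued.v (d i) = 1)
    (A : GL (Fin 3) K) (hdA : Matrix.diagonal d = (-(Matrix.diagonal d).det) • formCongr σ A ((StdForm.antidiagonal 3).over K))
    (s : Fin 3 → K) (hγA : ((γ : GL (Fin 3) K) : Matrix (Fin 3) (Fin 3) K) = (A : Matrix (Fin 3) (Fin 3) K) * Matrix.diagonal s * ((A⁻¹ : GL (Fin 3) K) : Matrix (Fin 3) (Fin 3) K))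
    (i₀ : Fin 3) {d₀ : ℕ} (he : ∀ i, Valued.v (s i - 1) ≤ Valued.v ϖ ^ d₀) (hiso : ∀ m, m ≠ i₀ → Valued.v (s i₀ - s m) = Valued.v ϖ ^ d₀)
    {s' : ℕ} (hgap : ∀ j k, j ≠ i₀ → k ≠ i₀ → j ≠ k → Valued.v (s j - s k) = Valued.v ϖ ^ (d₀ + 2 * s')) {k : Fin 3} (hk : k ≠ i₀)
    (c₁ ε : K) (hc₁ : Valued.v c₁ = 1) (hεv : Valued.v ε = 1)
    (u : unitaryGroupOfForm σ ((StdForm.antidiagonal 3).over K)) {v : {M : Submodule 𝒪[K] (Fin 3 → K) // IsVertex σ ϖ ((StdForm.antidiagonal 3).over K) M}} (hvu : v = latticeGraphIso σ ϖ ((StdForm.antidiagonal 3).over K) u ⟨stdLattice K 3, 0, isSelfDualLattice_stdLattice_three_of_v hϖ⟩) (hv0 : v = ⟨stdLattice K 3, 0, isSelfDualLattice_stdLattice_three_of_v hϖ⟩)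
    (hv : IsSelfDualLattice σ ϖ ((StdForm.antidiagonal 3).over K) v.1) (hvR : v.1.map ((Matrix.toLin' (((γ : GL (Fin 3) K) : Matrix (Fin 3) (Fin 3) K) - 1)).restrictScalars 𝒪[K]) ≤ scaleLattice (ϖ ^ d₀) v.1) :
    {c : {M : Submodule 𝒪[K] (Fin 3 → K) // IsVertex σ ϖ ((StdForm.antidiagonal 3).over K) M} | (latticeGraph σ ϖ ((StdForm.antidiagonal 3).over K)).Adj v c ∧ (latticeGraph σ ϖ ((StdForm.antidiagonal 3).over K)).dist ⟨stdLattice K 3, 0, isSelfDualLattice_stdLattice_three_of_v hϖ⟩ c = (latticeGraph σ ϖ ((StdForm.antidiagonal 3).over K)).dist ⟨stdLattice K 3, 0, isSelfDualLattice_stdLattice_three_of_v hϖ⟩ v + 1 ∧ ∃ κ : unitaryGroupOfForm σ ((StdForm.antidiagonal 3).over K), κ ∈ unitaryInt σ ((StdForm.antidiagonal 3).over K) ∧ c = latticeGraphIso σ ϖ ((StdForm.antidiagonal 3).over K) (u * κ) ⟨latt (Matrix.diagonal ![(1 : K), 1, ϖ]), 2, isVertexLattice_two_N₁_of_neg hσϖ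 hϖ⟩ ∧ (¬ (Valued.v (pairing σ ((StdForm.antidiagonal 3).over K) ((((u * κ : unitaryGroupOfForm σ ((StdForm.antidiagonal 3).over K)) : GL (Fin 3) K) : Matrix (Fin 3) (Fin 3) K) *ᵥ Pi.single 0 1) ((A : Matrix (Fin 3) (Fin 3) K) *ᵥ Pi.single i₀ 1)) < 1 ∧ Valued.v (pairing σ ((StdForm.antidiagonal 3).over K) ((((u * κ : unitaryGroupOfForm σ ((StdForm.antidiagonal 3).over K)) : GL (Fin 3) K) : Matrix (Fin 3) (Fin 3) K) *ᵥ Pi.single 0 1) (ϖ ^ s' • ((A : Matrix (Fin 3) (Fin 3) K) *ᵥ Pi.single k 1))) < 1) ∧ Valued.v ((ϖ ^ d₀)⁻¹ * pairing σ ((StdForm.antidiagonal 3).over K) (((κ : GL (Fin 3) K) : Matrix (Fin 3) (Fin 3) K) *ᵥ Pi.single 0 1) (((((u⁻¹ * γ * u : unitaryGroupOfForm σ ((StdForm.antidiagonal 3).over K)) : GL (Fin 3) K) : Matrix (Fin 3) (Fin 3) K) - 1) *ᵥ (((κ : GL (Fin 3) K) : Matrix (Fin 3) (Fin 3) K) *ᵥ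 Pi.single 0 1))) < 1)} = {c : {M : Submodule 𝒪[K] (Fin 3 → K) // IsVertex σ ϖ ((StdForm.antidiagonal 3).over K) M} | (latticeGraph σ ϖ ((StdForm.antidiagonal 3).over K)).Adj v c ∧ ∃ κ : unitaryGroupOfForm σ ((StdForm.antidiagonal 3).over K), κ ∈ unitaryInt σ ((StdForm.antidiagonal 3).over K) ∧ c = latticeGraphIso σ ϖ ((StdForm.antidiagonal 3).over K) (u * κ) ⟨latt (Matrix.diagonal ![(1 : K), 1, ϖ]), 2, isVertexLattice_two_N₁_of_neg hσϖ hϖ⟩ ∧ Valued.v ((ϖ ^ d₀)⁻¹ * pairing σ ((StdForm.antidiagonal 3).over K) (((κ : GL (Fin 3) K) : Matrix (Fin 3) (Fin 3) K) *ᵥ Pi.single 0 1) (((((u⁻¹ * γ * u : unitaryGroupOfForm σ ((StdForm.antidiagonal 3).over K)) : GL (Fin 3) K) : Matrix (Fin 3) (Fin 3) K) - 1) *ᵥ (((κ : GL (Fin 3) K) : Matrix (Fin 3) (Fin 3) K) *ᵥ Pi.single 0 1))) < 1} \ {c : {M : Submodule 𝒪[K] (Fin 3 → K) // IsVertex σ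 ϖ ((StdForm.antidiagonal 3).over K) M} | (latticeGraph σ ϖ ((StdForm.antidiagonal 3).over K)).Adj v c ∧ ∃ κ : unitaryGroupOfForm σ ((StdForm.antidiagonal 3).over K), κ ∈ unitaryInt σ ((StdForm.antidiagonal 3).over K) ∧ c = latticeGraphIso σ ϖ ((StdForm.antidiagonal 3).over K) (u * κ) ⟨latt (Matrix.diagonal ![(1 : K), 1, ϖ]), 2, isVertexLattice_two_N₁_of_neg hσϖ hϖ⟩ ∧ (Valued.v (pairing σ ((StdForm.antidiagonal 3).over K) ((((u * κ : unitaryGroupOfForm σ ((StdForm.antidiagonal 3).over K)) : GL (Fin 3) K) : Matrix (Fin 3) (Fin 3) K) *ᵥ Pi.single 0 1) ((A : Matrix (Fin 3) (Fin 3) K) *ᵥ Pi.single i₀ 1)) < 1 ∧ Valued.v (pairing σ ((StdForm.antidiagonal 3).over K) ((((u * κ : unitaryGroupOfForm σ ((StdForm.antidiagonal 3).over K)) : GL (Fin 3) K) : Matrix (Fin 3) (Fin 3) K) *ᵥ Pi.single 0 1) (ϖ ^ s' • ((A : Matrix (Fin 3) (Fin 3) K) *ᵥ Pi.single k 1)))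 < 1)} ∧
    {c : {M : Submodule 𝒪[K] (Fin 3 → K) // IsVertex σ ϖ ((StdForm.antidiagonal 3).over K) M} | (latticeGraph σ ϖ ((StdForm.antidiagonal 3).over K)).Adj v c ∧ ∃ κ : unitaryGroupOfForm σ ((StdForm.antidiagonal 3).over K), κ ∈ unitaryInt σ ((StdForm.antidiagonal 3).over K) ∧ c = latticeGraphIso σ ϖ ((StdForm.antidiagonal 3).over K) (u * κ) ⟨latt (Matrix.diagonal ![(1 : K), 1, ϖ]), 2, isVertexLattice_two_N₁_of_neg hσϖ hϖ⟩ ∧ (Valued.v (pairing σ ((StdForm.antidiagonal 3).over K) ((((u * κ : unitaryGroupOfForm σ ((StdForm.antidiagonal 3).over K)) : GL (Fin 3) K) : Matrix (Fin 3) (Fin 3) K) *ᵥ Pi.single 0 1) ((A : Matrix (Fin 3) (Fin 3) K) *ᵥ Pi.single i₀ 1)) < 1 ∧ Valued.v (pairing σ ((StdForm.antidiagonal 3).over K) ((((u * κ : unitaryGroupOfForm σ ((StdForm.antidiagonal 3).over K)) : GL (Fin 3) K) : Matrix (Fin 3) (Fin 3) K) *ᵥ Pi.single 0 1) (ϖ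 ^ s' • ((A : Matrix (Fin 3) (Fin 3) K) *ᵥ Pi.single k 1))) < 1)} ⊆ {c : {M : Submodule 𝒪[K] (Fin 3 → K) // IsVertex σ ϖ ((StdForm.antidiagonal 3).over K) M} | (latticeGraph σ ϖ ((StdForm.antidiagonal 3).over K)).Adj v c ∧ ∃ κ : unitaryGroupOfForm σ ((StdForm.antidiagonal 3).over K), κ ∈ unitaryInt σ ((StdForm.antidiagonal 3).over K) ∧ c = latticeGraphIso σ ϖ ((StdForm.antidiagonal 3).over K) (u * κ) ⟨latt (Matrix.diagonal ![(1 : K), 1, ϖ]), 2, isVertexLattice_two_N₁_of_neg hσϖ hϖ⟩ ∧ Valued.v ((ϖ ^ d₀)⁻¹ * pairing σ ((StdForm.antidiagonal 3).over K) (((κ : GL (Fin 3) K) : Matrix (Fin 3) (Fin 3) K) *ᵥ Pi.single 0 1) (((((u⁻¹ * γ * u : unitaryGroupOfForm σ ((StdForm.antidiagonal 3).over K)) : GL (Fin 3) K) : Matrix (Fin 3) (Fin 3) K) - 1) *ᵥ (((κ : GL (Fin 3) K) : Matrix (Fin 3) (Fin 3) K) *ᵥ Pi.single 0 1))) < 1}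 ∧
    {c : {M : Submodule 𝒪[K] (Fin 3 → K) // IsVertex σ ϖ ((StdForm.antidiagonal 3).over K) M} | (latticeGraph σ ϖ ((StdForm.antidiagonal 3).over K)).Adj v c ∧ (latticeGraph σ ϖ ((StdForm.antidiagonal 3).over K)).dist ⟨stdLattice K 3, 0, isSelfDualLattice_stdLattice_three_of_v hϖ⟩ c = (latticeGraph σ ϖ ((StdForm.antidiagonal 3).over K)).dist ⟨stdLattice K 3, 0, isSelfDualLattice_stdLattice_three_of_v hϖ⟩ v + 1 ∧ ∃ κ : unitaryGroupOfForm σ ((StdForm.antidiagonal 3).over K), κ ∈ unitaryInt σ ((StdForm.antidiagonal 3).over K) ∧ c = latticeGraphIso σ ϖ ((StdForm.antidiagonal 3).over K) (u * κ) ⟨latt (Matrix.diagonal ![(1 : K), 1, ϖ]), 2, isVertexLattice_two_N₁_of_neg hσϖ hϖ⟩ ∧ (¬ (Valued.v (pairing σ ((StdForm.antidiagonal 3).over K) ((((u * κ : unitaryGroupOfForm σ ((StdForm.antidiagonal 3).over K)) : GL (Fin 3) K) : Matrix (Fin 3) (Fin 3) K) *ᵥ Pi.single 0 1) ((A : Matrix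 (Fin 3) (Fin 3) K) *ᵥ Pi.single i₀ 1)) < 1 ∧ Valued.v (pairing σ ((StdForm.antidiagonal 3).over K) ((((u * κ : unitaryGroupOfForm σ ((StdForm.antidiagonal 3).over K)) : GL (Fin 3) K) : Matrix (Fin 3) (Fin 3) K) *ᵥ Pi.single 0 1) (ϖ ^ s' • ((A : Matrix (Fin 3) (Fin 3) K) *ᵥ Pi.single k 1))) < 1) ∧ ∃ a : K, Valued.v a = 1 ∧ Valued.v (((ϖ ^ d₀)⁻¹ * pairing σ ((StdForm.antidiagonal 3).over K) (((κ : GL (Fin 3) K) : Matrix (Fin 3) (Fin 3) K) *ᵥ Pi.single 0 1) (((((u⁻¹ * γ * u : unitaryGroupOfForm σ ((StdForm.antidiagonal 3).over K)) : GL (Fin 3) K) : Matrix (Fin 3) (Fin 3) K) - 1) *ᵥ (((κ : GL (Fin 3) K) : Matrix (Fin 3) (Fin 3) K) *ᵥ Pi.single 0 1))) - (-c₁) * a ^ 2) < 1)} = {c : {M : Submodule 𝒪[K] (Fin 3 → K) // IsVertex σ ϖ ((StdForm.antidiagonal 3).over K) M} | (latticeGraph σ ϖ ((StdForm.antidiagonal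 3).over K)).Adj v c ∧ ∃ κ : unitaryGroupOfForm σ ((StdForm.antidiagonal 3).over K), κ ∈ unitaryInt σ ((StdForm.antidiagonal 3).over K) ∧ c = latticeGraphIso σ ϖ ((StdForm.antidiagonal 3).over K) (u * κ) ⟨latt (Matrix.diagonal ![(1 : K), 1, ϖ]), 2, isVertexLattice_two_N₁_of_neg hσϖ hϖ⟩ ∧ (∃ a : K, Valued.v a = 1 ∧ Valued.v (((ϖ ^ d₀)⁻¹ * pairing σ ((StdForm.antidiagonal 3).over K) (((κ : GL (Fin 3) K) : Matrix (Fin 3) (Fin 3) K) *ᵥ Pi.single 0 1) (((((u⁻¹ * γ * u : unitaryGroupOfForm σ ((StdForm.antidiagonal 3).over K)) : GL (Fin 3) K) : Matrix (Fin 3) (Fin 3) K) - 1) *ᵥ (((κ : GL (Fin 3) K) : Matrix (Fin 3) (Fin 3) K) *ᵥ Pi.single 0 1))) - (-c₁) * a ^ 2) < 1)} ∧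
    {c : {M : Submodule 𝒪[K] (Fin 3 → K) // IsVertex σ ϖ ((StdForm.antidiagonal 3).over K) M} | (latticeGraph σ ϖ ((StdForm.antidiagonal 3).over K)).Adj v c ∧ (latticeGraph σ ϖ ((StdForm.antidiagonal 3).over K)).dist ⟨stdLattice K 3, 0, isSelfDualLattice_stdLattice_three_of_v hϖ⟩ c = (latticeGraph σ ϖ ((StdForm.antidiagonal 3).over K)).dist ⟨stdLattice K 3, 0, isSelfDualLattice_stdLattice_three_of_v hϖ⟩ v + 1 ∧ ∃ κ : unitaryGroupOfForm σ ((StdForm.antidiagonal 3).over K), κ ∈ unitaryInt σ ((StdForm.antidiagonal 3).over K) ∧ c = latticeGraphIso σ ϖ ((StdForm.antidiagonal 3).over K) (u * κ) ⟨latt (Matrix.diagonal ![(1 : K), 1, ϖ]), 2, isVertexLattice_two_N₁_of_neg hσϖ hϖ⟩ ∧ (¬ (Valued.v (pairing σ ((StdForm.antidiagonal 3).over K) ((((u * κ : unitaryGroupOfForm σ ((StdForm.antidiagonal 3).over K)) : GL (Fin 3) K) : Matrix (Fin 3) (Fin 3) K) *ᵥ Pi.single 0 1) ((A : Matrix (Fin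 3) (Fin 3) K) *ᵥ Pi.single i₀ 1)) < 1 ∧ Valued.v (pairing σ ((StdForm.antidiagonal 3).over K) ((((u * κ : unitaryGroupOfForm σ ((StdForm.antidiagonal 3).over K)) : GL (Fin 3) K) : Matrix (Fin 3) (Fin 3) K) *ᵥ Pi.single 0 1) (ϖ ^ s' • ((A : Matrix (Fin 3) (Fin 3) K) *ᵥ Pi.single k 1))) < 1) ∧ ∃ a : K, Valued.v a = 1 ∧ Valued.v (((ϖ ^ d₀)⁻¹ * pairing σ ((StdForm.antidiagonal 3).over K) (((κ : GL (Fin 3) K) : Matrix (Fin 3) (Fin 3) K) *ᵥ Pi.single 0 1) (((((u⁻¹ * γ * u : unitaryGroupOfForm σ ((StdForm.antidiagonal 3).over K)) : GL (Fin 3) K) : Matrix (Fin 3) (Fin 3) K) - 1) *ᵥ (((κ : GL (Fin 3) K) : Matrix (Fin 3) (Fin 3) K) *ᵥ Pi.single 0 1))) - (-(c₁ * ε)) * a ^ 2) < 1)} = {c : {M : Submodule 𝒪[K] (Fin 3 → K) // IsVertex σ ϖ ((StdForm.antidiagonal 3).over K) M} | (latticeGraph σ ϖ ((StdForm.antidiagonal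 3).over K)).Adj v c ∧ ∃ κ : unitaryGroupOfForm σ ((StdForm.antidiagonal 3).over K), κ ∈ unitaryInt σ ((StdForm.antidiagonal 3).over K) ∧ c = latticeGraphIso σ ϖ ((StdForm.antidiagonal 3).over K) (u * κ) ⟨latt (Matrix.diagonal ![(1 : K), 1, ϖ]), 2, isVertexLattice_two_N₁_of_neg hσϖ hϖ⟩ ∧ (∃ a : K, Valued.v a = 1 ∧ Valued.v (((ϖ ^ d₀)⁻¹ * pairing σ ((StdForm.antidiagonal 3).over K) (((κ : GL (Fin 3) K) : Matrix (Fin 3) (Fin 3) K) *ᵥ Pi.single 0 1) (((((u⁻¹ * γ * u : unitaryGroupOfForm σ ((StdForm.antidiagonal 3).over K)) : GL (Fin 3) K) : Matrix (Fin 3) (Fin 3) K) - 1) *ᵥ (((κ : GL (Fin 3) K) : Matrix (Fin 3) (Fin 3) K) *ᵥ Pi.single 0 1))) - (-(c₁ * ε)) * a ^ 2) < 1)} := by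
  -- the two test vectors lie in `v` (★ REGION CRITERION)
  obtain ⟨hyI, hyK⟩ := (map_sub_one_le_scaleLattice_iff_mem_and_mem_of_isSelfDualLattice hσ hvσ hϖ A hd hdA s hγA i₀ he hiso hgap hv hk).1 hvR
  rw [hvu] at hyI hyK
  have hRDiff : ∀ κ : unitaryGroupOfForm σ ((StdForm.antidiagonal 3).over K), κ ∈ unitaryInt σ ((StdForm.antidiagonal 3).over K) → ((Valued.v (pairing σ ((StdForm.antidiagonal 3).over K) ((((u * κ : unitaryGroupOfForm σ ((StdForm.antidiagonal 3).over K)) : GL (Fin 3) K) : Matrix (Fin 3) (Fin 3) K) *ᵥ Pi.single 0 1) ((A : Matrix (Fin 3) (Fin 3) K) *ᵥ Pi.single i₀ 1)) < 1 ∧ Valued.v (pairing σ ((StdForm.antidiagonal 3).over K) ((((u * κ : unitaryGroupOfForm σ ((StdForm.antidiagonal 3).over K)) : GL (Fin 3) K) : Matrix (Fin 3) (Fin 3) K) *ᵥ Pi.single 0 1) (ϖ ^ s' • ((A : Matrix (Fin 3) (Fin 3) K) *ᵥ Pi.single k 1))) < 1) ↔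
      (((A : Matrix (Fin 3) (Fin 3) K) *ᵥ Pi.single i₀ 1) ∈ (latticeGraphIso σ ϖ ((StdForm.antidiagonal 3).over K) (u * κ) ⟨latt (Matrix.diagonal ![(1 : K), 1, ϖ]), 2, isVertexLattice_two_N₁_of_neg hσϖ hϖ⟩ : {M : Submodule 𝒪[K] (Fin 3 → K) // IsVertex σ ϖ ((StdForm.antidiagonal 3).over K) M}).1 ∧ (ϖ ^ s' • ((A : Matrix (Fin 3) (Fin 3) K) *ᵥ Pi.single k 1)) ∈ (latticeGraphIso σ ϖ ((StdForm.antidiagonal 3).over K) (u * κ) ⟨latt (Matrix.diagonal ![(1 : K), 1, ϖ]), 2, isVertexLattice_two_N₁_of_neg hσϖ hϖ⟩ : {M : Submodule 𝒪[K] (Fin 3 → K) // IsVertex σ ϖ ((StdForm.antidiagonal 3).over K) M}).1)) := fun κ hκ =>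
    and_congr (v_pairing_lt_one_iff_mem_child hσϖ hϖ u hκ hyI) (v_pairing_lt_one_iff_mem_child hσϖ hϖ u hκ hyK)
  have hRDnull : ∀ κ : unitaryGroupOfForm σ ((StdForm.antidiagonal 3).over K), (Valued.v (pairing σ ((StdForm.antidiagonal 3).over K) ((((u * κ : unitaryGroupOfForm σ ((StdForm.antidiagonal 3).over K)) : GL (Fin 3) K) : Matrix (Fin 3) (Fin 3) K) *ᵥ Pi.single 0 1) ((A : Matrix (Fin 3) (Fin 3) K) *ᵥ Pi.single i₀ 1)) < 1 ∧ Valued.v (pairing σ ((StdForm.antidiagonal 3).over K) ((((u * κ : unitaryGroupOfForm σ ((StdForm.antidiagonal 3).over K)) : GL (Fin 3) K) : Matrix (Fin 3) (Fin 3) K) *ᵥ Pi.single 0 1) (ϖ ^ s' • ((A : Matrix (Fin 3) (Fin 3) K) *ᵥ Pi.single k 1))) < 1) → Valued.v ((ϖ ^ d₀)⁻¹ * pairing σ ((StdForm.antidiagonal 3).over K) (((κ : GL (Fin 3) K) : Matrix (Fin 3) (Fin 3) K) *ᵥ Pi.single 0 1) (((((u⁻¹ * γ * u : unitaryGroupOfForm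 σ ((StdForm.antidiagonal 3).over K)) : GL (Fin 3) K) : Matrix (Fin 3) (Fin 3) K) - 1) *ᵥ (((κ : GL (Fin 3) K) : Matrix (Fin 3) (Fin 3) K) *ᵥ Pi.single 0 1))) < 1 := fun κ hR =>
    v_lineValue_lt_one_of_regDir hσ hvσ hϖ hd A hdA s hγA i₀ hiso hgap hk u κ hR
  -- at the root every child is outward
  have hout : ∀ c : {M : Submodule 𝒪[K] (Fin 3 → K) // IsVertex σ ϖ ((StdForm.antidiagonal 3).over K) M}, (latticeGraph σ ϖ ((StdForm.antidiagonal 3).over K)).Adj v c → (latticeGraph σ ϖ ((StdForm.antidiagonal 3).over K)).dist ⟨stdLattice K 3, 0, isSelfDualLattice_stdLattice_three_of_v hϖ⟩ c = (latticeGraph σ ϖ ((StdForm.antidiagonal 3).over K)).dist ⟨stdLattice K 3, 0, isSelfDualLattice_stdLattice_three_of_v hϖ⟩ v + 1 := fun c hc => by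
    rw [hv0] at hc ⊢; exact dist_eq_dist_self_add_one_of_adj hc
  have hnn : ∀ (X tt : K), Valued.v tt = 1 → (∃ a : K, Valued.v a = 1 ∧ Valued.v (X - tt * a ^ 2) < 1) → ¬ Valued.v X < 1 := by
    rintro X tt htt ⟨a, ha, hlt⟩ hX
    have h1 : Valued.v (tt * a ^ 2) = 1 := by rw [map_mul, map_pow, htt, ha, one_pow, mul_one]
    have h2 : Valued.v (tt * a ^ 2) < 1 := by
      have e : tt * a ^ 2 = X - (X - tt * a ^ 2) := by ring
      rw [e]; exact lt_of_le_of_lt (Valuation.map_sub _ _ _) (max_lt hX hlt)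
    exact absurd h1 (ne_of_lt h2)
  have hnc₁ : Valued.v (-c₁) = 1 := by rw [Valuation.map_neg, hc₁]
  have hnc₁ε : Valued.v (-(c₁ * ε)) = 1 := by rw [Valuation.map_neg, map_mul, hc₁, hεv, mul_one]
  refine ⟨?_, ?_, ?_, ?_⟩
  · ext c
    simp only [Set.mem_sdiff, Set.mem_setOf_eq]
    constructor
    · rintro ⟨hadj, -, κ, hκ, hc, hnR, hnull⟩
      refine ⟨⟨hadj, κ, hκ, hc, hnull⟩, ?_⟩
      rintro ⟨-, κ', hκ', hc', hR'⟩
      exact hnR ((hRDiff κ hκ).2 (by rw [← hc, hc']; exact (hRDiff κ' hκ').1 hR'))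
    · rintro ⟨⟨hadj, κ, hκ, hc, hnull⟩, hnB⟩
      exact ⟨hadj, hout c hadj, κ, hκ, hc, fun hR => hnB ⟨hadj, κ, hκ, hc, hR⟩, hnull⟩
  · rintro c ⟨hadj, κ, hκ, hc, hR⟩
    exact ⟨hadj, κ, hκ, hc, hRDnull κ hR⟩
  · ext c
    simp only [Set.mem_setOf_eq]
    constructor
    · rintro ⟨hadj, -, κ, hκ, hc, -, hcls⟩
      exact ⟨hadj, κ, hκ, hc, hcls⟩
    · rintro ⟨hadj, κ, hκ, hc, hcls⟩
      exact ⟨hadj, hout c hadj, κ, hκ, hc, fun hR => hnn _ _ hnc₁ hcls (hRDnull κ hR), hcls⟩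
  · ext c
    simp only [Set.mem_setOf_eq]
    constructor
    · rintro ⟨hadj, -, κ, hκ, hc, -, hcls⟩
      exact ⟨hadj, κ, hκ, hc, hcls⟩
    · rintro ⟨hadj, κ, hκ, hc, hcls⟩
      exact ⟨hadj, hout c hadj, κ, hκ, hc, fun hR => hnn _ _ hnc₁ε hcls (hRDnull κ hR), hcls⟩

/-! ## §4 The κ-keyed line counts of ★ (V4) at an adapted vertex: INTERIOR∕ROOT values and END values -/

/-- **INTERIOR∕ROOT VALUES.**  At an adapted region vertex `v = u·r₀` (`hlam`, `hmu`) with `ϖ^{s'−1}A e_k ∈ v` (not an END vertex) and TWO region directions among its children, if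
★ (V4)'s outward sets satisfy the §2 identities, then `#E = 0`, `#P = (q − 1)[lock]`, `#M = (q − 1)[¬lock]` (★ (V1) shape with `l = 0`, ★ (V2) counts, `lock ⟺ χ(c₀·c) = 1` by
★ (V1)'s class pin). [cite: Kottwitz1986, §3] [cite: Rogawski1990, §4.9 Prop. 4.9.1 p. 55] [cite: BruhatTits1972, §10] -/
theorem lineCounts_of_not_end (hσ : ∀ x, σ (σ x) = x) (hvσ : ∀ a, Valued.v (σ a) = Valued.v a) (hσϖ : σ ϖ = -ϖ)
    (hϖ : Valued.v ϖ = WithZero.exp (-1 : ℤ)) (hres : ∀ x : K, Valued.v x ≤ 1 → Valued.v (σ x - x) < 1) (h2 : Valued.v (2 : K) = 1)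
    [Fintype 𝓀[K]] [DecidableEq 𝓀[K]]
    {γ : unitaryGroupOfForm σ ((StdForm.antidiagonal 3).over K)} (d : Fin 3 → K) (hd : ∀ i, Valued.v (d i) = 1) (hdσ : ∀ i, σ (d i) = d i)
    (A : GL (Fin 3) K) (hdA : Matrix.diagonal d = (-(Matrix.diagonal d).det) • formCongr σ A ((StdForm.antidiagonal 3).over K))
    (s : Fin 3 → K) (hγA : ((γ : GL (Fin 3) K) : Matrix (Fin 3) (Fin 3) K) = (A : Matrix (Fin 3) (Fin 3) K) * Matrix.diagonal s * ((A⁻¹ : GL (Fin 3) K) : Matrix (Fin 3) (Fin 3) K))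
    (i₀ : Fin 3) {d₀ : ℕ} (he : ∀ i, Valued.v (s i - 1) ≤ Valued.v ϖ ^ d₀) (hiso : ∀ m, m ≠ i₀ → Valued.v (s i₀ - s m) = Valued.v ϖ ^ d₀)
    {s' : ℕ} (hs' : 1 ≤ s') (hgap : ∀ j k, j ≠ i₀ → k ≠ i₀ → j ≠ k → Valued.v (s j - s k) = Valued.v ϖ ^ (d₀ + 2 * s'))
    {j k : Fin 3} (hj : j ≠ i₀) (hk : k ≠ i₀) (hjk : j ≠ k)
    (c₁ ε : K) (hc₁ : Valued.v c₁ = 1) (hεv : Valued.v ε = 1) (hε : ∀ z : K, Valued.v z ≤ 1 → Valued.v (z ^ 2 - ε) = 1)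
    (q : ℕ) (hq : q = Fintype.card 𝓀[K])
    (u : unitaryGroupOfForm σ ((StdForm.antidiagonal 3).over K)) {v : {M : Submodule 𝒪[K] (Fin 3 → K) // IsVertex σ ϖ ((StdForm.antidiagonal 3).over K) M}} (hvu : v = latticeGraphIso σ ϖ ((StdForm.antidiagonal 3).over K) u ⟨stdLattice K 3, 0, isSelfDualLattice_stdLattice_three_of_v hϖ⟩)
    (hv : IsSelfDualLattice σ ϖ ((StdForm.antidiagonal 3).over K) v.1) (hvR : v.1.map ((Matrix.toLin' (((γ : GL (Fin 3) K) : Matrix (Fin 3) (Fin 3) K) - 1)).restrictScalars 𝒪[K]) ≤ scaleLattice (ϖ ^ d₀) v.1)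
    (hlam : Valued.v (pairing σ ((StdForm.antidiagonal 3).over K) ((A : Matrix (Fin 3) (Fin 3) K) *ᵥ Pi.single i₀ 1) (((u : GL (Fin 3) K) : Matrix (Fin 3) (Fin 3) K) *ᵥ Pi.single 0 1)) < 1) (hmu : Valued.v (pairing σ ((StdForm.antidiagonal 3).over K) (ϖ ^ s' • ((A : Matrix (Fin 3) (Fin 3) K) *ᵥ Pi.single k 1)) (((u : GL (Fin 3) K) : Matrix (Fin 3) (Fin 3) K) *ᵥ Pi.single 0 1)) < 1)
    (hne : ϖ ^ (s' - 1) • ((A : Matrix (Fin 3) (Fin 3) K) *ᵥ Pi.single k 1) ∈ v.1)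
    (hEeq : {c : {M : Submodule 𝒪[K] (Fin 3 → K) // IsVertex σ ϖ ((StdForm.antidiagonal 3).over K) M} | (latticeGraph σ ϖ ((StdForm.antidiagonal 3).over K)).Adj v c ∧ (latticeGraph σ ϖ ((StdForm.antidiagonal 3).over K)).dist ⟨stdLattice K 3, 0, isSelfDualLattice_stdLattice_three_of_v hϖ⟩ c = (latticeGraph σ ϖ ((StdForm.antidiagonal 3).over K)).dist ⟨stdLattice K 3, 0, isSelfDualLattice_stdLattice_three_of_v hϖ⟩ v + 1 ∧ ∃ κ : unitaryGroupOfForm σ ((StdForm.antidiagonal 3).over K), κ ∈ unitaryInt σ ((StdForm.antidiagonal 3).over K) ∧ c = latticeGraphIso σ ϖ ((StdForm.antidiagonal 3).over K) (u * κ) ⟨latt (Matrix.diagonal ![(1 : K), 1, ϖ]), 2, isVertexLattice_two_N₁_of_neg hσϖ hϖ⟩ ∧ (¬ (Valued.v (pairing σ ((StdForm.antidiagonal 3).over K) ((((u * κ : unitaryGroupOfForm σ ((StdForm.antidiagonal 3).over K)) : GL (Fin 3) K) : Matrix (Fin 3) (Fin 3) K) *ᵥ Pi.single 0 1) ((A :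 Matrix (Fin 3) (Fin 3) K) *ᵥ Pi.single i₀ 1)) < 1 ∧ Valued.v (pairing σ ((StdForm.antidiagonal 3).over K) ((((u * κ : unitaryGroupOfForm σ ((StdForm.antidiagonal 3).over K)) : GL (Fin 3) K) : Matrix (Fin 3) (Fin 3) K) *ᵥ Pi.single 0 1) (ϖ ^ s' • ((A : Matrix (Fin 3) (Fin 3) K) *ᵥ Pi.single k 1))) < 1) ∧ Valued.v ((ϖ ^ d₀)⁻¹ * pairing σ ((StdForm.antidiagonal 3).over K) (((κ : GL (Fin 3) K) : Matrix (Fin 3) (Fin 3) K) *ᵥ Pi.single 0 1) (((((u⁻¹ * γ * u : unitaryGroupOfForm σ ((StdForm.antidiagonal 3).over K)) : GL (Fin 3) K) : Matrix (Fin 3) (Fin 3) K) - 1) *ᵥ (((κ : GL (Fin 3) K) : Matrix (Fin 3) (Fin 3) K) *ᵥ Pi.single 0 1))) < 1)} = {c : {M : Submodule 𝒪[K] (Fin 3 → K) // IsVertex σ ϖ ((StdForm.antidiagonal 3).over K) M} | (latticeGraph σ ϖ ((StdForm.antidiagonal 3).over K)).Adj v c ∧ ∃ κ : unitaryGroupOfForm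 σ ((StdForm.antidiagonal 3).over K), κ ∈ unitaryInt σ ((StdForm.antidiagonal 3).over K) ∧ c = latticeGraphIso σ ϖ ((StdForm.antidiagonal 3).over K) (u * κ) ⟨latt (Matrix.diagonal ![(1 : K), 1, ϖ]), 2, isVertexLattice_two_N₁_of_neg hσϖ hϖ⟩ ∧ Valued.v ((ϖ ^ d₀)⁻¹ * pairing σ ((StdForm.antidiagonal 3).over K) (((κ : GL (Fin 3) K) : Matrix (Fin 3) (Fin 3) K) *ᵥ Pi.single 0 1) (((((u⁻¹ * γ * u : unitaryGroupOfForm σ ((StdForm.antidiagonal 3).over K)) : GL (Fin 3) K) : Matrix (Fin 3) (Fin 3) K) - 1) *ᵥ (((κ : GL (Fin 3) K) : Matrix (Fin 3) (Fin 3) K) *ᵥ Pi.single 0 1))) < 1} \ {c : {M : Submodule 𝒪[K] (Fin 3 → K) // IsVertex σ ϖ ((StdForm.antidiagonal 3).over K) M} | (latticeGraph σ ϖ ((StdForm.antidiagonal 3).over K)).Adj v c ∧ ∃ κ : unitaryGroupOfForm σ ((StdForm.antidiagonal 3).over K), κ ∈ unitaryInt σ ((StdForm.antidiagonal 3).over K)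 ∧ c = latticeGraphIso σ ϖ ((StdForm.antidiagonal 3).over K) (u * κ) ⟨latt (Matrix.diagonal ![(1 : K), 1, ϖ]), 2, isVertexLattice_two_N₁_of_neg hσϖ hϖ⟩ ∧ (Valued.v (pairing σ ((StdForm.antidiagonal 3).over K) ((((u * κ : unitaryGroupOfForm σ ((StdForm.antidiagonal 3).over K)) : GL (Fin 3) K) : Matrix (Fin 3) (Fin 3) K) *ᵥ Pi.single 0 1) ((A : Matrix (Fin 3) (Fin 3) K) *ᵥ Pi.single i₀ 1)) < 1 ∧ Valued.v (pairing σ ((StdForm.antidiagonal 3).over K) ((((u * κ : unitaryGroupOfForm σ ((StdForm.antidiagonal 3).over K)) : GL (Fin 3) K) : Matrix (Fin 3) (Fin 3) K) *ᵥ Pi.single 0 1) (ϖ ^ s' • ((A : Matrix (Fin 3) (Fin 3) K) *ᵥ Pi.single k 1))) < 1)})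
    (hRDsub : {c : {M : Submodule 𝒪[K] (Fin 3 → K) // IsVertex σ ϖ ((StdForm.antidiagonal 3).over K) M} | (latticeGraph σ ϖ ((StdForm.antidiagonal 3).over K)).Adj v c ∧ ∃ κ : unitaryGroupOfForm σ ((StdForm.antidiagonal 3).over K), κ ∈ unitaryInt σ ((StdForm.antidiagonal 3).over K) ∧ c = latticeGraphIso σ ϖ ((StdForm.antidiagonal 3).over K) (u * κ) ⟨latt (Matrix.diagonal ![(1 : K), 1, ϖ]), 2, isVertexLattice_two_N₁_of_neg hσϖ hϖ⟩ ∧ (Valued.v (pairing σ ((StdForm.antidiagonal 3).over K) ((((u * κ : unitaryGroupOfForm σ ((StdForm.antidiagonal 3).over K)) : GL (Fin 3) K) : Matrix (Fin 3) (Fin 3) K) *ᵥ Pi.single 0 1) ((A : Matrix (Fin 3) (Fin 3) K) *ᵥ Pi.single i₀ 1)) < 1 ∧ Valued.v (pairing σ ((StdForm.antidiagonal 3).over K) ((((u * κ : unitaryGroupOfForm σ ((StdForm.antidiagonal 3).over K)) : GL (Fin 3) K) : Matrix (Fin 3) (Fin 3) K) *ᵥ Pi.single 0 1) (ϖ ^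 s' • ((A : Matrix (Fin 3) (Fin 3) K) *ᵥ Pi.single k 1))) < 1)} ⊆ {c : {M : Submodule 𝒪[K] (Fin 3 → K) // IsVertex σ ϖ ((StdForm.antidiagonal 3).over K) M} | (latticeGraph σ ϖ ((StdForm.antidiagonal 3).over K)).Adj v c ∧ ∃ κ : unitaryGroupOfForm σ ((StdForm.antidiagonal 3).over K), κ ∈ unitaryInt σ ((StdForm.antidiagonal 3).over K) ∧ c = latticeGraphIso σ ϖ ((StdForm.antidiagonal 3).over K) (u * κ) ⟨latt (Matrix.diagonal ![(1 : K), 1, ϖ]), 2, isVertexLattice_two_N₁_of_neg hσϖ hϖ⟩ ∧ Valued.v ((ϖ ^ d₀)⁻¹ * pairing σ ((StdForm.antidiagonal 3).over K) (((κ : GL (Fin 3) K) : Matrix (Fin 3) (Fin 3) K) *ᵥ Pi.single 0 1) (((((u⁻¹ * γ * u : unitaryGroupOfForm σ ((StdForm.antidiagonal 3).over K)) : GL (Fin 3) K) : Matrix (Fin 3) (Fin 3) K) - 1) *ᵥ (((κ : GL (Fin 3) K) : Matrix (Fin 3) (Fin 3) K) *ᵥ Pi.single 0 1))) < 1})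
    (hPeq : {c : {M : Submodule 𝒪[K] (Fin 3 → K) // IsVertex σ ϖ ((StdForm.antidiagonal 3).over K) M} | (latticeGraph σ ϖ ((StdForm.antidiagonal 3).over K)).Adj v c ∧ (latticeGraph σ ϖ ((StdForm.antidiagonal 3).over K)).dist ⟨stdLattice K 3, 0, isSelfDualLattice_stdLattice_three_of_v hϖ⟩ c = (latticeGraph σ ϖ ((StdForm.antidiagonal 3).over K)).dist ⟨stdLattice K 3, 0, isSelfDualLattice_stdLattice_three_of_v hϖ⟩ v + 1 ∧ ∃ κ : unitaryGroupOfForm σ ((StdForm.antidiagonal 3).over K), κ ∈ unitaryInt σ ((StdForm.antidiagonal 3).over K) ∧ c = latticeGraphIso σ ϖ ((StdForm.antidiagonal 3).over K) (u * κ) ⟨latt (Matrix.diagonal ![(1 : K), 1, ϖ]), 2, isVertexLattice_two_N₁_of_neg hσϖ hϖ⟩ ∧ (¬ (Valued.v (pairing σ ((StdForm.antidiagonal 3).over K) ((((u * κ : unitaryGroupOfForm σ ((StdForm.antidiagonal 3).over K)) : GL (Fin 3) K) : Matrix (Fin 3) (Fin 3) K) *ᵥ Pi.single 0 1) ((A :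 Matrix (Fin 3) (Fin 3) K) *ᵥ Pi.single i₀ 1)) < 1 ∧ Valued.v (pairing σ ((StdForm.antidiagonal 3).over K) ((((u * κ : unitaryGroupOfForm σ ((StdForm.antidiagonal 3).over K)) : GL (Fin 3) K) : Matrix (Fin 3) (Fin 3) K) *ᵥ Pi.single 0 1) (ϖ ^ s' • ((A : Matrix (Fin 3) (Fin 3) K) *ᵥ Pi.single k 1))) < 1) ∧ ∃ a : K, Valued.v a = 1 ∧ Valued.v (((ϖ ^ d₀)⁻¹ * pairing σ ((StdForm.antidiagonal 3).over K) (((κ : GL (Fin 3) K) : Matrix (Fin 3) (Fin 3) K) *ᵥ Pi.single 0 1) (((((u⁻¹ * γ * u : unitaryGroupOfForm σ ((StdForm.antidiagonal 3).over K)) : GL (Fin 3) K) : Matrix (Fin 3) (Fin 3) K) - 1) *ᵥ (((κ : GL (Fin 3) K) : Matrix (Fin 3) (Fin 3) K) *ᵥ Pi.single 0 1))) - (-c₁) * a ^ 2) < 1)} = {c : {M : Submodule 𝒪[K] (Fin 3 → K) // IsVertex σ ϖ ((StdForm.antidiagonal 3).over K) M} | (latticeGraph σ ϖ ((StdForm.antidiagonal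 3).over K)).Adj v c ∧ ∃ κ : unitaryGroupOfForm σ ((StdForm.antidiagonal 3).over K), κ ∈ unitaryInt σ ((StdForm.antidiagonal 3).over K) ∧ c = latticeGraphIso σ ϖ ((StdForm.antidiagonal 3).over K) (u * κ) ⟨latt (Matrix.diagonal ![(1 : K), 1, ϖ]), 2, isVertexLattice_two_N₁_of_neg hσϖ hϖ⟩ ∧ (∃ a : K, Valued.v a = 1 ∧ Valued.v (((ϖ ^ d₀)⁻¹ * pairing σ ((StdForm.antidiagonal 3).over K) (((κ : GL (Fin 3) K) : Matrix (Fin 3) (Fin 3) K) *ᵥ Pi.single 0 1) (((((u⁻¹ * γ * u : unitaryGroupOfForm σ ((StdForm.antidiagonal 3).over K)) : GL (Fin 3) K) : Matrix (Fin 3) (Fin 3) K) - 1) *ᵥ (((κ : GL (Fin 3) K) : Matrix (Fin 3) (Fin 3) K) *ᵥ Pi.single 0 1))) - (-c₁) * a ^ 2) < 1)})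
    (hMeq : {c : {M : Submodule 𝒪[K] (Fin 3 → K) // IsVertex σ ϖ ((StdForm.antidiagonal 3).over K) M} | (latticeGraph σ ϖ ((StdForm.antidiagonal 3).over K)).Adj v c ∧ (latticeGraph σ ϖ ((StdForm.antidiagonal 3).over K)).dist ⟨stdLattice K 3, 0, isSelfDualLattice_stdLattice_three_of_v hϖ⟩ c = (latticeGraph σ ϖ ((StdForm.antidiagonal 3).over K)).dist ⟨stdLattice K 3, 0, isSelfDualLattice_stdLattice_three_of_v hϖ⟩ v + 1 ∧ ∃ κ : unitaryGroupOfForm σ ((StdForm.antidiagonal 3).over K), κ ∈ unitaryInt σ ((StdForm.antidiagonal 3).over K) ∧ c = latticeGraphIso σ ϖ ((StdForm.antidiagonal 3).over K) (u * κ) ⟨latt (Matrix.diagonal ![(1 : K), 1, ϖ]), 2, isVertexLattice_two_N₁_of_neg hσϖ hϖ⟩ ∧ (¬ (Valued.v (pairing σ ((StdForm.antidiagonal 3).over K) ((((u * κ : unitaryGroupOfForm σ ((StdForm.antidiagonal 3).over K)) : GL (Fin 3) K) : Matrix (Fin 3) (Fin 3) K) *ᵥ Pi.single 0 1) ((A :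 Matrix (Fin 3) (Fin 3) K) *ᵥ Pi.single i₀ 1)) < 1 ∧ Valued.v (pairing σ ((StdForm.antidiagonal 3).over K) ((((u * κ : unitaryGroupOfForm σ ((StdForm.antidiagonal 3).over K)) : GL (Fin 3) K) : Matrix (Fin 3) (Fin 3) K) *ᵥ Pi.single 0 1) (ϖ ^ s' • ((A : Matrix (Fin 3) (Fin 3) K) *ᵥ Pi.single k 1))) < 1) ∧ ∃ a : K, Valued.v a = 1 ∧ Valued.v (((ϖ ^ d₀)⁻¹ * pairing σ ((StdForm.antidiagonal 3).over K) (((κ : GL (Fin 3) K) : Matrix (Fin 3) (Fin 3) K) *ᵥ Pi.single 0 1) (((((u⁻¹ * γ * u : unitaryGroupOfForm σ ((StdForm.antidiagonal 3).over K)) : GL (Fin 3) K) : Matrix (Fin 3) (Fin 3) K) - 1) *ᵥ (((κ : GL (Fin 3) K) : Matrix (Fin 3) (Fin 3) K) *ᵥ Pi.single 0 1))) - (-(c₁ * ε)) * a ^ 2) < 1)} = {c : {M : Submodule 𝒪[K] (Fin 3 → K) // IsVertex σ ϖ ((StdForm.antidiagonal 3).over K) M} | (latticeGraph σ ϖ ((StdForm.antidiagonal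 3).over K)).Adj v c ∧ ∃ κ : unitaryGroupOfForm σ ((StdForm.antidiagonal 3).over K), κ ∈ unitaryInt σ ((StdForm.antidiagonal 3).over K) ∧ c = latticeGraphIso σ ϖ ((StdForm.antidiagonal 3).over K) (u * κ) ⟨latt (Matrix.diagonal ![(1 : K), 1, ϖ]), 2, isVertexLattice_two_N₁_of_neg hσϖ hϖ⟩ ∧ (∃ a : K, Valued.v a = 1 ∧ Valued.v (((ϖ ^ d₀)⁻¹ * pairing σ ((StdForm.antidiagonal 3).over K) (((κ : GL (Fin 3) K) : Matrix (Fin 3) (Fin 3) K) *ᵥ Pi.single 0 1) (((((u⁻¹ * γ * u : unitaryGroupOfForm σ ((StdForm.antidiagonal 3).over K)) : GL (Fin 3) K) : Matrix (Fin 3) (Fin 3) K) - 1) *ᵥ (((κ : GL (Fin 3) K) : Matrix (Fin 3) (Fin 3) K) *ᵥ Pi.single 0 1))) - (-(c₁ * ε)) * a ^ 2) < 1)})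
    (hRD : ({c : {M : Submodule 𝒪[K] (Fin 3 → K) // IsVertex σ ϖ ((StdForm.antidiagonal 3).over K) M} | (latticeGraph σ ϖ ((StdForm.antidiagonal 3).over K)).Adj v c ∧ ∃ κ : unitaryGroupOfForm σ ((StdForm.antidiagonal 3).over K), κ ∈ unitaryInt σ ((StdForm.antidiagonal 3).over K) ∧ c = latticeGraphIso σ ϖ ((StdForm.antidiagonal 3).over K) (u * κ) ⟨latt (Matrix.diagonal ![(1 : K), 1, ϖ]), 2, isVertexLattice_two_N₁_of_neg hσϖ hϖ⟩ ∧ (Valued.v (pairing σ ((StdForm.antidiagonal 3).over K) ((((u * κ : unitaryGroupOfForm σ ((StdForm.antidiagonal 3).over K)) : GL (Fin 3) K) : Matrix (Fin 3) (Fin 3) K) *ᵥ Pi.single 0 1) ((A : Matrix (Fin 3) (Fin 3) K) *ᵥ Pi.single i₀ 1)) < 1 ∧ Valued.v (pairing σ ((StdForm.antidiagonal 3).over K) ((((u * κ : unitaryGroupOfForm σ ((StdForm.antidiagonal 3).over K)) : GL (Fin 3) K) : Matrix (Fin 3) (Fin 3) K) *ᵥ Pi.single 0 1) (ϖ ^ s'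 • ((A : Matrix (Fin 3) (Fin 3) K) *ᵥ Pi.single k 1))) < 1)}).ncard = 2) :
    ({c : {M : Submodule 𝒪[K] (Fin 3 → K) // IsVertex σ ϖ ((StdForm.antidiagonal 3).over K) M} | (latticeGraph σ ϖ ((StdForm.antidiagonal 3).over K)).Adj v c ∧ (latticeGraph σ ϖ ((StdForm.antidiagonal 3).over K)).dist ⟨stdLattice K 3, 0, isSelfDualLattice_stdLattice_three_of_v hϖ⟩ c = (latticeGraph σ ϖ ((StdForm.antidiagonal 3).over K)).dist ⟨stdLattice K 3, 0, isSelfDualLattice_stdLattice_three_of_v hϖ⟩ v + 1 ∧ ∃ κ : unitaryGroupOfForm σ ((StdForm.antidiagonal 3).over K), κ ∈ unitaryInt σ ((StdForm.antidiagonal 3).over K) ∧ c = latticeGraphIso σ ϖ ((StdForm.antidiagonal 3).over K) (u * κ) ⟨latt (Matrix.diagonal ![(1 : K), 1, ϖ]), 2, isVertexLattice_two_N₁_of_neg hσϖ hϖ⟩ ∧ (¬ (Valued.v (pairing σ ((StdForm.antidiagonal 3).over K) ((((u * κ : unitaryGroupOfForm σ ((StdForm.antidiagonal 3).over K)) : GL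 (Fin 3) K) : Matrix (Fin 3) (Fin 3) K) *ᵥ Pi.single 0 1) ((A : Matrix (Fin 3) (Fin 3) K) *ᵥ Pi.single i₀ 1)) < 1 ∧ Valued.v (pairing σ ((StdForm.antidiagonal 3).over K) ((((u * κ : unitaryGroupOfForm σ ((StdForm.antidiagonal 3).over K)) : GL (Fin 3) K) : Matrix (Fin 3) (Fin 3) K) *ᵥ Pi.single 0 1) (ϖ ^ s' • ((A : Matrix (Fin 3) (Fin 3) K) *ᵥ Pi.single k 1))) < 1) ∧ Valued.v ((ϖ ^ d₀)⁻¹ * pairing σ ((StdForm.antidiagonal 3).over K) (((κ : GL (Fin 3) K) : Matrix (Fin 3) (Fin 3) K) *ᵥ Pi.single 0 1) (((((u⁻¹ * γ * u : unitaryGroupOfForm σ ((StdForm.antidiagonal 3).over K)) : GL (Fin 3) K) : Matrix (Fin 3) (Fin 3) K) - 1) *ᵥ (((κ : GL (Fin 3) K) : Matrix (Fin 3) (Fin 3) K) *ᵥ Pi.single 0 1))) < 1)}).ncard = 0 ∧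
    ({c : {M : Submodule 𝒪[K] (Fin 3 → K) // IsVertex σ ϖ ((StdForm.antidiagonal 3).over K) M} | (latticeGraph σ ϖ ((StdForm.antidiagonal 3).over K)).Adj v c ∧ (latticeGraph σ ϖ ((StdForm.antidiagonal 3).over K)).dist ⟨stdLattice K 3, 0, isSelfDualLattice_stdLattice_three_of_v hϖ⟩ c = (latticeGraph σ ϖ ((StdForm.antidiagonal 3).over K)).dist ⟨stdLattice K 3, 0, isSelfDualLattice_stdLattice_three_of_v hϖ⟩ v + 1 ∧ ∃ κ : unitaryGroupOfForm σ ((StdForm.antidiagonal 3).over K), κ ∈ unitaryInt σ ((StdForm.antidiagonal 3).over K) ∧ c = latticeGraphIso σ ϖ ((StdForm.antidiagonal 3).over K) (u * κ) ⟨latt (Matrix.diagonal ![(1 : K), 1, ϖ]), 2, isVertexLattice_two_N₁_of_neg hσϖ hϖ⟩ ∧ (¬ (Valued.v (pairing σ ((StdForm.antidiagonal 3).over K) ((((u * κ : unitaryGroupOfForm σ ((StdForm.antidiagonal 3).over K)) : GL (Fin 3) K) : Matrix (Fin 3) (Fin 3) K) *ᵥ Pi.single 0 1) ((A : Matrix (Fin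 3) (Fin 3) K) *ᵥ Pi.single i₀ 1)) < 1 ∧ Valued.v (pairing σ ((StdForm.antidiagonal 3).over K) ((((u * κ : unitaryGroupOfForm σ ((StdForm.antidiagonal 3).over K)) : GL (Fin 3) K) : Matrix (Fin 3) (Fin 3) K) *ᵥ Pi.single 0 1) (ϖ ^ s' • ((A : Matrix (Fin 3) (Fin 3) K) *ᵥ Pi.single k 1))) < 1) ∧ ∃ a : K, Valued.v a = 1 ∧ Valued.v (((ϖ ^ d₀)⁻¹ * pairing σ ((StdForm.antidiagonal 3).over K) (((κ : GL (Fin 3) K) : Matrix (Fin 3) (Fin 3) K) *ᵥ Pi.single 0 1) (((((u⁻¹ * γ * u : unitaryGroupOfForm σ ((StdForm.antidiagonal 3).over K)) : GL (Fin 3) K) : Matrix (Fin 3) (Fin 3) K) - 1) *ᵥ (((κ : GL (Fin 3) K) : Matrix (Fin 3) (Fin 3) K) *ᵥ Pi.single 0 1))) - (-c₁) * a ^ 2) < 1)}).ncard = (if (∃ a : K, Valued.v a = 1 ∧ Valued.v (((ϖ ^ d₀)⁻¹ * (s i₀ - s j) * (d i₀ * (-(Matrix.diagonal d).det)⁻¹))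 + c₁ * a ^ 2) < 1) then q - 1 else 0) ∧
    ({c : {M : Submodule 𝒪[K] (Fin 3 → K) // IsVertex σ ϖ ((StdForm.antidiagonal 3).over K) M} | (latticeGraph σ ϖ ((StdForm.antidiagonal 3).over K)).Adj v c ∧ (latticeGraph σ ϖ ((StdForm.antidiagonal 3).over K)).dist ⟨stdLattice K 3, 0, isSelfDualLattice_stdLattice_three_of_v hϖ⟩ c = (latticeGraph σ ϖ ((StdForm.antidiagonal 3).over K)).dist ⟨stdLattice K 3, 0, isSelfDualLattice_stdLattice_three_of_v hϖ⟩ v + 1 ∧ ∃ κ : unitaryGroupOfForm σ ((StdForm.antidiagonal 3).over K), κ ∈ unitaryInt σ ((StdForm.antidiagonal 3).over K) ∧ c = latticeGraphIso σ ϖ ((StdForm.antidiagonal 3).over K) (u * κ) ⟨latt (Matrix.diagonal ![(1 : K), 1, ϖ]), 2, isVertexLattice_two_N₁_of_neg hσϖ hϖ⟩ ∧ (¬ (Valued.v (pairing σ ((StdForm.antidiagonal 3).over K) ((((u * κ : unitaryGroupOfForm σ ((StdForm.antidiagonal 3).over K)) : GL (Fin 3) K) : Matrix (Fin 3) (Fin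 3) K) *ᵥ Pi.single 0 1) ((A : Matrix (Fin 3) (Fin 3) K) *ᵥ Pi.single i₀ 1)) < 1 ∧ Valued.v (pairing σ ((StdForm.antidiagonal 3).over K) ((((u * κ : unitaryGroupOfForm σ ((StdForm.antidiagonal 3).over K)) : GL (Fin 3) K) : Matrix (Fin 3) (Fin 3) K) *ᵥ Pi.single 0 1) (ϖ ^ s' • ((A : Matrix (Fin 3) (Fin 3) K) *ᵥ Pi.single k 1))) < 1) ∧ ∃ a : K, Valued.v a = 1 ∧ Valued.v (((ϖ ^ d₀)⁻¹ * pairing σ ((StdForm.antidiagonal 3).over K) (((κ : GL (Fin 3) K) : Matrix (Fin 3) (Fin 3) K) *ᵥ Pi.single 0 1) (((((u⁻¹ * γ * u : unitaryGroupOfForm σ ((StdForm.antidiagonal 3).over K)) : GL (Fin 3) K) : Matrix (Fin 3) (Fin 3) K) - 1) *ᵥ (((κ : GL (Fin 3) K) : Matrix (Fin 3) (Fin 3) K) *ᵥ Pi.single 0 1))) - (-(c₁ * ε)) * a ^ 2) < 1)}).ncard = (if (∃ a : K, Valued.v a = 1 ∧ Valued.v (((ϖ ^ d₀)⁻¹ *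 (s i₀ - s j) * (d i₀ * (-(Matrix.diagonal d).det)⁻¹)) + c₁ * a ^ 2) < 1) then 0 else q - 1) := by
  have hϖ0 : ϖ ≠ 0 := fun h0 => by rw [h0, map_zero] at hϖ; exact WithZero.coe_ne_zero hϖ.symm
  have hvϖ0 : Valued.v ϖ ≠ 0 := (Valuation.ne_zero_iff _).2 hϖ0
  have hres0 : ∀ x : 𝒪[K], IsLocalRing.residue 𝒪[K] x = 0 ↔ Valued.v (x : K) < 1 := residue_eq_zero_iff_v_lt_one
  have hk2 : ringChar 𝓀[K] ≠ 2 := ringChar_residueField_ne_two h2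
  -- the integral matrix `Y₀ = (ϖ^d₀)⁻¹(u⁻¹γu − 1)`
  have hY : ∀ a b, Valued.v (((((u⁻¹ * γ * u : unitaryGroupOfForm σ ((StdForm.antidiagonal 3).over K)) : GL (Fin 3) K) : Matrix (Fin 3) (Fin 3) K) - 1) a b) ≤ Valued.v ϖ ^ d₀ := by
    have h := (forall_v_conj_sub_one_le_iff_map_sub_one_le_scaleLattice γ u (pow_ne_zero d₀ hϖ0)).1 (by rw [hvu] at hvR; exact hvR)
    intro a b; rw [← map_pow]; exact h a b
  obtain ⟨Y₀, hY₀⟩ : ∃ Y₀ : Matrix (Fin 3) (Fin 3) 𝒪[K], ∀ a b, ((Y₀ a b : 𝒪[K]) : K) = (ϖ ^ d₀)⁻¹ * (((((u⁻¹ * γ * u : unitaryGroupOfForm σ ((StdForm.antidiagonal 3).over K)) : GL (Fin 3) K) : Matrix (Fin 3) (Fin 3) K) - 1) a b) := by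
    refine ⟨fun a b => ⟨(ϖ ^ d₀)⁻¹ * (((((u⁻¹ * γ * u : unitaryGroupOfForm σ ((StdForm.antidiagonal 3).over K)) : GL (Fin 3) K) : Matrix (Fin 3) (Fin 3) K) - 1) a b), (Valuation.mem_integer_iff _ _).2 ?_⟩, fun a b => rfl⟩
    rw [map_mul, map_inv₀, map_pow]
    calc (Valued.v ϖ ^ d₀)⁻¹ * Valued.v (((((u⁻¹ * γ * u : unitaryGroupOfForm σ ((StdForm.antidiagonal 3).over K)) : GL (Fin 3) K) : Matrix (Fin 3) (Fin 3) K) - 1) a b) ≤ (Valued.v ϖ ^ d₀)⁻¹ * Valued.v ϖ ^ d₀ := mul_le_mul_right (hY a b) _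
      _ = 1 := inv_mul_cancel₀ (pow_ne_zero _ hvϖ0)
  -- residual constants
  have hc₁O : -c₁ ∈ 𝒪[K] := (Valuation.mem_integer_iff _ _).2 (by rw [Valuation.map_neg]; exact hc₁.le)
  have hεO : ε ∈ 𝒪[K] := (Valuation.mem_integer_iff _ _).2 hεv.le
  have hnc₁v : Valued.v (((⟨-c₁, hc₁O⟩ : 𝒪[K]) : 𝒪[K]) : K) = 1 := by
    show Valued.v (-c₁) = 1
    rw [Valuation.map_neg, hc₁]
  have hnc0 : IsLocalRing.residue 𝒪[K] ⟨-c₁, hc₁O⟩ ≠ 0 := residue_ne_zero_of_v_eq_one _ hnc₁v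
  -- the SHAPE (★ (V1)) and the residue-test spelling (§3)
  obtain ⟨c, t, l, hc0, hshape, hl0, hCpin, hBpin⟩ :=
    isotropicValue_eq_vertexShape_of_region hσ hvσ hσϖ hϖ hres d hd hdσ A hdA s hγA i₀ he hiso hs' hgap hj hk hjk u hvu hv hvR hlam hmu Y₀ hY₀
  obtain ⟨hAeq, hAPeq, hAMeq⟩ := childSets_eq_residueTestSets (γ := γ) hvσ hσϖ hϖ hres c₁ ε hε u hvu Y₀ hY₀ ⟨-c₁, hc₁O⟩ rfl hnc₁v ⟨ε, hεO⟩ rfl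
  -- the ROOT-LINE class constant `C` and `lock ↔ χ(c₀ c) = 1`
  have htO : ∀ m, (ϖ ^ d₀)⁻¹ * (s m - 1) ∈ 𝒪[K] := fun m => by
    refine (Valuation.mem_integer_iff _ _).2 ?_
    rw [map_mul, map_inv₀, map_pow]
    have h' := mul_le_mul' (le_refl ((Valued.v ϖ ^ d₀)⁻¹)) (he m)
    rwa [inv_mul_cancel₀ (pow_ne_zero _ hvϖ0)] at h'
  have hcdet : Valued.v (-(Matrix.diagonal d).det) = 1 := by
    rw [Valuation.map_neg, Matrix.det_diagonal, map_prod]; exact Finset.prod_eq_one fun i _ => hd i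
  have hdcO : d i₀ * (-(Matrix.diagonal d).det)⁻¹ ∈ 𝒪[K] := by
    refine (Valuation.mem_integer_iff _ _).2 ?_
    rw [map_mul, map_inv₀, hd, hcdet, inv_one, mul_one]
  have hCO : ((ϖ ^ d₀)⁻¹ * (s i₀ - s j) * (d i₀ * (-(Matrix.diagonal d).det)⁻¹)) ∈ 𝒪[K] := by
    have h : ((ϖ ^ d₀)⁻¹ * (s i₀ - s j) * (d i₀ * (-(Matrix.diagonal d).det)⁻¹)) = ((ϖ ^ d₀)⁻¹ * (s i₀ - 1) - (ϖ ^ d₀)⁻¹ * (s j - 1)) * (d i₀ * (-(Matrix.diagonal d).det)⁻¹) := by ring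
    rw [h]; exact mul_mem (sub_mem (htO i₀) (htO j)) hdcO
  obtain ⟨z, hz0, hcz⟩ := hCpin ⟨((ϖ ^ d₀)⁻¹ * (s i₀ - s j) * (d i₀ * (-(Matrix.diagonal d).det)⁻¹)), hCO⟩ rfl
  have hχc : quadraticChar 𝓀[K] ((IsLocalRing.residue 𝒪[K] ⟨-c₁, hc₁O⟩)⁻¹ * c) = quadraticChar 𝓀[K] ((IsLocalRing.residue 𝒪[K] ⟨-c₁, hc₁O⟩)⁻¹ * IsLocalRing.residue 𝒪[K] ⟨((ϖ ^ d₀)⁻¹ * (s i₀ - s j) * (d i₀ * (-(Matrix.diagonal d).det)⁻¹)), hCO⟩) := by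
    rw [hcz, ← mul_assoc, map_mul, quadraticChar_sq_one' hz0, mul_one]
  have hlock : (∃ a : K, Valued.v a = 1 ∧ Valued.v (((ϖ ^ d₀)⁻¹ * (s i₀ - s j) * (d i₀ * (-(Matrix.diagonal d).det)⁻¹)) + c₁ * a ^ 2) < 1) ↔ quadraticChar 𝓀[K] ((IsLocalRing.residue 𝒪[K] ⟨-c₁, hc₁O⟩)⁻¹ * c) = 1 := by
    have h := exists_unit_v_sub_mul_sq_lt_one_iff_residue (⟨((ϖ ^ d₀)⁻¹ * (s i₀ - s j) * (d i₀ * (-(Matrix.diagonal d).det)⁻¹)), hCO⟩ : 𝒪[K]) ⟨-c₁, hc₁O⟩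
    rw [hχc, ← exists_eq_mul_sq_iff_quadraticChar_eq_one hnc0]
    refine Iff.trans ?_ h
    refine exists_congr fun a => and_congr_right fun _ => ?_
    rw [show ((⟨((ϖ ^ d₀)⁻¹ * (s i₀ - s j) * (d i₀ * (-(Matrix.diagonal d).det)⁻¹)), hCO⟩ : 𝒪[K]) : K) - ((⟨-c₁, hc₁O⟩ : 𝒪[K]) : K) * a ^ 2 = ((ϖ ^ d₀)⁻¹ * (s i₀ - s j) * (d i₀ * (-(Matrix.diagonal d).det)⁻¹)) + c₁ * a ^ 2 by push_cast; ring]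
  have hc₀c0 : (IsLocalRing.residue 𝒪[K] ⟨-c₁, hc₁O⟩)⁻¹ * c ≠ 0 := mul_ne_zero (inv_ne_zero hnc0) hc0

  have hl : l = 0 := hl0.2 hne
  -- ★ (V2) counts
  have hA2 := ncard_children_null_eq_two_of_shape hσ hvσ hσϖ hϖ hres h2 u ((((u⁻¹ * γ * u : unitaryGroupOfForm σ ((StdForm.antidiagonal 3).over K)) : GL (Fin 3) K) : Matrix (Fin 3) (Fin 3) K) - 1) Y₀ hY₀ hc0 t hl hshape
  have hAP := ncard_children_quadraticChar_eq_of_shape hσ hvσ hσϖ hϖ hres h2 u ((((u⁻¹ * γ * u : unitaryGroupOfForm σ ((StdForm.antidiagonal 3).over K)) : GL (Fin 3) K) : Matrix (Fin 3) (Fin 3) K) - 1) Y₀ hY₀ t hl hshape ((IsLocalRing.residue 𝒪[K] ⟨-c₁, hc₁O⟩)⁻¹) (τ := 1) (Or.inl rfl)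
  have hAM := ncard_children_quadraticChar_eq_of_shape hσ hvσ hσϖ hϖ hres h2 u ((((u⁻¹ * γ * u : unitaryGroupOfForm σ ((StdForm.antidiagonal 3).over K)) : GL (Fin 3) K) : Matrix (Fin 3) (Fin 3) K) - 1) Y₀ hY₀ t hl hshape ((IsLocalRing.residue 𝒪[K] ⟨-c₁, hc₁O⟩)⁻¹) (τ := -1) (Or.inr rfl)
  rw [← hAeq] at hA2
  rw [← hAPeq, ← hq] at hAP
  rw [← hAMeq, ← hq] at hAM
  have hAfin : ({c : {M : Submodule 𝒪[K] (Fin 3 → K) // IsVertex σ ϖ ((StdForm.antidiagonal 3).over K) M} | (latticeGraph σ ϖ ((StdForm.antidiagonal 3).over K)).Adj v c ∧ ∃ κ : unitaryGroupOfForm σ ((StdForm.antidiagonal 3).over K), κ ∈ unitaryInt σ ((StdForm.antidiagonal 3).over K) ∧ c = latticeGraphIso σ ϖ ((StdForm.antidiagonal 3).over K) (u * κ) ⟨latt (Matrix.diagonal ![(1 : K), 1, ϖ]), 2, isVertexLattice_two_N₁_of_neg hσϖ hϖ⟩ ∧ Valued.v ((ϖ ^ d₀)⁻¹ * pairing σ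 ((StdForm.antidiagonal 3).over K) (((κ : GL (Fin 3) K) : Matrix (Fin 3) (Fin 3) K) *ᵥ Pi.single 0 1) (((((u⁻¹ * γ * u : unitaryGroupOfForm σ ((StdForm.antidiagonal 3).over K)) : GL (Fin 3) K) : Matrix (Fin 3) (Fin 3) K) - 1) *ᵥ (((κ : GL (Fin 3) K) : Matrix (Fin 3) (Fin 3) K) *ᵥ Pi.single 0 1))) < 1}).Finite := Set.finite_of_ncard_ne_zero (by rw [hA2]; norm_num)
  refine ⟨?_, ?_, ?_⟩
  · rw [hEeq, Set.ncard_sdiff hRDsub (hAfin.subset hRDsub), hA2, hRD]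
  · rw [hPeq, hAP]
    by_cases hL : (∃ a : K, Valued.v a = 1 ∧ Valued.v (((ϖ ^ d₀)⁻¹ * (s i₀ - s j) * (d i₀ * (-(Matrix.diagonal d).det)⁻¹)) + c₁ * a ^ 2) < 1)
    · rw [if_pos (hlock.1 hL), if_pos hL, mul_one]
    · rw [if_neg (fun h => hL (hlock.2 h)), if_neg hL, mul_zero]
  · rw [hMeq, hAM]
    by_cases hL : (∃ a : K, Valued.v a = 1 ∧ Valued.v (((ϖ ^ d₀)⁻¹ * (s i₀ - s j) * (d i₀ * (-(Matrix.diagonal d).det)⁻¹)) + c₁ * a ^ 2) < 1)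
    · rw [if_neg (by rw [hlock.1 hL]; decide), if_pos hL, mul_zero]
    · have hm1 : quadraticChar 𝓀[K] ((IsLocalRing.residue 𝒪[K] ⟨-c₁, hc₁O⟩)⁻¹ * c) = -1 :=
        (quadraticChar_dichotomy hc₀c0).resolve_left (fun h => hL (hlock.2 h))
      rw [if_pos hm1, if_neg hL, mul_one]

set_option maxHeartbeats 400000 in
/-- **END VALUES.**  At an adapted region vertex `v = u·r₀` with `ϖ^{s'−1}A e_k ∉ v` (an END vertex) and ONE region direction among its children, if ★ (V4)'s outward sets
satisfy the §2 identities, then `#E = 2[BIG]` and `2#P`, `2#M` are `q−3 ∣ q−1 ∣ q−1 ∣ q+1`, `q−1 ∣ q+1 ∣ q−3 ∣ q−1` in the cases `(lock, BIG) = (1,1) ∣ (1,0) ∣ (0,1) ∣ (0,0)`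
(★ (V1) shape with `l ≠ 0`, ★ (V2) END counts, `BIG ⟺ χ(−lc) = 1` and `lock ⟺ χ(c₀c) = 1` by ★ (V1)'s pins). [cite: Kottwitz1986, §3] [cite: Rogawski1990, §4.9 Prop. 4.9.1 p. 55]
[cite: BruhatTits1972, §10] -/
theorem lineCounts_of_end (hσ : ∀ x, σ (σ x) = x) (hvσ : ∀ a, Valued.v (σ a) = Valued.v a) (hσϖ : σ ϖ = -ϖ)
    (hϖ : Valued.v ϖ = WithZero.exp (-1 : ℤ)) (hres : ∀ x : K, Valued.v x ≤ 1 → Valued.v (σ x - x) < 1) (h2 : Valued.v (2 : K) = 1)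
    [Fintype 𝓀[K]] [DecidableEq 𝓀[K]]
    {γ : unitaryGroupOfForm σ ((StdForm.antidiagonal 3).over K)} (d : Fin 3 → K) (hd : ∀ i, Valued.v (d i) = 1) (hdσ : ∀ i, σ (d i) = d i)
    (A : GL (Fin 3) K) (hdA : Matrix.diagonal d = (-(Matrix.diagonal d).det) • formCongr σ A ((StdForm.antidiagonal 3).over K))
    (s : Fin 3 → K) (hγA : ((γ : GL (Fin 3) K) : Matrix (Fin 3) (Fin 3) K) = (A : Matrix (Fin 3) (Fin 3) K) * Matrix.diagonal s * ((A⁻¹ : GL (Fin 3) K) : Matrix (Fin 3) (Fin 3) K))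
    (i₀ : Fin 3) {d₀ : ℕ} (he : ∀ i, Valued.v (s i - 1) ≤ Valued.v ϖ ^ d₀) (hiso : ∀ m, m ≠ i₀ → Valued.v (s i₀ - s m) = Valued.v ϖ ^ d₀)
    {s' : ℕ} (hs' : 1 ≤ s') (hgap : ∀ j k, j ≠ i₀ → k ≠ i₀ → j ≠ k → Valued.v (s j - s k) = Valued.v ϖ ^ (d₀ + 2 * s'))
    {j k : Fin 3} (hj : j ≠ i₀) (hk : k ≠ i₀) (hjk : j ≠ k)
    (c₁ ε : K) (hc₁ : Valued.v c₁ = 1) (hεv : Valued.v ε = 1) (hε : ∀ z : K, Valued.v z ≤ 1 → Valued.v (z ^ 2 - ε) = 1)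
    (q : ℕ) (hq : q = Fintype.card 𝓀[K])
    (u : unitaryGroupOfForm σ ((StdForm.antidiagonal 3).over K)) {v : {M : Submodule 𝒪[K] (Fin 3 → K) // IsVertex σ ϖ ((StdForm.antidiagonal 3).over K) M}} (hvu : v = latticeGraphIso σ ϖ ((StdForm.antidiagonal 3).over K) u ⟨stdLattice K 3, 0, isSelfDualLattice_stdLattice_three_of_v hϖ⟩)
    (hv : IsSelfDualLattice σ ϖ ((StdForm.antidiagonal 3).over K) v.1) (hvR : v.1.map ((Matrix.toLin' (((γ : GL (Fin 3) K) : Matrix (Fin 3) (Fin 3) K) - 1)).restrictScalars 𝒪[K]) ≤ scaleLattice (ϖ ^ d₀) v.1)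
    (hlam : Valued.v (pairing σ ((StdForm.antidiagonal 3).over K) ((A : Matrix (Fin 3) (Fin 3) K) *ᵥ Pi.single i₀ 1) (((u : GL (Fin 3) K) : Matrix (Fin 3) (Fin 3) K) *ᵥ Pi.single 0 1)) < 1) (hmu : Valued.v (pairing σ ((StdForm.antidiagonal 3).over K) (ϖ ^ s' • ((A : Matrix (Fin 3) (Fin 3) K) *ᵥ Pi.single k 1)) (((u : GL (Fin 3) K) : Matrix (Fin 3) (Fin 3) K) *ᵥ Pi.single 0 1)) < 1)
    (hend : ¬ ϖ ^ (s' - 1) • ((A : Matrix (Fin 3) (Fin 3) K) *ᵥ Pi.single k 1) ∈ v.1)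
    (hEeq : {c : {M : Submodule 𝒪[K] (Fin 3 → K) // IsVertex σ ϖ ((StdForm.antidiagonal 3).over K) M} | (latticeGraph σ ϖ ((StdForm.antidiagonal 3).over K)).Adj v c ∧ (latticeGraph σ ϖ ((StdForm.antidiagonal 3).over K)).dist ⟨stdLattice K 3, 0, isSelfDualLattice_stdLattice_three_of_v hϖ⟩ c = (latticeGraph σ ϖ ((StdForm.antidiagonal 3).over K)).dist ⟨stdLattice K 3, 0, isSelfDualLattice_stdLattice_three_of_v hϖ⟩ v + 1 ∧ ∃ κ : unitaryGroupOfForm σ ((StdForm.antidiagonal 3).over K), κ ∈ unitaryInt σ ((StdForm.antidiagonal 3).over K) ∧ c = latticeGraphIso σ ϖ ((StdForm.antidiagonal 3).over K) (u * κ) ⟨latt (Matrix.diagonal ![(1 : K), 1, ϖ]), 2, isVertexLattice_two_N₁_of_neg hσϖ hϖ⟩ ∧ (¬ (Valued.v (pairing σ ((StdForm.antidiagonal 3).over K) ((((u * κ : unitaryGroupOfForm σ ((StdForm.antidiagonal 3).over K)) : GL (Fin 3) K) : Matrix (Fin 3) (Fin 3) K) *ᵥ Pi.single 0 1) ((A :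 Matrix (Fin 3) (Fin 3) K) *ᵥ Pi.single i₀ 1)) < 1 ∧ Valued.v (pairing σ ((StdForm.antidiagonal 3).over K) ((((u * κ : unitaryGroupOfForm σ ((StdForm.antidiagonal 3).over K)) : GL (Fin 3) K) : Matrix (Fin 3) (Fin 3) K) *ᵥ Pi.single 0 1) (ϖ ^ s' • ((A : Matrix (Fin 3) (Fin 3) K) *ᵥ Pi.single k 1))) < 1) ∧ Valued.v ((ϖ ^ d₀)⁻¹ * pairing σ ((StdForm.antidiagonal 3).over K) (((κ : GL (Fin 3) K) : Matrix (Fin 3) (Fin 3) K) *ᵥ Pi.single 0 1) (((((u⁻¹ * γ * u : unitaryGroupOfForm σ ((StdForm.antidiagonal 3).over K)) : GL (Fin 3) K) : Matrix (Fin 3) (Fin 3) K) - 1) *ᵥ (((κ : GL (Fin 3) K) : Matrix (Fin 3) (Fin 3) K) *ᵥ Pi.single 0 1))) < 1)} = {c : {M : Submodule 𝒪[K] (Fin 3 → K) // IsVertex σ ϖ ((StdForm.antidiagonal 3).over K) M} | (latticeGraph σ ϖ ((StdForm.antidiagonal 3).over K)).Adj v c ∧ ∃ κ : unitaryGroupOfForm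 σ ((StdForm.antidiagonal 3).over K), κ ∈ unitaryInt σ ((StdForm.antidiagonal 3).over K) ∧ c = latticeGraphIso σ ϖ ((StdForm.antidiagonal 3).over K) (u * κ) ⟨latt (Matrix.diagonal ![(1 : K), 1, ϖ]), 2, isVertexLattice_two_N₁_of_neg hσϖ hϖ⟩ ∧ Valued.v ((ϖ ^ d₀)⁻¹ * pairing σ ((StdForm.antidiagonal 3).over K) (((κ : GL (Fin 3) K) : Matrix (Fin 3) (Fin 3) K) *ᵥ Pi.single 0 1) (((((u⁻¹ * γ * u : unitaryGroupOfForm σ ((StdForm.antidiagonal 3).over K)) : GL (Fin 3) K) : Matrix (Fin 3) (Fin 3) K) - 1) *ᵥ (((κ : GL (Fin 3) K) : Matrix (Fin 3) (Fin 3) K) *ᵥ Pi.single 0 1))) < 1} \ {c : {M : Submodule 𝒪[K] (Fin 3 → K) // IsVertex σ ϖ ((StdForm.antidiagonal 3).over K) M} | (latticeGraph σ ϖ ((StdForm.antidiagonal 3).over K)).Adj v c ∧ ∃ κ : unitaryGroupOfForm σ ((StdForm.antidiagonal 3).over K), κ ∈ unitaryInt σ ((StdForm.antidiagonal 3).over K)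 ∧ c = latticeGraphIso σ ϖ ((StdForm.antidiagonal 3).over K) (u * κ) ⟨latt (Matrix.diagonal ![(1 : K), 1, ϖ]), 2, isVertexLattice_two_N₁_of_neg hσϖ hϖ⟩ ∧ (Valued.v (pairing σ ((StdForm.antidiagonal 3).over K) ((((u * κ : unitaryGroupOfForm σ ((StdForm.antidiagonal 3).over K)) : GL (Fin 3) K) : Matrix (Fin 3) (Fin 3) K) *ᵥ Pi.single 0 1) ((A : Matrix (Fin 3) (Fin 3) K) *ᵥ Pi.single i₀ 1)) < 1 ∧ Valued.v (pairing σ ((StdForm.antidiagonal 3).over K) ((((u * κ : unitaryGroupOfForm σ ((StdForm.antidiagonal 3).over K)) : GL (Fin 3) K) : Matrix (Fin 3) (Fin 3) K) *ᵥ Pi.single 0 1) (ϖ ^ s' • ((A : Matrix (Fin 3) (Fin 3) K) *ᵥ Pi.single k 1))) < 1)})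
    (hRDsub : {c : {M : Submodule 𝒪[K] (Fin 3 → K) // IsVertex σ ϖ ((StdForm.antidiagonal 3).over K) M} | (latticeGraph σ ϖ ((StdForm.antidiagonal 3).over K)).Adj v c ∧ ∃ κ : unitaryGroupOfForm σ ((StdForm.antidiagonal 3).over K), κ ∈ unitaryInt σ ((StdForm.antidiagonal 3).over K) ∧ c = latticeGraphIso σ ϖ ((StdForm.antidiagonal 3).over K) (u * κ) ⟨latt (Matrix.diagonal ![(1 : K), 1, ϖ]), 2, isVertexLattice_two_N₁_of_neg hσϖ hϖ⟩ ∧ (Valued.v (pairing σ ((StdForm.antidiagonal 3).over K) ((((u * κ : unitaryGroupOfForm σ ((StdForm.antidiagonal 3).over K)) : GL (Fin 3) K) : Matrix (Fin 3) (Fin 3) K) *ᵥ Pi.single 0 1) ((A : Matrix (Fin 3) (Fin 3) K) *ᵥ Pi.single i₀ 1)) < 1 ∧ Valued.v (pairing σ ((StdForm.antidiagonal 3).over K) ((((u * κ : unitaryGroupOfForm σ ((StdForm.antidiagonal 3).over K)) : GL (Fin 3) K) : Matrix (Fin 3) (Fin 3) K) *ᵥ Pi.single 0 1) (ϖ ^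 s' • ((A : Matrix (Fin 3) (Fin 3) K) *ᵥ Pi.single k 1))) < 1)} ⊆ {c : {M : Submodule 𝒪[K] (Fin 3 → K) // IsVertex σ ϖ ((StdForm.antidiagonal 3).over K) M} | (latticeGraph σ ϖ ((StdForm.antidiagonal 3).over K)).Adj v c ∧ ∃ κ : unitaryGroupOfForm σ ((StdForm.antidiagonal 3).over K), κ ∈ unitaryInt σ ((StdForm.antidiagonal 3).over K) ∧ c = latticeGraphIso σ ϖ ((StdForm.antidiagonal 3).over K) (u * κ) ⟨latt (Matrix.diagonal ![(1 : K), 1, ϖ]), 2, isVertexLattice_two_N₁_of_neg hσϖ hϖ⟩ ∧ Valued.v ((ϖ ^ d₀)⁻¹ * pairing σ ((StdForm.antidiagonal 3).over K) (((κ : GL (Fin 3) K) : Matrix (Fin 3) (Fin 3) K) *ᵥ Pi.single 0 1) (((((u⁻¹ * γ * u : unitaryGroupOfForm σ ((StdForm.antidiagonal 3).over K)) : GL (Fin 3) K) : Matrix (Fin 3) (Fin 3) K) - 1) *ᵥ (((κ : GL (Fin 3) K) : Matrix (Fin 3) (Fin 3) K) *ᵥ Pi.single 0 1))) < 1})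
    (hPeq : {c : {M : Submodule 𝒪[K] (Fin 3 → K) // IsVertex σ ϖ ((StdForm.antidiagonal 3).over K) M} | (latticeGraph σ ϖ ((StdForm.antidiagonal 3).over K)).Adj v c ∧ (latticeGraph σ ϖ ((StdForm.antidiagonal 3).over K)).dist ⟨stdLattice K 3, 0, isSelfDualLattice_stdLattice_three_of_v hϖ⟩ c = (latticeGraph σ ϖ ((StdForm.antidiagonal 3).over K)).dist ⟨stdLattice K 3, 0, isSelfDualLattice_stdLattice_three_of_v hϖ⟩ v + 1 ∧ ∃ κ : unitaryGroupOfForm σ ((StdForm.antidiagonal 3).over K), κ ∈ unitaryInt σ ((StdForm.antidiagonal 3).over K) ∧ c = latticeGraphIso σ ϖ ((StdForm.antidiagonal 3).over K) (u * κ) ⟨latt (Matrix.diagonal ![(1 : K), 1, ϖ]), 2, isVertexLattice_two_N₁_of_neg hσϖ hϖ⟩ ∧ (¬ (Valued.v (pairing σ ((StdForm.antidiagonal 3).over K) ((((u * κ : unitaryGroupOfForm σ ((StdForm.antidiagonal 3).over K)) : GL (Fin 3) K) : Matrix (Fin 3) (Fin 3) K) *ᵥ Pi.single 0 1) ((A :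 Matrix (Fin 3) (Fin 3) K) *ᵥ Pi.single i₀ 1)) < 1 ∧ Valued.v (pairing σ ((StdForm.antidiagonal 3).over K) ((((u * κ : unitaryGroupOfForm σ ((StdForm.antidiagonal 3).over K)) : GL (Fin 3) K) : Matrix (Fin 3) (Fin 3) K) *ᵥ Pi.single 0 1) (ϖ ^ s' • ((A : Matrix (Fin 3) (Fin 3) K) *ᵥ Pi.single k 1))) < 1) ∧ ∃ a : K, Valued.v a = 1 ∧ Valued.v (((ϖ ^ d₀)⁻¹ * pairing σ ((StdForm.antidiagonal 3).over K) (((κ : GL (Fin 3) K) : Matrix (Fin 3) (Fin 3) K) *ᵥ Pi.single 0 1) (((((u⁻¹ * γ * u : unitaryGroupOfForm σ ((StdForm.antidiagonal 3).over K)) : GL (Fin 3) K) : Matrix (Fin 3) (Fin 3) K) - 1) *ᵥ (((κ : GL (Fin 3) K) : Matrix (Fin 3) (Fin 3) K) *ᵥ Pi.single 0 1))) - (-c₁) * a ^ 2) < 1)} = {c : {M : Submodule 𝒪[K] (Fin 3 → K) // IsVertex σ ϖ ((StdForm.antidiagonal 3).over K) M} | (latticeGraph σ ϖ ((StdForm.antidiagonal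 3).over K)).Adj v c ∧ ∃ κ : unitaryGroupOfForm σ ((StdForm.antidiagonal 3).over K), κ ∈ unitaryInt σ ((StdForm.antidiagonal 3).over K) ∧ c = latticeGraphIso σ ϖ ((StdForm.antidiagonal 3).over K) (u * κ) ⟨latt (Matrix.diagonal ![(1 : K), 1, ϖ]), 2, isVertexLattice_two_N₁_of_neg hσϖ hϖ⟩ ∧ (∃ a : K, Valued.v a = 1 ∧ Valued.v (((ϖ ^ d₀)⁻¹ * pairing σ ((StdForm.antidiagonal 3).over K) (((κ : GL (Fin 3) K) : Matrix (Fin 3) (Fin 3) K) *ᵥ Pi.single 0 1) (((((u⁻¹ * γ * u : unitaryGroupOfForm σ ((StdForm.antidiagonal 3).over K)) : GL (Fin 3) K) : Matrix (Fin 3) (Fin 3) K) - 1) *ᵥ (((κ : GL (Fin 3) K) : Matrix (Fin 3) (Fin 3) K) *ᵥ Pi.single 0 1))) - (-c₁) * a ^ 2) < 1)})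
    (hMeq : {c : {M : Submodule 𝒪[K] (Fin 3 → K) // IsVertex σ ϖ ((StdForm.antidiagonal 3).over K) M} | (latticeGraph σ ϖ ((StdForm.antidiagonal 3).over K)).Adj v c ∧ (latticeGraph σ ϖ ((StdForm.antidiagonal 3).over K)).dist ⟨stdLattice K 3, 0, isSelfDualLattice_stdLattice_three_of_v hϖ⟩ c = (latticeGraph σ ϖ ((StdForm.antidiagonal 3).over K)).dist ⟨stdLattice K 3, 0, isSelfDualLattice_stdLattice_three_of_v hϖ⟩ v + 1 ∧ ∃ κ : unitaryGroupOfForm σ ((StdForm.antidiagonal 3).over K), κ ∈ unitaryInt σ ((StdForm.antidiagonal 3).over K) ∧ c = latticeGraphIso σ ϖ ((StdForm.antidiagonal 3).over K) (u * κ) ⟨latt (Matrix.diagonal ![(1 : K), 1, ϖ]), 2, isVertexLattice_two_N₁_of_neg hσϖ hϖ⟩ ∧ (¬ (Valued.v (pairing σ ((StdForm.antidiagonal 3).over K) ((((u * κ : unitaryGroupOfForm σ ((StdForm.antidiagonal 3).over K)) : GL (Fin 3) K) : Matrix (Fin 3) (Fin 3) K) *ᵥ Pi.single 0 1) ((A :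 Matrix (Fin 3) (Fin 3) K) *ᵥ Pi.single i₀ 1)) < 1 ∧ Valued.v (pairing σ ((StdForm.antidiagonal 3).over K) ((((u * κ : unitaryGroupOfForm σ ((StdForm.antidiagonal 3).over K)) : GL (Fin 3) K) : Matrix (Fin 3) (Fin 3) K) *ᵥ Pi.single 0 1) (ϖ ^ s' • ((A : Matrix (Fin 3) (Fin 3) K) *ᵥ Pi.single k 1))) < 1) ∧ ∃ a : K, Valued.v a = 1 ∧ Valued.v (((ϖ ^ d₀)⁻¹ * pairing σ ((StdForm.antidiagonal 3).over K) (((κ : GL (Fin 3) K) : Matrix (Fin 3) (Fin 3) K) *ᵥ Pi.single 0 1) (((((u⁻¹ * γ * u : unitaryGroupOfForm σ ((StdForm.antidiagonal 3).over K)) : GL (Fin 3) K) : Matrix (Fin 3) (Fin 3) K) - 1) *ᵥ (((κ : GL (Fin 3) K) : Matrix (Fin 3) (Fin 3) K) *ᵥ Pi.single 0 1))) - (-(c₁ * ε)) * a ^ 2) < 1)} = {c : {M : Submodule 𝒪[K] (Fin 3 → K) // IsVertex σ ϖ ((StdForm.antidiagonal 3).over K) M} | (latticeGraph σ ϖ ((StdForm.antidiagonal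 3).over K)).Adj v c ∧ ∃ κ : unitaryGroupOfForm σ ((StdForm.antidiagonal 3).over K), κ ∈ unitaryInt σ ((StdForm.antidiagonal 3).over K) ∧ c = latticeGraphIso σ ϖ ((StdForm.antidiagonal 3).over K) (u * κ) ⟨latt (Matrix.diagonal ![(1 : K), 1, ϖ]), 2, isVertexLattice_two_N₁_of_neg hσϖ hϖ⟩ ∧ (∃ a : K, Valued.v a = 1 ∧ Valued.v (((ϖ ^ d₀)⁻¹ * pairing σ ((StdForm.antidiagonal 3).over K) (((κ : GL (Fin 3) K) : Matrix (Fin 3) (Fin 3) K) *ᵥ Pi.single 0 1) (((((u⁻¹ * γ * u : unitaryGroupOfForm σ ((StdForm.antidiagonal 3).over K)) : GL (Fin 3) K) : Matrix (Fin 3) (Fin 3) K) - 1) *ᵥ (((κ : GL (Fin 3) K) : Matrix (Fin 3) (Fin 3) K) *ᵥ Pi.single 0 1))) - (-(c₁ * ε)) * a ^ 2) < 1)})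
    (hRD : ({c : {M : Submodule 𝒪[K] (Fin 3 → K) // IsVertex σ ϖ ((StdForm.antidiagonal 3).over K) M} | (latticeGraph σ ϖ ((StdForm.antidiagonal 3).over K)).Adj v c ∧ ∃ κ : unitaryGroupOfForm σ ((StdForm.antidiagonal 3).over K), κ ∈ unitaryInt σ ((StdForm.antidiagonal 3).over K) ∧ c = latticeGraphIso σ ϖ ((StdForm.antidiagonal 3).over K) (u * κ) ⟨latt (Matrix.diagonal ![(1 : K), 1, ϖ]), 2, isVertexLattice_two_N₁_of_neg hσϖ hϖ⟩ ∧ (Valued.v (pairing σ ((StdForm.antidiagonal 3).over K) ((((u * κ : unitaryGroupOfForm σ ((StdForm.antidiagonal 3).over K)) : GL (Fin 3) K) : Matrix (Fin 3) (Fin 3) K) *ᵥ Pi.single 0 1) ((A : Matrix (Fin 3) (Fin 3) K) *ᵥ Pi.single i₀ 1)) < 1 ∧ Valued.v (pairing σ ((StdForm.antidiagonal 3).over K) ((((u * κ : unitaryGroupOfForm σ ((StdForm.antidiagonal 3).over K)) : GL (Fin 3) K) : Matrix (Fin 3) (Fin 3) K) *ᵥ Pi.single 0 1) (ϖ ^ s'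 • ((A : Matrix (Fin 3) (Fin 3) K) *ᵥ Pi.single k 1))) < 1)}).ncard = 1) :
    ({c : {M : Submodule 𝒪[K] (Fin 3 → K) // IsVertex σ ϖ ((StdForm.antidiagonal 3).over K) M} | (latticeGraph σ ϖ ((StdForm.antidiagonal 3).over K)).Adj v c ∧ (latticeGraph σ ϖ ((StdForm.antidiagonal 3).over K)).dist ⟨stdLattice K 3, 0, isSelfDualLattice_stdLattice_three_of_v hϖ⟩ c = (latticeGraph σ ϖ ((StdForm.antidiagonal 3).over K)).dist ⟨stdLattice K 3, 0, isSelfDualLattice_stdLattice_three_of_v hϖ⟩ v + 1 ∧ ∃ κ : unitaryGroupOfForm σ ((StdForm.antidiagonal 3).over K), κ ∈ unitaryInt σ ((StdForm.antidiagonal 3).over K) ∧ c = latticeGraphIso σ ϖ ((StdForm.antidiagonal 3).over K) (u * κ) ⟨latt (Matrix.diagonal ![(1 : K), 1, ϖ]), 2, isVertexLattice_two_N₁_of_neg hσϖ hϖ⟩ ∧ (¬ (Valued.v (pairing σ ((StdForm.antidiagonal 3).over K) ((((u * κ : unitaryGroupOfForm σ ((StdForm.antidiagonal 3).over K)) : GL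 (Fin 3) K) : Matrix (Fin 3) (Fin 3) K) *ᵥ Pi.single 0 1) ((A : Matrix (Fin 3) (Fin 3) K) *ᵥ Pi.single i₀ 1)) < 1 ∧ Valued.v (pairing σ ((StdForm.antidiagonal 3).over K) ((((u * κ : unitaryGroupOfForm σ ((StdForm.antidiagonal 3).over K)) : GL (Fin 3) K) : Matrix (Fin 3) (Fin 3) K) *ᵥ Pi.single 0 1) (ϖ ^ s' • ((A : Matrix (Fin 3) (Fin 3) K) *ᵥ Pi.single k 1))) < 1) ∧ Valued.v ((ϖ ^ d₀)⁻¹ * pairing σ ((StdForm.antidiagonal 3).over K) (((κ : GL (Fin 3) K) : Matrix (Fin 3) (Fin 3) K) *ᵥ Pi.single 0 1) (((((u⁻¹ * γ * u : unitaryGroupOfForm σ ((StdForm.antidiagonal 3).over K)) : GL (Fin 3) K) : Matrix (Fin 3) (Fin 3) K) - 1) *ᵥ (((κ : GL (Fin 3) K) : Matrix (Fin 3) (Fin 3) K) *ᵥ Pi.single 0 1))) < 1)}).ncard = (if (∃ t : K, Valued.v t = 1 ∧ Valued.v (t ^ 2 - ((-1) ^ (s' + 1) * ((ϖ ^ d₀)⁻¹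 * (s i₀ - s j)) * ((ϖ ^ (d₀ + 2 * s'))⁻¹ * (s k - s j)) * (d i₀ * d k))) < 1) then 2 else 0) ∧
    2 * ({c : {M : Submodule 𝒪[K] (Fin 3 → K) // IsVertex σ ϖ ((StdForm.antidiagonal 3).over K) M} | (latticeGraph σ ϖ ((StdForm.antidiagonal 3).over K)).Adj v c ∧ (latticeGraph σ ϖ ((StdForm.antidiagonal 3).over K)).dist ⟨stdLattice K 3, 0, isSelfDualLattice_stdLattice_three_of_v hϖ⟩ c = (latticeGraph σ ϖ ((StdForm.antidiagonal 3).over K)).dist ⟨stdLattice K 3, 0, isSelfDualLattice_stdLattice_three_of_v hϖ⟩ v + 1 ∧ ∃ κ : unitaryGroupOfForm σ ((StdForm.antidiagonal 3).over K), κ ∈ unitaryInt σ ((StdForm.antidiagonal 3).over K) ∧ c = latticeGraphIso σ ϖ ((StdForm.antidiagonal 3).over K) (u * κ) ⟨latt (Matrix.diagonal ![(1 : K), 1, ϖ]), 2, isVertexLattice_two_N₁_of_neg hσϖ hϖ⟩ ∧ (¬ (Valued.v (pairing σ ((StdForm.antidiagonal 3).over K) ((((u * κ : unitaryGroupOfForm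 σ ((StdForm.antidiagonal 3).over K)) : GL (Fin 3) K) : Matrix (Fin 3) (Fin 3) K) *ᵥ Pi.single 0 1) ((A : Matrix (Fin 3) (Fin 3) K) *ᵥ Pi.single i₀ 1)) < 1 ∧ Valued.v (pairing σ ((StdForm.antidiagonal 3).over K) ((((u * κ : unitaryGroupOfForm σ ((StdForm.antidiagonal 3).over K)) : GL (Fin 3) K) : Matrix (Fin 3) (Fin 3) K) *ᵥ Pi.single 0 1) (ϖ ^ s' • ((A : Matrix (Fin 3) (Fin 3) K) *ᵥ Pi.single k 1))) < 1) ∧ ∃ a : K, Valued.v a = 1 ∧ Valued.v (((ϖ ^ d₀)⁻¹ * pairing σ ((StdForm.antidiagonal 3).over K) (((κ : GL (Fin 3) K) : Matrix (Fin 3) (Fin 3) K) *ᵥ Pi.single 0 1) (((((u⁻¹ * γ * u : unitaryGroupOfForm σ ((StdForm.antidiagonal 3).over K)) : GL (Fin 3) K) : Matrix (Fin 3) (Fin 3) K) - 1) *ᵥ (((κ : GL (Fin 3) K) : Matrix (Fin 3) (Fin 3) K) *ᵥ Pi.single 0 1))) - (-c₁) * a ^ 2) < 1)}).ncard = (if (∃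 a : K, Valued.v a = 1 ∧ Valued.v (((ϖ ^ d₀)⁻¹ * (s i₀ - s j) * (d i₀ * (-(Matrix.diagonal d).det)⁻¹)) + c₁ * a ^ 2) < 1) then (if (∃ t : K, Valued.v t = 1 ∧ Valued.v (t ^ 2 - ((-1) ^ (s' + 1) * ((ϖ ^ d₀)⁻¹ * (s i₀ - s j)) * ((ϖ ^ (d₀ + 2 * s'))⁻¹ * (s k - s j)) * (d i₀ * d k))) < 1) then q - 3 else q - 1) else (if (∃ t : K, Valued.v t = 1 ∧ Valued.v (t ^ 2 - ((-1) ^ (s' + 1) * ((ϖ ^ d₀)⁻¹ * (s i₀ - s j)) * ((ϖ ^ (d₀ + 2 * s'))⁻¹ * (s k - s j)) * (d i₀ * d k))) < 1) then q - 1 else q + 1)) ∧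
    2 * ({c : {M : Submodule 𝒪[K] (Fin 3 → K) // IsVertex σ ϖ ((StdForm.antidiagonal 3).over K) M} | (latticeGraph σ ϖ ((StdForm.antidiagonal 3).over K)).Adj v c ∧ (latticeGraph σ ϖ ((StdForm.antidiagonal 3).over K)).dist ⟨stdLattice K 3, 0, isSelfDualLattice_stdLattice_three_of_v hϖ⟩ c = (latticeGraph σ ϖ ((StdForm.antidiagonal 3).over K)).dist ⟨stdLattice K 3, 0, isSelfDualLattice_stdLattice_three_of_v hϖ⟩ v + 1 ∧ ∃ κ : unitaryGroupOfForm σ ((StdForm.antidiagonal 3).over K), κ ∈ unitaryInt σ ((StdForm.antidiagonal 3).over K) ∧ c = latticeGraphIso σ ϖ ((StdForm.antidiagonal 3).over K) (u * κ) ⟨latt (Matrix.diagonal ![(1 : K), 1, ϖ]), 2, isVertexLattice_two_N₁_of_neg hσϖ hϖ⟩ ∧ (¬ (Valued.v (pairing σ ((StdForm.antidiagonal 3).over K) ((((u * κ : unitaryGroupOfForm σ ((StdForm.antidiagonal 3).over K)) : GL (Fin 3) K) : Matrix (Fin 3) (Fin 3) K) *ᵥ Pi.single 0 1) ((A : Matrix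 (Fin 3) (Fin 3) K) *ᵥ Pi.single i₀ 1)) < 1 ∧ Valued.v (pairing σ ((StdForm.antidiagonal 3).over K) ((((u * κ : unitaryGroupOfForm σ ((StdForm.antidiagonal 3).over K)) : GL (Fin 3) K) : Matrix (Fin 3) (Fin 3) K) *ᵥ Pi.single 0 1) (ϖ ^ s' • ((A : Matrix (Fin 3) (Fin 3) K) *ᵥ Pi.single k 1))) < 1) ∧ ∃ a : K, Valued.v a = 1 ∧ Valued.v (((ϖ ^ d₀)⁻¹ * pairing σ ((StdForm.antidiagonal 3).over K) (((κ : GL (Fin 3) K) : Matrix (Fin 3) (Fin 3) K) *ᵥ Pi.single 0 1) (((((u⁻¹ * γ * u : unitaryGroupOfForm σ ((StdForm.antidiagonal 3).over K)) : GL (Fin 3) K) : Matrix (Fin 3) (Fin 3) K) - 1) *ᵥ (((κ : GL (Fin 3) K) : Matrix (Fin 3) (Fin 3) K) *ᵥ Pi.single 0 1))) - (-(c₁ * ε)) * a ^ 2) < 1)}).ncard = (if (∃ a : K, Valued.v a = 1 ∧ Valued.v (((ϖ ^ d₀)⁻¹ * (s i₀ - s j) * (d i₀ * (-(Matrix.diagonal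 d).det)⁻¹)) + c₁ * a ^ 2) < 1) then (if (∃ t : K, Valued.v t = 1 ∧ Valued.v (t ^ 2 - ((-1) ^ (s' + 1) * ((ϖ ^ d₀)⁻¹ * (s i₀ - s j)) * ((ϖ ^ (d₀ + 2 * s'))⁻¹ * (s k - s j)) * (d i₀ * d k))) < 1) then q - 1 else q + 1) else (if (∃ t : K, Valued.v t = 1 ∧ Valued.v (t ^ 2 - ((-1) ^ (s' + 1) * ((ϖ ^ d₀)⁻¹ * (s i₀ - s j)) * ((ϖ ^ (d₀ + 2 * s'))⁻¹ * (s k - s j)) * (d i₀ * d k))) < 1) then q - 3 else q - 1)) := by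
  have hϖ0 : ϖ ≠ 0 := fun h0 => by rw [h0, map_zero] at hϖ; exact WithZero.coe_ne_zero hϖ.symm
  have hvϖ0 : Valued.v ϖ ≠ 0 := (Valuation.ne_zero_iff _).2 hϖ0
  have hres0 : ∀ x : 𝒪[K], IsLocalRing.residue 𝒪[K] x = 0 ↔ Valued.v (x : K) < 1 := residue_eq_zero_iff_v_lt_one
  have hk2 : ringChar 𝓀[K] ≠ 2 := ringChar_residueField_ne_two h2
  -- the integral matrix `Y₀ = (ϖ^d₀)⁻¹(u⁻¹γu − 1)`
  have hY : ∀ a b, Valued.v (((((u⁻¹ * γ * u : unitaryGroupOfForm σ ((StdForm.antidiagonal 3).over K)) : GL (Fin 3) K) : Matrix (Fin 3) (Fin 3) K) - 1) a b) ≤ Valued.v ϖ ^ d₀ := by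
    have h := (forall_v_conj_sub_one_le_iff_map_sub_one_le_scaleLattice γ u (pow_ne_zero d₀ hϖ0)).1 (by rw [hvu] at hvR; exact hvR)
    intro a b; rw [← map_pow]; exact h a b
  obtain ⟨Y₀, hY₀⟩ : ∃ Y₀ : Matrix (Fin 3) (Fin 3) 𝒪[K], ∀ a b, ((Y₀ a b : 𝒪[K]) : K) = (ϖ ^ d₀)⁻¹ * (((((u⁻¹ * γ * u : unitaryGroupOfForm σ ((StdForm.antidiagonal 3).over K)) : GL (Fin 3) K) : Matrix (Fin 3) (Fin 3) K) - 1) a b) := by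
    refine ⟨fun a b => ⟨(ϖ ^ d₀)⁻¹ * (((((u⁻¹ * γ * u : unitaryGroupOfForm σ ((StdForm.antidiagonal 3).over K)) : GL (Fin 3) K) : Matrix (Fin 3) (Fin 3) K) - 1) a b), (Valuation.mem_integer_iff _ _).2 ?_⟩, fun a b => rfl⟩
    rw [map_mul, map_inv₀, map_pow]
    calc (Valued.v ϖ ^ d₀)⁻¹ * Valued.v (((((u⁻¹ * γ * u : unitaryGroupOfForm σ ((StdForm.antidiagonal 3).over K)) : GL (Fin 3) K) : Matrix (Fin 3) (Fin 3) K) - 1) a b) ≤ (Valued.v ϖ ^ d₀)⁻¹ * Valued.v ϖ ^ d₀ := mul_le_mul_right (hY a b) _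
      _ = 1 := inv_mul_cancel₀ (pow_ne_zero _ hvϖ0)
  -- residual constants
  have hc₁O : -c₁ ∈ 𝒪[K] := (Valuation.mem_integer_iff _ _).2 (by rw [Valuation.map_neg]; exact hc₁.le)
  have hεO : ε ∈ 𝒪[K] := (Valuation.mem_integer_iff _ _).2 hεv.le
  have hnc₁v : Valued.v (((⟨-c₁, hc₁O⟩ : 𝒪[K]) : 𝒪[K]) : K) = 1 := by
    show Valued.v (-c₁) = 1
    rw [Valuation.map_neg, hc₁]
  have hnc0 : IsLocalRing.residue 𝒪[K] ⟨-c₁, hc₁O⟩ ≠ 0 := residue_ne_zero_of_v_eq_one _ hnc₁v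
  -- the SHAPE (★ (V1)) and the residue-test spelling (§3)
  obtain ⟨c, t, l, hc0, hshape, hl0, hCpin, hBpin⟩ :=
    isotropicValue_eq_vertexShape_of_region hσ hvσ hσϖ hϖ hres d hd hdσ A hdA s hγA i₀ he hiso hs' hgap hj hk hjk u hvu hv hvR hlam hmu Y₀ hY₀
  obtain ⟨hAeq, hAPeq, hAMeq⟩ := childSets_eq_residueTestSets (γ := γ) hvσ hσϖ hϖ hres c₁ ε hε u hvu Y₀ hY₀ ⟨-c₁, hc₁O⟩ rfl hnc₁v ⟨ε, hεO⟩ rfl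
  -- the ROOT-LINE class constant `C` and `lock ↔ χ(c₀ c) = 1`
  have htO : ∀ m, (ϖ ^ d₀)⁻¹ * (s m - 1) ∈ 𝒪[K] := fun m => by
    refine (Valuation.mem_integer_iff _ _).2 ?_
    rw [map_mul, map_inv₀, map_pow]
    have h' := mul_le_mul' (le_refl ((Valued.v ϖ ^ d₀)⁻¹)) (he m)
    rwa [inv_mul_cancel₀ (pow_ne_zero _ hvϖ0)] at h'
  have hcdet : Valued.v (-(Matrix.diagonal d).det) = 1 := by
    rw [Valuation.map_neg, Matrix.det_diagonal, map_prod]; exact Finset.prod_eq_one fun i _ => hd i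
  have hdcO : d i₀ * (-(Matrix.diagonal d).det)⁻¹ ∈ 𝒪[K] := by
    refine (Valuation.mem_integer_iff _ _).2 ?_
    rw [map_mul, map_inv₀, hd, hcdet, inv_one, mul_one]
  have hCO : ((ϖ ^ d₀)⁻¹ * (s i₀ - s j) * (d i₀ * (-(Matrix.diagonal d).det)⁻¹)) ∈ 𝒪[K] := by
    have h : ((ϖ ^ d₀)⁻¹ * (s i₀ - s j) * (d i₀ * (-(Matrix.diagonal d).det)⁻¹)) = ((ϖ ^ d₀)⁻¹ * (s i₀ - 1) - (ϖ ^ d₀)⁻¹ * (s j - 1)) * (d i₀ * (-(Matrix.diagonal d).det)⁻¹) := by ring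
    rw [h]; exact mul_mem (sub_mem (htO i₀) (htO j)) hdcO
  obtain ⟨z, hz0, hcz⟩ := hCpin ⟨((ϖ ^ d₀)⁻¹ * (s i₀ - s j) * (d i₀ * (-(Matrix.diagonal d).det)⁻¹)), hCO⟩ rfl
  have hχc : quadraticChar 𝓀[K] ((IsLocalRing.residue 𝒪[K] ⟨-c₁, hc₁O⟩)⁻¹ * c) = quadraticChar 𝓀[K] ((IsLocalRing.residue 𝒪[K] ⟨-c₁, hc₁O⟩)⁻¹ * IsLocalRing.residue 𝒪[K] ⟨((ϖ ^ d₀)⁻¹ * (s i₀ - s j) * (d i₀ * (-(Matrix.diagonal d).det)⁻¹)), hCO⟩) := by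
    rw [hcz, ← mul_assoc, map_mul, quadraticChar_sq_one' hz0, mul_one]
  have hlock : (∃ a : K, Valued.v a = 1 ∧ Valued.v (((ϖ ^ d₀)⁻¹ * (s i₀ - s j) * (d i₀ * (-(Matrix.diagonal d).det)⁻¹)) + c₁ * a ^ 2) < 1) ↔ quadraticChar 𝓀[K] ((IsLocalRing.residue 𝒪[K] ⟨-c₁, hc₁O⟩)⁻¹ * c) = 1 := by
    have h := exists_unit_v_sub_mul_sq_lt_one_iff_residue (⟨((ϖ ^ d₀)⁻¹ * (s i₀ - s j) * (d i₀ * (-(Matrix.diagonal d).det)⁻¹)), hCO⟩ : 𝒪[K]) ⟨-c₁, hc₁O⟩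
    rw [hχc, ← exists_eq_mul_sq_iff_quadraticChar_eq_one hnc0]
    refine Iff.trans ?_ h
    refine exists_congr fun a => and_congr_right fun _ => ?_
    rw [show ((⟨((ϖ ^ d₀)⁻¹ * (s i₀ - s j) * (d i₀ * (-(Matrix.diagonal d).det)⁻¹)), hCO⟩ : 𝒪[K]) : K) - ((⟨-c₁, hc₁O⟩ : 𝒪[K]) : K) * a ^ 2 = ((ϖ ^ d₀)⁻¹ * (s i₀ - s j) * (d i₀ * (-(Matrix.diagonal d).det)⁻¹)) + c₁ * a ^ 2 by push_cast; ring]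
  have hc₀c0 : (IsLocalRing.residue 𝒪[K] ⟨-c₁, hc₁O⟩)⁻¹ * c ≠ 0 := mul_ne_zero (inv_ne_zero hnc0) hc0

  have hl : l ≠ 0 := fun h0 => hend (hl0.1 h0)
  have hc₀0 : (IsLocalRing.residue 𝒪[K] ⟨-c₁, hc₁O⟩)⁻¹ ≠ 0 := inv_ne_zero hnc0
  have hq3 : 3 ≤ q := by
    rw [hq]
    have hm1 : (-1 : 𝓀[K]) ≠ 1 := Ring.neg_one_ne_one_of_char_ne_two hk2
    exact Fintype.two_lt_card_iff.2 ⟨0, 1, -1, zero_ne_one, (neg_ne_zero.2 one_ne_zero).symm, hm1.symm⟩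
  -- ★ (V2) END counts (in `ℤ`)
  have hA := ncard_children_null_eq_of_shape_end hσ hvσ hσϖ hϖ hres h2 u ((((u⁻¹ * γ * u : unitaryGroupOfForm σ ((StdForm.antidiagonal 3).over K)) : GL (Fin 3) K) : Matrix (Fin 3) (Fin 3) K) - 1) Y₀ hY₀ hc0 t hl hshape
  have hAP := two_mul_ncard_children_quadraticChar_eq_of_shape_end hσ hvσ hσϖ hϖ hres h2 u ((((u⁻¹ * γ * u : unitaryGroupOfForm σ ((StdForm.antidiagonal 3).over K)) : GL (Fin 3) K) : Matrix (Fin 3) (Fin 3) K) - 1) Y₀ hY₀ hc0 t hl hshape hc₀0 (τ := 1) (Or.inl rfl)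
  have hAM := two_mul_ncard_children_quadraticChar_eq_of_shape_end hσ hvσ hσϖ hϖ hres h2 u ((((u⁻¹ * γ * u : unitaryGroupOfForm σ ((StdForm.antidiagonal 3).over K)) : GL (Fin 3) K) : Matrix (Fin 3) (Fin 3) K) - 1) Y₀ hY₀ hc0 t hl hshape hc₀0 (τ := -1) (Or.inr rfl)
  rw [← hAeq] at hA
  rw [← hAPeq, ← hq] at hAP
  rw [← hAMeq, ← hq] at hAM
  -- the END constant `B` and `BIG ↔ χ(−lc) = 1`
  have hBv : Valued.v ((-1) ^ (s' + 1) * ((ϖ ^ d₀)⁻¹ * (s i₀ - s j)) * ((ϖ ^ (d₀ + 2 * s'))⁻¹ * (s k - s j)) * (d i₀ * d k)) = 1 := by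
    rw [map_mul, map_mul, map_mul, map_pow, Valuation.map_neg, Valuation.map_one, one_pow, one_mul, map_mul, map_inv₀, map_pow, hiso j hj,
      inv_mul_cancel₀ (pow_ne_zero _ hvϖ0), one_mul, map_mul, map_inv₀, map_pow, hgap k j hk hj (Ne.symm hjk), inv_mul_cancel₀ (pow_ne_zero _ hvϖ0), one_mul,
      map_mul, hd, hd, mul_one]
  have hBO : ((-1) ^ (s' + 1) * ((ϖ ^ d₀)⁻¹ * (s i₀ - s j)) * ((ϖ ^ (d₀ + 2 * s'))⁻¹ * (s k - s j)) * (d i₀ * d k)) ∈ 𝒪[K] := (Valuation.mem_integer_iff _ _).2 hBv.le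
  obtain ⟨zB, hzB0, hBz⟩ := hBpin ⟨((-1) ^ (s' + 1) * ((ϖ ^ d₀)⁻¹ * (s i₀ - s j)) * ((ϖ ^ (d₀ + 2 * s'))⁻¹ * (s k - s j)) * (d i₀ * d k)), hBO⟩ rfl hl
  have hlc0 : -(l * c) ≠ 0 := neg_ne_zero.2 (mul_ne_zero hl hc0)
  have hχB : quadraticChar 𝓀[K] (-(l * c)) = quadraticChar 𝓀[K] (IsLocalRing.residue 𝒪[K] ⟨((-1) ^ (s' + 1) * ((ϖ ^ d₀)⁻¹ * (s i₀ - s j)) * ((ϖ ^ (d₀ + 2 * s'))⁻¹ * (s k - s j)) * (d i₀ * d k)), hBO⟩) := by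
    rw [hBz, map_mul, quadraticChar_sq_one' hzB0, mul_one]
  have hbig : (∃ t : K, Valued.v t = 1 ∧ Valued.v (t ^ 2 - ((-1) ^ (s' + 1) * ((ϖ ^ d₀)⁻¹ * (s i₀ - s j)) * ((ϖ ^ (d₀ + 2 * s'))⁻¹ * (s k - s j)) * (d i₀ * d k))) < 1) ↔ quadraticChar 𝓀[K] (-(l * c)) = 1 := by
    have h := exists_unit_v_sub_mul_sq_lt_one_iff_residue (⟨((-1) ^ (s' + 1) * ((ϖ ^ d₀)⁻¹ * (s i₀ - s j)) * ((ϖ ^ (d₀ + 2 * s'))⁻¹ * (s k - s j)) * (d i₀ * d k)), hBO⟩ : 𝒪[K]) 1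
    rw [map_one] at h
    have h1 := exists_eq_mul_sq_iff_quadraticChar_eq_one (one_ne_zero : (1 : 𝓀[K]) ≠ 0) (IsLocalRing.residue 𝒪[K] ⟨((-1) ^ (s' + 1) * ((ϖ ^ d₀)⁻¹ * (s i₀ - s j)) * ((ϖ ^ (d₀ + 2 * s'))⁻¹ * (s k - s j)) * (d i₀ * d k)), hBO⟩)
    rw [inv_one, one_mul] at h1
    have e : ∀ a : K, Valued.v (a ^ 2 - ((-1) ^ (s' + 1) * ((ϖ ^ d₀)⁻¹ * (s i₀ - s j)) * ((ϖ ^ (d₀ + 2 * s'))⁻¹ * (s k - s j)) * (d i₀ * d k))) = Valued.v (((⟨((-1) ^ (s' + 1) * ((ϖ ^ d₀)⁻¹ * (s i₀ - s j)) * ((ϖ ^ (d₀ + 2 * s'))⁻¹ * (s k - s j)) * (d i₀ * d k)), hBO⟩ : 𝒪[K]) : K) - ((1 : 𝒪[K]) : K) * a ^ 2) := fun a => by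
      rw [OneMemClass.coe_one, one_mul, Valuation.map_sub_swap]
    rw [hχB, ← h1, ← h]
    exact exists_congr fun a => and_congr_right fun _ => by rw [e]
  -- the four sign cases
  have hcast : ∀ n : ℕ, ∀ z : ℤ, ((n : ℕ) : ℤ) = z → 0 ≤ z := fun n z h => by rw [← h]; exact Int.natCast_nonneg n
  refine ⟨?_, ?_, ?_⟩
  · -- E
    by_cases hB : (∃ t : K, Valued.v t = 1 ∧ Valued.v (t ^ 2 - ((-1) ^ (s' + 1) * ((ϖ ^ d₀)⁻¹ * (s i₀ - s j)) * ((ϖ ^ (d₀ + 2 * s'))⁻¹ * (s k - s j)) * (d i₀ * d k))) < 1)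
    · have h3 : ({c : {M : Submodule 𝒪[K] (Fin 3 → K) // IsVertex σ ϖ ((StdForm.antidiagonal 3).over K) M} | (latticeGraph σ ϖ ((StdForm.antidiagonal 3).over K)).Adj v c ∧ ∃ κ : unitaryGroupOfForm σ ((StdForm.antidiagonal 3).over K), κ ∈ unitaryInt σ ((StdForm.antidiagonal 3).over K) ∧ c = latticeGraphIso σ ϖ ((StdForm.antidiagonal 3).over K) (u * κ) ⟨latt (Matrix.diagonal ![(1 : K), 1, ϖ]), 2, isVertexLattice_two_N₁_of_neg hσϖ hϖ⟩ ∧ Valued.v ((ϖ ^ d₀)⁻¹ * pairing σ ((StdForm.antidiagonal 3).over K) (((κ : GL (Fin 3) K) : Matrix (Fin 3) (Fin 3) K) *ᵥ Pi.single 0 1) (((((u⁻¹ * γ * u : unitaryGroupOfForm σ ((StdForm.antidiagonal 3).over K)) : GL (Fin 3) K) : Matrix (Fin 3) (Fin 3) K) - 1) *ᵥ (((κ : GL (Fin 3) K) : Matrix (Fin 3) (Fin 3) K) *ᵥ Pi.single 0 1))) < 1}).ncard = 3 := by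
        have h := hA; rw [hbig.1 hB] at h; omega
      have hAfin : ({c : {M : Submodule 𝒪[K] (Fin 3 → K) // IsVertex σ ϖ ((StdForm.antidiagonal 3).over K) M} | (latticeGraph σ ϖ ((StdForm.antidiagonal 3).over K)).Adj v c ∧ ∃ κ : unitaryGroupOfForm σ ((StdForm.antidiagonal 3).over K), κ ∈ unitaryInt σ ((StdForm.antidiagonal 3).over K) ∧ c = latticeGraphIso σ ϖ ((StdForm.antidiagonal 3).over K) (u * κ) ⟨latt (Matrix.diagonal ![(1 : K), 1, ϖ]), 2, isVertexLattice_two_N₁_of_neg hσϖ hϖ⟩ ∧ Valued.v ((ϖ ^ d₀)⁻¹ * pairing σ ((StdForm.antidiagonal 3).over K) (((κ : GL (Fin 3) K) : Matrix (Fin 3) (Fin 3) K) *ᵥ Pi.single 0 1) (((((u⁻¹ * γ * u : unitaryGroupOfForm σ ((StdForm.antidiagonal 3).over K)) : GL (Fin 3) K) : Matrix (Fin 3) (Fin 3) K) - 1) *ᵥ (((κ : GL (Fin 3) K) : Matrix (Fin 3) (Fin 3) K) *ᵥ Pi.single 0 1))) < 1}).Finite := Set.finite_of_ncard_ne_zero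 (by rw [h3]; norm_num)
      rw [hEeq, Set.ncard_sdiff hRDsub (hAfin.subset hRDsub), h3, hRD, if_pos hB]
    · have hm1 : quadraticChar 𝓀[K] (-(l * c)) = -1 := (quadraticChar_dichotomy hlc0).resolve_left (fun h => hB (hbig.2 h))
      have h1 : ({c : {M : Submodule 𝒪[K] (Fin 3 → K) // IsVertex σ ϖ ((StdForm.antidiagonal 3).over K) M} | (latticeGraph σ ϖ ((StdForm.antidiagonal 3).over K)).Adj v c ∧ ∃ κ : unitaryGroupOfForm σ ((StdForm.antidiagonal 3).over K), κ ∈ unitaryInt σ ((StdForm.antidiagonal 3).over K) ∧ c = latticeGraphIso σ ϖ ((StdForm.antidiagonal 3).over K) (u * κ) ⟨latt (Matrix.diagonal ![(1 : K), 1, ϖ]), 2, isVertexLattice_two_N₁_of_neg hσϖ hϖ⟩ ∧ Valued.v ((ϖ ^ d₀)⁻¹ * pairing σ ((StdForm.antidiagonal 3).over K) (((κ : GL (Fin 3) K) : Matrix (Fin 3) (Fin 3) K) *ᵥ Pi.single 0 1) (((((u⁻¹ * γ * u : unitaryGroupOfForm σ ((StdForm.antidiagonal 3).over K)) : GL (Fin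 3) K) : Matrix (Fin 3) (Fin 3) K) - 1) *ᵥ (((κ : GL (Fin 3) K) : Matrix (Fin 3) (Fin 3) K) *ᵥ Pi.single 0 1))) < 1}).ncard = 1 := by
        have h := hA; rw [hm1] at h; omega
      have hAfin : ({c : {M : Submodule 𝒪[K] (Fin 3 → K) // IsVertex σ ϖ ((StdForm.antidiagonal 3).over K) M} | (latticeGraph σ ϖ ((StdForm.antidiagonal 3).over K)).Adj v c ∧ ∃ κ : unitaryGroupOfForm σ ((StdForm.antidiagonal 3).over K), κ ∈ unitaryInt σ ((StdForm.antidiagonal 3).over K) ∧ c = latticeGraphIso σ ϖ ((StdForm.antidiagonal 3).over K) (u * κ) ⟨latt (Matrix.diagonal ![(1 : K), 1, ϖ]), 2, isVertexLattice_two_N₁_of_neg hσϖ hϖ⟩ ∧ Valued.v ((ϖ ^ d₀)⁻¹ * pairing σ ((StdForm.antidiagonal 3).over K) (((κ : GL (Fin 3) K) : Matrix (Fin 3) (Fin 3) K) *ᵥ Pi.single 0 1) (((((u⁻¹ * γ * u : unitaryGroupOfForm σ ((StdForm.antidiagonal 3).over K)) : GL (Fin 3) K) : Matrix (Fin 3)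 (Fin 3) K) - 1) *ᵥ (((κ : GL (Fin 3) K) : Matrix (Fin 3) (Fin 3) K) *ᵥ Pi.single 0 1))) < 1}).Finite := Set.finite_of_ncard_ne_zero (by rw [h1]; norm_num)
      rw [hEeq, Set.ncard_sdiff hRDsub (hAfin.subset hRDsub), h1, hRD, if_neg hB]
  · -- P
    rw [hPeq]
    by_cases hL : (∃ a : K, Valued.v a = 1 ∧ Valued.v (((ϖ ^ d₀)⁻¹ * (s i₀ - s j) * (d i₀ * (-(Matrix.diagonal d).det)⁻¹)) + c₁ * a ^ 2) < 1) <;> by_cases hB : (∃ t : K, Valued.v t = 1 ∧ Valued.v (t ^ 2 - ((-1) ^ (s' + 1) * ((ϖ ^ d₀)⁻¹ * (s i₀ - s j)) * ((ϖ ^ (d₀ + 2 * s'))⁻¹ * (s k - s j)) * (d i₀ * d k))) < 1)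
    · have h := hAP; rw [hlock.1 hL, hbig.1 hB] at h
      rw [if_pos hL, if_pos hB]; omega
    · have h := hAP; rw [hlock.1 hL, (quadraticChar_dichotomy hlc0).resolve_left (fun h => hB (hbig.2 h))] at h
      rw [if_pos hL, if_neg hB]; omega
    · have h := hAP; rw [(quadraticChar_dichotomy hc₀c0).resolve_left (fun h => hL (hlock.2 h)), hbig.1 hB] at h
      rw [if_neg hL, if_pos hB]; omega
    · have h := hAP; rw [(quadraticChar_dichotomy hc₀c0).resolve_left (fun h => hL (hlock.2 h)), (quadraticChar_dichotomy hlc0).resolve_left (fun h => hB (hbig.2 h))] at h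
      rw [if_neg hL, if_neg hB]; omega
  · -- M
    rw [hMeq]
    by_cases hL : (∃ a : K, Valued.v a = 1 ∧ Valued.v (((ϖ ^ d₀)⁻¹ * (s i₀ - s j) * (d i₀ * (-(Matrix.diagonal d).det)⁻¹)) + c₁ * a ^ 2) < 1) <;> by_cases hB : (∃ t : K, Valued.v t = 1 ∧ Valued.v (t ^ 2 - ((-1) ^ (s' + 1) * ((ϖ ^ d₀)⁻¹ * (s i₀ - s j)) * ((ϖ ^ (d₀ + 2 * s'))⁻¹ * (s k - s j)) * (d i₀ * d k))) < 1)
    · have h := hAM; rw [hlock.1 hL, hbig.1 hB] at h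
      rw [if_pos hL, if_pos hB]; omega
    · have h := hAM; rw [hlock.1 hL, (quadraticChar_dichotomy hlc0).resolve_left (fun h => hB (hbig.2 h))] at h
      rw [if_pos hL, if_neg hB]; omega
    · have h := hAM; rw [(quadraticChar_dichotomy hc₀c0).resolve_left (fun h => hL (hlock.2 h)), hbig.1 hB] at h
      rw [if_neg hL, if_pos hB]; omega
    · have h := hAM; rw [(quadraticChar_dichotomy hc₀c0).resolve_left (fun h => hL (hlock.2 h)), (quadraticChar_dichotomy hlc0).resolve_left (fun h => hB (hbig.2 h))] at h
      rw [if_neg hL, if_neg hB]; omega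

end Literature.NumberTheory.Rogawski1990.HyperbolicJunction

end
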